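import Literature.Computability.QuantumComplexity.ZXCalculusTriangleNotCycle
import HarnessLib

/-!
# ZX-calculus: Appendix Lemma 34 (anti-control hanging branch and control-α commute)

Towards **Appendix Lemma 34** of Jeandel–Perdrix–Vilmart (LICS'18) in the `ZX_{π/4}` axiomatisation, along the printed
route (figs. `anti-control-hanging-branch-and-control-alpha-commute-proof-{aux,fin}`): the bending / pendant / ladder
preliminaries, the ladder/aux chain, the plugged ladder and the rule-(C) core `L34_forward` (both sides of Lemma 34 brought
to a common form around an instance of rule (C)). The assembly `ZXClass.L34` is in `ZXCalculusHangingBranchBent`.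
[cite: JeandelPerdrixVilmart2018, Appendix, Lemma 34 and its proof; Fig. 1 rule (C)]
-/

namespace Literature.Computability.QuantumComplexity

open ZXDiagram

namespace ZXClass

/-- `X^{(1,3)}` absorbs a swap of its last two outputs. [cite: JeandelPerdrixVilmart2018, Fig. 1 (S1)] -/
private theorem hb_X_one_three_seq_par_swap : mk (X 1 3 0) ⨟ (mk (wires 1) ⊠ mk swap) = mk (X 1 3 0) := by
  have h := congrArg colorSwap Z_one_three_seq_par_swap
  simpa using h

/-- `X^{(1,2)} ⨾ (X^{(1,2)} ⊗ 𝕀) = X^{(1,3)}`. [cite: JeandelPerdrixVilmart2018, Fig. 1 (S1)] -/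
private theorem hb_xsplit_seq_xsplit_par : mk (X 1 2 0) ⨟ (mk (X 1 2 0) ⊠ mk (wires 1)) = mk (X 1 3 0) := by
  have h := congrArg colorSwap (Z_seq_Z_par 1 1 1 2 le_rfl 0 0)
  simpa using h

/-- Sliding two pieces in turn around a cup. [cite: JeandelPerdrixVilmart2018, §2.2] -/
private theorem hb_cup_slide_seq {P Q P' Q' : ZXClass 1 1} (hP : mk cup ⨟ (mk (wires 1) ⊠ P) = mk cup ⨟ (P' ⊠ mk (wires 1))) (hQ : mk cup ⨟ (mk (wires 1) ⊠ Q) = mk cup ⨟ (Q' ⊠ mk (wires 1))) :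
    mk cup ⨟ (mk (wires 1) ⊠ (P ⨟ Q)) = mk cup ⨟ ((Q' ⨟ P') ⊠ mk (wires 1)) := by
  rw [wires_par_seq, ← seq_assoc, hP, seq_assoc, slide, ← seq_assoc, hQ, seq_assoc, ← seq_par_wires]

/-- A green phase slides around the cup. [cite: JeandelPerdrixVilmart2018, §2.2] -/
private theorem hb_cup_seq_par_phase_comm (a : ZMod 8) : mk cup ⨟ (mk (wires 1) ⊠ mk (Z 1 1 a)) = mk cup ⨟ (mk (Z 1 1 a) ⊠ mk (wires 1)) := by
  rw [cup_seq_par_phase, ← cup_swap, seq_assoc, swap_seq_par_one_one, ← seq_assoc, cup_seq_par_phase, Z_seq_swap]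

/-- The gadget node of the triangle slides around the cup. [cite: JeandelPerdrixVilmart2018, §2.2] -/
private theorem hb_cup_seq_par_gadgetNode : mk cup ⨟ (mk (wires 1) ⊠ (mk (Z 1 2 0) ⨟ (mk (wires 1) ⊠ (mk (X 1 2 0) ⨟ (mk (Z 1 0 (-1)) ⊠ mk (Z 1 0 (-1))))))) = mk cup ⨟ ((mk (Z 1 2 0) ⨟ (mk (wires 1) ⊠ (mk (X 1 2 0) ⨟ (mk (Z 1 0 (-1)) ⊠ mk (Z 1 0 (-1)))))) ⊠ mk (wires 1)) := by
  rw [wires_par_seq, ← seq_assoc, ← Z_zero_three_eq_cup_par_split, seq_par_wires, ← seq_assoc, ← Z_zero_three_eq_cup_split_par,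
    show (mk (wires 1) ⊠ (mk (X 1 2 0) ⨟ (mk (Z 1 0 (-1)) ⊠ mk (Z 1 0 (-1))))) ⊠ mk (wires 1) = mk (wires 1) ⊠ ((mk (X 1 2 0) ⨟ (mk (Z 1 0 (-1)) ⊠ mk (Z 1 0 (-1)))) ⊠ mk (wires 1)) from (par_assoc _ _ _).trans (cast_id _ _ _), ← swap_seq_effect_par, wires_par_seq,
    ← seq_assoc, Z_zero_three_seq_par_swap]

/-- **The triangle slides around the cup as its transpose**: `∪ ⨾ (𝕀 ⊗ T) = ∪ ⨾ (Tᵗ ⊗ 𝕀)`. [cite: JeandelPerdrixVilmart2018, §2.2, §6] -/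
private theorem hb_cup_seq_par_triangle : mk cup ⨟ (mk (wires 1) ⊠ mk triangle) = mk cup ⨟ ((mk triangle).transpose ⊠ mk (wires 1)) := by
  have hT : mk triangle = (mk (Z 1 2 0) ⨟ (mk (wires 1) ⊠ (mk (X 1 2 0) ⨟ (mk (Z 1 0 (-1)) ⊠ mk (Z 1 0 (-1)))))) ⨟ ((mk (xLeafL 0 1) ⨟ mk (Z 1 1 1)) ⨟ mk (X 1 1 2)) := by
    rw [mk_triangle, seq_assoc, seq_assoc, ← seq_assoc (mk (xLeafL 0 1))]
  rw [triangle_transpose_explicit, hT, hb_cup_slide_seq hb_cup_seq_par_gadgetNode (hb_cup_slide_seq (hb_cup_slide_seq (cup_seq_par_xLeafL 1) (hb_cup_seq_par_phase_comm 1)) (cup_seq_par_xphase 2))]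
  simp only [seq_assoc]

/-- The transposed triangle slides around the cup as the triangle. [cite: JeandelPerdrixVilmart2018, §2.2, §6] -/
private theorem hb_cup_seq_par_triangleT : mk cup ⨟ (mk (wires 1) ⊠ (mk triangle).transpose) = mk cup ⨟ (mk triangle ⊠ mk (wires 1)) := by
  rw [← cup_swap, seq_assoc, swap_seq_par_phase, ← seq_assoc, ← hb_cup_seq_par_triangle, seq_assoc, ← swap_seq_par_one_one, ← seq_assoc, cup_swap]

/-- Two states swap. [cite: JeandelPerdrixVilmart2018, §2.2] -/
private theorem hb_states_seq_swap (u v : ZXClass 0 1) : (u ⊠ v) ⨟ mk swap = v ⊠ u := by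
  rw [par_eq_seq_left u v, par_empty, seq_assoc, par_state_seq_swap, par_eq_seq_right v u, empty_par_state]

/-- (B1), green version: `√2 ⊗ (Z^{(0,1)} ⨾ X^{(1,2)}) = Z^{(0,1)} ⊗ Z^{(0,1)}`. [cite: JeandelPerdrixVilmart2018, Fig. 1 (B1)] -/
private theorem hb_rule_B1_green : mk (dumbbell 0 0) ⊠ (mk (Z 0 1 0) ⨟ mk (X 1 2 0)) = mk (Z 0 1 0) ⊠ mk (Z 0 1 0) := by
  have h := congrArg colorSwap rule_B1
  simpa using h

end ZXClass

end Literature.Computability.QuantumComplexity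

/-!
# ZX-calculus, Layer T18: Appendix Lemmas 34 and 35 (the triangle passes through the W-fork)

[cite: JeandelPerdrixVilmart2018, Appendix Lemma 34 (`anti-control-hanging-branch-and-control-alpha-commute`),
Lemma 35 (`lem:n-four`, fig. `ug-and-not-W-commute-simplified`)]; numbering of arXiv:1705.11151v2 (LICS 2018).
Lemma 35 is the identity `F ⨾ (𝕀 ⊗ T) = T ⨾ F` for the W-fork `F` ("triangle through W", axiom (TW) of the
ΔZX-calculus), used throughout Jeandel–Perdrix–Vilmart's normal-form paper (LICS 2019). Proof architecture after the
printed figure chains (`…-proof-aux_00–10`, `…-proof-fin_00–06`, `…-proof-from-new-c1_00–14`), each step transcribed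
as a lemma.
-/

namespace Literature.Computability.QuantumComplexity

open ZXDiagram

namespace ZXClass

/-- The "ladder" state of the auxiliary computation in the proof of Appendix Lemma 34: a red `α` state copied (green),
one copy through `X(α)` into a green node fed by `Z^{(0,1)} ⨾ T` and emitting a triangle towards the red merge of the
other copy; outputs: the green copy of the merge and the red merge of the remaining legs.
[cite: JeandelPerdrixVilmart2018, Appendix, proof of Lemma 34 (fig. `…-proof-aux_00`)] -/
theorem ladderState_wellTyped (a : ZMod 8) :
    (((mk (X 0 1 a) ⨟ mk (Z 1 2 0)) ⊠ (mk (Z 0 1 0) ⨟ mk triangle)) ⨟ ((mk (wires 1) ⊠ mk (X 1 1 a)) ⊠ mk (wires 1))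
      ⨟ (mk (wires 1) ⊠ mk (Z 2 2 0)) ⨟ ((mk (wires 1) ⊠ mk triangle) ⊠ mk (wires 1)) ⨟ (mk (X 2 1 0) ⊠ mk (wires 1))
      ⨟ (mk (Z 1 2 0) ⊠ mk (wires 1)) ⨟ (mk (wires 1) ⊠ mk (X 2 1 0)) : ZXClass 0 2) =
    (((mk (X 0 1 a) ⨟ mk (Z 1 2 0)) ⊠ (mk (Z 0 1 0) ⨟ mk triangle)) ⨟ ((mk (wires 1) ⊠ mk (X 1 1 a)) ⊠ mk (wires 1))
      ⨟ (mk (wires 1) ⊠ mk (Z 2 2 0)) ⨟ ((mk (wires 1) ⊠ mk triangle) ⊠ mk (wires 1)) ⨟ (mk (X 2 1 0) ⊠ mk (wires 1))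
      ⨟ (mk (Z 1 2 0) ⊠ mk (wires 1)) ⨟ (mk (wires 1) ⊠ mk (X 2 1 0))) := rfl

/-! ### Tools -/

/-- `1/√2 ⊗ (√2 ⊗ A) = A`. [cite: JeandelPerdrixVilmart2018, Appendix Lemma 5 (inverse)] -/
theorem invSqrtTwo_par_sqrt_two_par_cancel {n m : ℕ} (A : ZXClass n m) :
    mk invSqrtTwo ⊠ (mk (dumbbell 0 0) ⊠ A) = A.cast (by omega) (by omega) := by
  rw [par_assoc', invSqrtTwo_par_dumbbell, empty_par]
  simp

/-- A red copy followed by a CNOT controlled by one copy and targeting the other detaches a green state: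
`X^{(1,2)} ⨾ (Z^{(1,2)} ⊗ 𝕀) ⨾ (𝕀 ⊗ X^{(2,1)}) = ½ ⊗ (Z^{(0,1)} ⊗ 𝕀)` (bialgebra and Hopf).
[cite: JeandelPerdrixVilmart2018, Fig. 1 (B1), (B2), Appendix (Hopf law)] -/
theorem xsplit_seq_cnot :
    mk (X 1 2 0) ⨟ ((mk (Z 1 2 0) ⊠ mk (wires 1)) ⨟ (mk (wires 1) ⊠ mk (X 2 1 0))) = mk invSqrtTwo ⊠ (mk invSqrtTwo ⊠ (mk (Z 0 1 0) ⊠ mk (wires 1))) := by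
  have hXNC : mk (X 1 2 0) ⨟ ((mk (X 1 2 0) ⊠ mk (wires 1)) ⨟ (mk (wires 1) ⊠ mk (Z 2 1 0))) = mk invSqrtTwo ⊠ (mk invSqrtTwo ⊠ (mk (wires 1) ⊠ mk (Z 0 1 0))) := by
    rw [← seq_assoc, hb_xsplit_seq_xsplit_par, show mk (X 1 3 0) = mk (X 1 2 0) ⨟ (mk (wires 1) ⊠ mk (X 1 2 0)) from by rw [X_seq_par_X 1 1 1 2 le_rfl, add_zero],
      seq_assoc, ← wires_par_seq, xsplit_seq_merge_eq]
    rw [show ∀ (s : ZXClass 0 0) (B : ZXClass 1 1), mk (wires 1) ⊠ (s ⊠ B) = s ⊠ (mk (wires 1) ⊠ B) from fun s B => by rw [scalar_par_wires_par_one],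
      show ∀ (s : ZXClass 0 0) (B : ZXClass 1 1), mk (wires 1) ⊠ (s ⊠ B) = s ⊠ (mk (wires 1) ⊠ B) from fun s B => by rw [scalar_par_wires_par_one],
      show ∀ (A : ZXClass 1 2) (s : ZXClass 0 0) (B : ZXClass 2 2), A ⨟ (s ⊠ B) = s ⊠ (A ⨟ B) from fun A s B => by rw [scalar_par_seq_right, empty_par, cast_id],
      show ∀ (A : ZXClass 1 2) (s : ZXClass 0 0) (B : ZXClass 2 2), A ⨟ (s ⊠ B) = s ⊠ (A ⨟ B) from fun A s B => by rw [scalar_par_seq_right, empty_par, cast_id],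
      wires_par_seq, ← seq_assoc, X_seq_par_X 1 1 1 0 le_rfl, add_zero (0 : ZMod 8), show mk (X 1 (1 + 0) 0) = mk (wires 1) from X_one_one, id_seq]
  have hB1 : mk (Z 0 1 0) ⨟ mk (X 1 2 0) = mk invSqrtTwo ⊠ (mk (Z 0 1 0) ⊠ mk (Z 0 1 0)) := by
    rw [← hb_rule_B1_green, invSqrtTwo_par_sqrt_two_par_cancel, cast_id]
  have hZNC : (mk (Z 0 1 0) ⊠ mk (wires 1)) ⨟ ((mk (X 1 2 0) ⊠ mk (wires 1)) ⨟ (mk (wires 1) ⊠ mk (Z 2 1 0))) = mk invSqrtTwo ⊠ (mk (Z 0 1 0) ⊠ mk (wires 1)) := by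
    rw [← seq_assoc, ← seq_par_wires, hB1, show (mk invSqrtTwo ⊠ (mk (Z 0 1 0) ⊠ mk (Z 0 1 0))) ⊠ mk (wires 1) = mk invSqrtTwo ⊠ (mk (Z 0 1 0) ⊠ (mk (Z 0 1 0) ⊠ mk (wires 1))) from by
        rw [show (mk invSqrtTwo ⊠ (mk (Z 0 1 0) ⊠ mk (Z 0 1 0))) ⊠ mk (wires 1) = mk invSqrtTwo ⊠ ((mk (Z 0 1 0) ⊠ mk (Z 0 1 0)) ⊠ mk (wires 1)) from (par_assoc _ _ _).trans (cast_id _ _ _)]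
        exact congrArg _ ((par_assoc _ _ _).trans (cast_id _ _ _)),
      show ∀ (s : ZXClass 0 0) (A : ZXClass 1 3) (B : ZXClass 3 2), (s ⊠ A) ⨟ B = s ⊠ (A ⨟ B) from fun s A B => by rw [scalar_par_seq_left, empty_par, cast_id],
      interchange, seq_id, Z_par_seq_Z 0 1 1 1 le_rfl, add_zero, Z_one_one]
  rw [rule_B2_cnot, show ∀ (A : ZXClass 1 2) (s : ZXClass 0 0) (B : ZXClass 2 2), A ⨟ (s ⊠ B) = s ⊠ (A ⨟ B) from fun A s B => by rw [scalar_par_seq_right, empty_par, cast_id],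
    ← seq_assoc (mk (X 1 2 0)) (((mk (X 1 2 0) ⊠ mk (wires 1)) ⨟ (mk (wires 1) ⊠ mk (Z 2 1 0))) ⨟ mk swap) ((mk (X 1 2 0) ⊠ mk (wires 1)) ⨟ (mk (wires 1) ⊠ mk (Z 2 1 0))), ← seq_assoc (mk (X 1 2 0)) ((mk (X 1 2 0) ⊠ mk (wires 1)) ⨟ (mk (wires 1) ⊠ mk (Z 2 1 0))) (mk swap), hXNC,
    show ∀ (s : ZXClass 0 0) (A : ZXClass 1 2) (B : ZXClass 2 2), (s ⊠ A) ⨟ B = s ⊠ (A ⨟ B) from fun s A B => by rw [scalar_par_seq_left, empty_par, cast_id],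
    show ∀ (s : ZXClass 0 0) (A : ZXClass 1 2) (B : ZXClass 2 2), (s ⊠ A) ⨟ B = s ⊠ (A ⨟ B) from fun s A B => by rw [scalar_par_seq_left, empty_par, cast_id],
    show ∀ (s : ZXClass 0 0) (A : ZXClass 1 2) (B : ZXClass 2 2), (s ⊠ A) ⨟ B = s ⊠ (A ⨟ B) from fun s A B => by rw [scalar_par_seq_left, empty_par, cast_id],
    show ∀ (s : ZXClass 0 0) (A : ZXClass 1 2) (B : ZXClass 2 2), (s ⊠ A) ⨟ B = s ⊠ (A ⨟ B) from fun s A B => by rw [scalar_par_seq_left, empty_par, cast_id],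
    par_state_seq_swap, hZNC, scalar_par_scalar_par (mk (dumbbell 0 0)) (mk invSqrtTwo), scalar_par_scalar_par (mk (dumbbell 0 0)) (mk invSqrtTwo),
    invSqrtTwo_par_sqrt_two_par_cancel, cast_id]

/-- A green copy with a phase is the phase-free copy followed by the phase on its first output.
[cite: JeandelPerdrixVilmart2018, Fig. 1 (S1)] -/
theorem Z_split_eq_split_seq_phase_par (a : ZMod 8) : mk (Z 1 2 a) = mk (Z 1 2 0) ⨟ (mk (Z 1 1 a) ⊠ mk (wires 1)) := by
  rw [← Z_seq_swap 1 a, show mk (Z 1 2 a) = mk (Z 1 2 0) ⨟ (mk (wires 1) ⊠ mk (Z 1 1 a)) from by rw [Z_seq_par_Z 1 1 1 1 le_rfl, zero_add],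
    seq_assoc, show (mk (wires 1) ⊠ mk (Z 1 1 a)) ⨟ mk swap = mk swap ⨟ (mk (Z 1 1 a) ⊠ mk (wires 1)) from (swap_seq_par_one_one _ _).symm,
    ← seq_assoc, Z_seq_swap]

/-- Last steps of the auxiliary computation of Appendix Lemma 34 (figs. `…-proof-aux_08–10`): the red copy of a green
`α` state, a green `α` copy on one branch and the red merge collapse (Hopf) to two red `α` states:
`√2 ⊗ ((Z(α) ⨾ X^{(1,2)}) ⨾ (Z^{(1,2)}(α) ⊗ 𝕀) ⨾ (H ⊗ (X^{(2,1)} ⨾ H))) = 1/√2 ⊗ (X(α) ⊗ X(α))`.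
[cite: JeandelPerdrixVilmart2018, Appendix, proof of Lemma 34] -/
theorem ladder_tail (a : ZMod 8) :
    mk (dumbbell 0 0) ⊠ (((mk (Z 0 1 a) ⨟ mk (X 1 2 0)) ⨟ (mk (Z 1 2 a) ⊠ mk (wires 1))) ⨟ (mk hBox ⊠ (mk (X 2 1 0) ⨟ mk hBox))) =
      mk invSqrtTwo ⊠ (mk (X 0 1 a) ⊠ mk (X 0 1 a)) := by
  rw [Z_split_eq_split_seq_phase_par, seq_par_wires, show mk hBox ⊠ (mk (X 2 1 0) ⨟ mk hBox) = (mk (wires 1) ⊠ mk (X 2 1 0)) ⨟ (mk hBox ⊠ mk hBox) from by rw [interchange, id_seq],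
    show (mk (Z 1 1 a) ⊠ mk (wires 1)) ⊠ mk (wires 1) = mk (Z 1 1 a) ⊠ mk (wires 2) from by rw [← wires_par_wires 1 1]; exact (par_assoc _ _ _).trans (cast_id _ _ _),
    seq_assoc (mk (Z 0 1 a)), seq_assoc (mk (Z 0 1 a)),
    seq_assoc (mk (X 1 2 0)) ((mk (Z 1 2 0) ⊠ mk (wires 1)) ⨟ (mk (Z 1 1 a) ⊠ mk (wires 2))), seq_assoc (mk (Z 1 2 0) ⊠ mk (wires 1)) (mk (Z 1 1 a) ⊠ mk (wires 2)),
    ← seq_assoc (mk (Z 1 1 a) ⊠ mk (wires 2)) (mk (wires 1) ⊠ mk (X 2 1 0)) (mk hBox ⊠ mk hBox),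
    show (mk (Z 1 1 a) ⊠ mk (wires 2)) ⨟ (mk (wires 1) ⊠ mk (X 2 1 0)) = (mk (wires 1) ⊠ mk (X 2 1 0)) ⨟ (mk (Z 1 1 a) ⊠ mk (wires 1)) from by rw [interchange, id_seq, seq_id, interchange, id_seq, seq_id],
    seq_assoc (mk (wires 1) ⊠ mk (X 2 1 0)) (mk (Z 1 1 a) ⊠ mk (wires 1)) (mk hBox ⊠ mk hBox), ← seq_assoc (mk (Z 1 2 0) ⊠ mk (wires 1)) (mk (wires 1) ⊠ mk (X 2 1 0)),
    ← seq_assoc (mk (X 1 2 0)) ((mk (Z 1 2 0) ⊠ mk (wires 1)) ⨟ (mk (wires 1) ⊠ mk (X 2 1 0))), xsplit_seq_cnot,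
    show (mk (Z 1 1 a) ⊠ mk (wires 1)) ⨟ (mk hBox ⊠ mk hBox) = (mk (Z 1 1 a) ⨟ mk hBox) ⊠ mk hBox from by rw [interchange, id_seq],
    show ∀ (s : ZXClass 0 0) (A : ZXClass 1 2) (B : ZXClass 2 2), (s ⊠ A) ⨟ B = s ⊠ (A ⨟ B) from fun s A B => by rw [scalar_par_seq_left, empty_par, cast_id],
    show ∀ (s : ZXClass 0 0) (A : ZXClass 1 2) (B : ZXClass 2 2), (s ⊠ A) ⨟ B = s ⊠ (A ⨟ B) from fun s A B => by rw [scalar_par_seq_left, empty_par, cast_id],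
    show ∀ (A : ZXClass 0 1) (s : ZXClass 0 0) (B : ZXClass 1 2), A ⨟ (s ⊠ B) = s ⊠ (A ⨟ B) from fun A s B => by rw [scalar_par_seq_right, empty_par, cast_id],
    show ∀ (A : ZXClass 0 1) (s : ZXClass 0 0) (B : ZXClass 1 2), A ⨟ (s ⊠ B) = s ⊠ (A ⨟ B) from fun A s B => by rw [scalar_par_seq_right, empty_par, cast_id],
    ← seq_assoc (mk (Z 0 1 a)), show mk (Z 0 1 a) ⨟ (mk (Z 0 1 0) ⊠ mk (wires 1)) = mk (Z 0 1 0) ⊠ mk (Z 0 1 a) from by rw [par_eq_seq_right (mk (Z 0 1 0)) (mk (Z 0 1 a)), empty_par, cast_id],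
    interchange, ← seq_assoc, Z_seq_Z 0 1 1 le_rfl, zero_add a, Z_state_seq_hBox,
    scalar_par_scalar_par (mk (dumbbell 0 0)) (mk invSqrtTwo), invSqrtTwo_par_sqrt_two_par_cancel, cast_id]

/-- The two hanging gadgets of the auxiliary computation of Appendix Lemma 34 (a red node with two `-π/4` leaves,
once plain and once with a `π`) vanish from a green node on a wire (supplementarity):
`(𝕀 ⊗ ((S ⨾ X^{(2,1)}) ⊗ (S ⨾ X^{(2,1)}(π)) ⨾ Z^{(2,1)})) ⨾ Z^{(2,1)} = db(π,-π/2) ⊗ 𝕀`, `S = Z(-π/4) ⊗ Z(-π/4)`.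
[cite: JeandelPerdrixVilmart2018, Appendix Lemma 19, proof of Lemma 34 (figs. `…-proof-aux_07/08`)] -/
theorem wire_par_gadgets_seq_merge :
    (mk (wires 1) ⊠ ((((mk (Z 0 1 (-1)) ⊠ mk (Z 0 1 (-1))) ⨟ mk (X 2 1 0)) ⊠ ((mk (Z 0 1 (-1)) ⊠ mk (Z 0 1 (-1))) ⨟ mk (X 2 1 4))) ⨟ mk (Z 2 1 0))) ⨟ mk (Z 2 1 0) = mk (dumbbell 4 (-2)) ⊠ mk (wires 1) := by
  rw [supp_to_minus_pi_4, show mk (wires 1) ⊠ (mk (dumbbell 4 (-2)) ⊠ mk (Z 0 1 0)) = mk (dumbbell 4 (-2)) ⊠ (mk (wires 1) ⊠ mk (Z 0 1 0)) from by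
      rw [show mk (wires 1) ⊠ (mk (dumbbell 4 (-2)) ⊠ mk (Z 0 1 0)) = (mk (wires 1) ⊠ mk (dumbbell 4 (-2))) ⊠ mk (Z 0 1 0) from (par_assoc' _ _ _).trans (cast_id _ _ _),
        ← scalar_par_wires]; exact (par_assoc _ _ _).trans (cast_id _ _ _),
    show ∀ (s : ZXClass 0 0) (A : ZXClass 1 2) (B : ZXClass 2 1), (s ⊠ A) ⨟ B = s ⊠ (A ⨟ B) from fun s A B => by rw [scalar_par_seq_left, empty_par, cast_id],
    par_Z_seq_Z 1 0 1 1 le_rfl, add_zero (0 : ZMod 8), show mk (Z (1 + 0) 1 0) = mk (wires 1) from Z_one_one]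

/-- Scalars are symmetric: `(1/√2)ᵗ = 1/√2`. [cite: JeandelPerdrixVilmart2018, §2.2] -/
theorem transpose_invSqrtTwo : (mk invSqrtTwo).transpose = mk invSqrtTwo := by
  rw [show mk invSqrtTwo = mk (Z 0 3 0) ⨟ mk (X 3 0 0) from rfl, transpose_seq, transpose_mk, transpose_mk, ZXDiagram.transpose_Z,
    ZXDiagram.transpose_X, ← invSqrtTwo_eq_red]; rfl

/-- The red `π/2` effect in green (transpose of `X_state_two`). [cite: JeandelPerdrixVilmart2018, Appendix Lemma 10] -/
theorem X_effect_two : mk (X 1 0 2) = mk invSqrtTwo ⊠ (mk (Z 0 0 2) ⊠ mk (Z 1 0 (-2))) := by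
  have h := congrArg transpose X_state_two
  rw [transpose_mk, ZXDiagram.transpose_X, transpose_par, transpose_par, transpose_invSqrtTwo, transpose_mk, transpose_mk,
    ZXDiagram.transpose_Z, ZXDiagram.transpose_Z] at h
  exact h

/-- The pendant state of fig. `…-proof-aux_06` (a green `π/4` state with a red `π/2` leaf, then a red `π` node with a
green `π/4` leaf) is the hanging gadget of fig. `…-proof-aux_07` (a red node with two green `-π/4` leaves), up to scalars.
[cite: JeandelPerdrixVilmart2018, Appendix Lemmas 10, 17, proof of Lemma 34] -/
theorem halfpi_pendant_state :
    (mk (Z 0 2 1) ⨟ (mk (wires 1) ⊠ mk (X 1 0 2))) ⨟ mk (xLeafL 4 1) =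
      mk invSqrtTwo ⊠ (mk (Z 0 0 2) ⊠ (mk invSqrtTwo ⊠ (mk (dumbbell 4 1) ⊠ ((mk (Z 0 1 (-1)) ⊠ mk (Z 0 1 (-1))) ⨟ mk (X 2 1 0))))) := by
  have hL : mk (xLeafL 4 1) = mk invSqrtTwo ⊠ (mk (dumbbell 4 1) ⊠ mk (xLeafL 0 (-1))) := by
    have h := congrArg (mk invSqrtTwo ⊠ ·) (dumbbell_four_par_xLeafL_neg 0 1)
    simp only [invSqrtTwo_par_sqrt_two_par_cancel, cast_id, show (0 : ZMod 8) + 4 = 4 from by decide] at h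
    exact h.symm
  rw [X_effect_two, show mk (wires 1) ⊠ (mk invSqrtTwo ⊠ (mk (Z 0 0 2) ⊠ mk (Z 1 0 (-2)))) = mk invSqrtTwo ⊠ (mk (Z 0 0 2) ⊠ (mk (wires 1) ⊠ mk (Z 1 0 (-2)))) from by
      rw [scalar_par_wires_par_one_zero, scalar_par_wires_par_one_zero],
    show ∀ (A : ZXClass 0 2) (s : ZXClass 0 0) (B : ZXClass 2 1), A ⨟ (s ⊠ B) = s ⊠ (A ⨟ B) from fun A s B => by rw [scalar_par_seq_right, empty_par, cast_id],
    show ∀ (A : ZXClass 0 2) (s : ZXClass 0 0) (B : ZXClass 2 1), A ⨟ (s ⊠ B) = s ⊠ (A ⨟ B) from fun A s B => by rw [scalar_par_seq_right, empty_par, cast_id],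
    Z_seq_par_Z 0 1 1 0 le_rfl, show (1 : ZMod 8) + -2 = -1 from by decide,
    show ∀ (s : ZXClass 0 0) (A : ZXClass 0 1) (B : ZXClass 1 1), (s ⊠ A) ⨟ B = s ⊠ (A ⨟ B) from fun s A B => by rw [scalar_par_seq_left, empty_par, cast_id],
    show ∀ (s : ZXClass 0 0) (A : ZXClass 0 1) (B : ZXClass 1 1), (s ⊠ A) ⨟ B = s ⊠ (A ⨟ B) from fun s A B => by rw [scalar_par_seq_left, empty_par, cast_id],
    hL, show ∀ (A : ZXClass 0 1) (s : ZXClass 0 0) (B : ZXClass 1 1), A ⨟ (s ⊠ B) = s ⊠ (A ⨟ B) from fun A s B => by rw [scalar_par_seq_right, empty_par, cast_id],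
    show ∀ (A : ZXClass 0 1) (s : ZXClass 0 0) (B : ZXClass 1 1), A ⨟ (s ⊠ B) = s ⊠ (A ⨟ B) from fun A s B => by rw [scalar_par_seq_right, empty_par, cast_id],
    ← Z_state_par_seq_X_merge (-1) 0, ← seq_assoc, show mk (Z 0 (1 + 0) (-1)) ⨟ (mk (Z 0 1 (-1)) ⊠ mk (wires 1)) = mk (Z 0 1 (-1)) ⊠ mk (Z 0 1 (-1)) from by
      rw [par_eq_seq_right (mk (Z 0 1 (-1))) (mk (Z 0 1 (-1))), empty_par, cast_id]]

/-- A red merge bent into a red copy: `(∪ ⊗ 𝕀) ⨾ (𝕀 ⊗ X^{(2,1)}) = X^{(1,2)}`. [cite: JeandelPerdrixVilmart2018, §2.2] -/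
theorem xspider_bend : (mk cup ⊠ mk (wires 1)) ⨟ (mk (wires 1) ⊠ mk (X 2 1 0)) = mk (X 1 2 0) := by
  have h := congrArg transpose par_xsplit_seq_cap_par
  rw [transpose_seq, transpose_par, transpose_par, transpose_mk, transpose_mk, transpose_mk, transpose_mk, ZXDiagram.transpose_wires,
    ZXDiagram.transpose_X, ZXDiagram.transpose_cap, ZXDiagram.transpose_X] at h
  exact h

/-- A green state fed into a red copy is the bent leaf: `Z(α) ⨾ X^{(1,2)} = ∪ ⨾ (xLeafL 0 α ⊗ 𝕀)`.
[cite: JeandelPerdrixVilmart2018, §2.2] -/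
theorem Z_state_seq_xsplit_eq_cup (a : ZMod 8) : mk (Z 0 1 a) ⨟ mk (X 1 2 0) = mk cup ⨟ (mk (xLeafL 0 a) ⊠ mk (wires 1)) := by
  rw [← xspider_bend, ← seq_assoc, show mk (Z 0 1 a) ⨟ (mk cup ⊠ mk (wires 1)) = mk cup ⊠ mk (Z 0 1 a) from by rw [par_eq_seq_right (mk cup) (mk (Z 0 1 a)), empty_par, cast_id],
    show mk cup ⊠ mk (Z 0 1 a) = mk cup ⨟ (mk (wires 1) ⊠ (mk (wires 1) ⊠ mk (Z 0 1 a))) from by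
      rw [par_eq_seq_left (mk cup) (mk (Z 0 1 a)), par_empty, ← wires_par_wires 1 1]; exact congrArg _ ((par_assoc _ _ _).trans (cast_id _ _ _)),
    seq_assoc, ← wires_par_seq, par_Z_state_seq_X_merge, cup_seq_par_xLeafL]

/-- The state of fig. `…-proof-aux_05/06` read two ways (only the topology differs): a green `α` pair whose second leg
carries a red node with a green `α` leaf equals a green `α` state copied red with a green `α` phase on the first copy.
[cite: JeandelPerdrixVilmart2018, §2.2, proof of Appendix Lemma 34] -/
theorem Z_pair_par_xLeafL_eq (a : ZMod 8) :
    mk (Z 0 2 a) ⨟ (mk (wires 1) ⊠ mk (xLeafL 0 a)) = (mk (Z 0 1 a) ⨟ mk (X 1 2 0)) ⨟ (mk (Z 1 1 a) ⊠ mk (wires 1)) := by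
  rw [Z_zero_two_eq_cup_par_phase, seq_assoc, ← wires_par_seq, hb_cup_slide_seq (hb_cup_seq_par_phase_comm a) (cup_seq_par_xLeafL a),
    Z_state_seq_xsplit_eq_cup, seq_assoc, ← seq_par_wires]

/-- **Fusion across a rung (Frobenius layout)**: `(Z^{(1,2)}(b) ⊗ 𝕀) ⨾ (𝕀 ⊗ Z^{(2,1)}(a)) = Z^{(2,2)}(b+a)`.
[cite: JeandelPerdrixVilmart2018, Fig. 1 (S1)] -/
theorem Z_ladder (a b : ZMod 8) : (mk (Z 1 2 b) ⊠ mk (wires 1)) ⨟ (mk (wires 1) ⊠ mk (Z 2 1 a)) = mk (Z 2 2 (b + a)) := by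
  have h := fusion 1 1 1 1 1 le_rfl b a
  rw [show ofEq (Nat.add_assoc 1 1 1) = mk (wires 3) from rfl, seq_id] at h
  exact h

/-- The mirrored rung: `(𝕀 ⊗ Z^{(1,2)}(b)) ⨾ (Z^{(2,1)}(a) ⊗ 𝕀) = Z^{(2,2)}(b+a)` (transpose of `Z_ladder`).
[cite: JeandelPerdrixVilmart2018, Fig. 1 (S1)] -/
theorem Z_ladder' (a b : ZMod 8) : (mk (wires 1) ⊠ mk (Z 1 2 b)) ⨟ (mk (Z 2 1 a) ⊠ mk (wires 1)) = mk (Z 2 2 (b + a)) := by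
  have h := congrArg transpose (Z_ladder b a)
  rw [transpose_seq, transpose_par, transpose_par, transpose_mk, transpose_mk, transpose_mk, transpose_mk, ZXDiagram.transpose_Z,
    ZXDiagram.transpose_Z, ZXDiagram.transpose_wires, ZXDiagram.transpose_Z, add_comm a b] at h
  exact h

/-- The red mirrored rung: `(𝕀 ⊗ X^{(1,2)}(b)) ⨾ (X^{(2,1)}(a) ⊗ 𝕀) = X^{(2,2)}(b+a)`. [cite: JeandelPerdrixVilmart2018, Fig. 1 (S1), (H)] -/
theorem X_ladder' (a b : ZMod 8) : (mk (wires 1) ⊠ mk (X 1 2 b)) ⨟ (mk (X 2 1 a) ⊠ mk (wires 1)) = mk (X 2 2 (b + a)) := by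
  have h := congrArg colorSwap (Z_ladder' a b)
  simpa using h

/-- `H ⨾ Z^{(1,2)}(α) = X^{(1,2)}(α) ⨾ (H ⊗ H)`. [cite: JeandelPerdrixVilmart2018, Fig. 1 (H)] -/
theorem hBox_seq_Z_split (a : ZMod 8) : mk hBox ⨟ mk (Z 1 2 a) = mk (X 1 2 a) ⨟ (mk hBox ⊠ mk hBox) := by
  rw [X_split_eq, seq_assoc, seq_assoc, interchange, hBox_seq_hBox, wires_par_wires, seq_id]

/-- `X^{(0,2)}(α) ⨾ (H ⊗ H) = Z^{(0,2)}(α)`. [cite: JeandelPerdrixVilmart2018, Fig. 1 (H)] -/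
theorem X_pair_seq_hBoxes (a : ZMod 8) : mk (X 0 2 a) ⨟ (mk hBox ⊠ mk hBox) = mk (Z 0 2 a) := by
  rw [← rule_H 0 2 a, hTensor_zero, hTensor_two, id_seq]

/-- The Hopf cut in the proof of Appendix Lemma 34 (figs. `…-proof-aux_05/06`): two legs of a green `c` state reach
the same red node (one directly, one through the colour-changed `α` copy) and are cut:
`Z^{(0,3)}(c) ⨾ ((𝕀 ⊗ (H ⨾ Z^{(1,2)}(α))) ⊗ 𝕀) ⨾ ((𝕀 ⊗ (H ⊗ xLeafL 0 α)) ⊗ 𝕀) ⨾ ((X^{(2,1)} ⊗ 𝕀) ⊗ 𝕀) ⨾ ((H ⊗ 𝕀) ⊗ 𝕀)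
 = ½ ⊗ (((Z(α) ⨾ X^{(1,2)}) ⨾ (Z(α) ⊗ 𝕀)) ⊗ Z(c))`. [cite: JeandelPerdrixVilmart2018, Appendix (Hopf law), proof of Lemma 34] -/
theorem zphase_branch_hopf (a c : ZMod 8) :
    mk (Z 0 3 c) ⨟ ((mk (wires 1) ⊠ (mk hBox ⨟ mk (Z 1 2 a))) ⊠ mk (wires 1)) ⨟ ((mk (wires 1) ⊠ (mk hBox ⊠ mk (xLeafL 0 a))) ⊠ mk (wires 1)) ⨟ ((mk (X 2 1 0) ⊠ mk (wires 1)) ⊠ mk (wires 1))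
        ⨟ ((mk hBox ⊠ mk (wires 1)) ⊠ mk (wires 1)) = mk invSqrtTwo ⊠ (mk invSqrtTwo ⊠ (((mk (Z 0 1 a) ⨟ mk (X 1 2 0)) ⨟ (mk (Z 1 1 a) ⊠ mk (wires 1))) ⊠ mk (Z 0 1 c))) := by
  -- the `2 → 2` block on the first two legs is a red `2 → 2` spider followed by the Hadamards
  have hM : (mk (wires 1) ⊠ (mk hBox ⨟ mk (Z 1 2 a))) ⨟ ((mk (wires 1) ⊠ (mk hBox ⊠ mk (xLeafL 0 a))) ⨟ ((mk (X 2 1 0) ⊠ mk (wires 1)) ⨟ (mk hBox ⊠ mk (wires 1)))) =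
      mk (X 2 2 a) ⨟ (mk hBox ⊠ (mk hBox ⨟ mk (xLeafL 0 a))) := by
    rw [hBox_seq_Z_split, wires_par_seq, seq_assoc, ← seq_assoc (mk (wires 1) ⊠ (mk hBox ⊠ mk hBox)), ← wires_par_seq, interchange, hBox_seq_hBox,
      show mk (wires 1) ⊠ (mk (wires 1) ⊠ (mk hBox ⨟ mk (xLeafL 0 a))) = mk (wires 2) ⊠ (mk hBox ⨟ mk (xLeafL 0 a)) from by rw [← wires_par_wires 1 1]; exact (par_assoc' _ _ _).trans (cast_id _ _ _),
      ← seq_assoc (mk (wires 2) ⊠ (mk hBox ⨟ mk (xLeafL 0 a))), show (mk (wires 2) ⊠ (mk hBox ⨟ mk (xLeafL 0 a))) ⨟ (mk (X 2 1 0) ⊠ mk (wires 1)) = mk (X 2 1 0) ⊠ (mk hBox ⨟ mk (xLeafL 0 a)) from by rw [interchange, id_seq, seq_id],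
      show (mk (X 2 1 0) ⊠ (mk hBox ⨟ mk (xLeafL 0 a))) ⨟ (mk hBox ⊠ mk (wires 1)) = (mk (X 2 1 0) ⊠ mk (wires 1)) ⨟ (mk hBox ⊠ (mk hBox ⨟ mk (xLeafL 0 a))) from by rw [interchange, seq_id, interchange, id_seq],
      ← seq_assoc, X_ladder' 0 a, add_zero]
  have hZ3 : mk (Z 0 3 c) = mk (Z 0 2 c) ⨟ (mk (Z 1 2 0) ⊠ mk (wires 1)) := by rw [Z_seq_Z_par 0 1 1 2 le_rfl, zero_add]
  have hX22 : mk (X 2 2 a) = mk (X 2 1 0) ⨟ mk (X 1 2 a) := by rw [X_seq_X 2 1 2 le_rfl, zero_add]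
  have hcut : (mk (Z 1 2 0) ⊠ mk (wires 1)) ⨟ (mk (X 2 1 0) ⊠ mk (wires 1)) = mk invSqrtTwo ⊠ (mk invSqrtTwo ⊠ (((mk (Z 1 0 0) ⊠ mk (wires 1)) ⨟ (mk (X 0 1 0) ⊠ mk (wires 1))))) := by
    rw [← seq_par_wires, split_seq_xmerge_eq_disconnect,
      show ∀ (s : ZXClass 0 0) (A : ZXClass 1 1), (s ⊠ A) ⊠ mk (wires 1) = s ⊠ (A ⊠ mk (wires 1)) from fun s A => (par_assoc _ _ _).trans (cast_id _ _ _),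
      show ∀ (s : ZXClass 0 0) (A : ZXClass 1 1), (s ⊠ A) ⊠ mk (wires 1) = s ⊠ (A ⊠ mk (wires 1)) from fun s A => (par_assoc _ _ _).trans (cast_id _ _ _),
      seq_par_wires]
  have hstate : mk (Z 0 2 c) ⨟ ((mk (Z 1 0 0) ⊠ mk (wires 1)) ⨟ (mk (X 0 1 0) ⊠ mk (wires 1))) = mk (X 0 1 0) ⊠ mk (Z 0 1 c) := by
    rw [← seq_assoc, Z_seq_Z_par 0 1 1 0 le_rfl, zero_add c, par_eq_seq_right (mk (X 0 1 0)) (mk (Z 0 1 c)), empty_par, cast_id]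
  have htail : (mk (X 0 1 0) ⊠ mk (Z 0 1 c)) ⨟ ((mk (X 1 2 a) ⊠ mk (wires 1)) ⨟ ((mk hBox ⊠ (mk hBox ⨟ mk (xLeafL 0 a))) ⊠ mk (wires 1))) = ((mk (Z 0 1 a) ⨟ mk (X 1 2 0)) ⨟ (mk (Z 1 1 a) ⊠ mk (wires 1))) ⊠ mk (Z 0 1 c) := by
    rw [← seq_par_wires, interchange, seq_id, ← seq_assoc, X_seq_X 0 1 2 le_rfl, zero_add a,
      show mk hBox ⊠ (mk hBox ⨟ mk (xLeafL 0 a)) = (mk hBox ⊠ mk hBox) ⨟ (mk (wires 1) ⊠ mk (xLeafL 0 a)) from by rw [interchange, seq_id], ← seq_assoc, X_pair_seq_hBoxes, Z_pair_par_xLeafL_eq]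
  simp only [seq_assoc]
  rw [← seq_par_wires, ← seq_par_wires, ← seq_par_wires, hM, seq_par_wires, hX22, seq_par_wires, hZ3, seq_assoc,
    seq_assoc (mk (X 2 1 0) ⊠ mk (wires 1)) (mk (X 1 2 a) ⊠ mk (wires 1)), ← seq_assoc (mk (Z 1 2 0) ⊠ mk (wires 1)) (mk (X 2 1 0) ⊠ mk (wires 1)), hcut,
    show ∀ (s : ZXClass 0 0) (A : ZXClass 2 2) (B : ZXClass 2 3), (s ⊠ A) ⨟ B = s ⊠ (A ⨟ B) from fun s A B => by rw [scalar_par_seq_left, empty_par, cast_id],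
    show ∀ (s : ZXClass 0 0) (A : ZXClass 2 2) (B : ZXClass 2 3), (s ⊠ A) ⨟ B = s ⊠ (A ⨟ B) from fun s A B => by rw [scalar_par_seq_left, empty_par, cast_id],
    show ∀ (A : ZXClass 0 2) (s : ZXClass 0 0) (B : ZXClass 2 3), A ⨟ (s ⊠ B) = s ⊠ (A ⨟ B) from fun A s B => by rw [scalar_par_seq_right, empty_par, cast_id],
    show ∀ (A : ZXClass 0 2) (s : ZXClass 0 0) (B : ZXClass 2 3), A ⨟ (s ⊠ B) = s ⊠ (A ⨟ B) from fun A s B => by rw [scalar_par_seq_right, empty_par, cast_id],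
    ← seq_assoc (mk (Z 0 2 c)), hstate, htail, seq_assoc]

/-! ### Re-rooting tools -/

/-- A green copy with its first output capped (to a wire on the left) is the merge:
`(𝕀 ⊗ Z^{(1,2)}(a)) ⨾ (∩ ⊗ 𝕀) = Z^{(2,1)}(a)`. [cite: JeandelPerdrixVilmart2018, Fig. 1 (S1), §2.2] -/
theorem par_split_seq_cap_par (a : ZMod 8) : (mk (wires 1) ⊠ mk (Z 1 2 a)) ⨟ (mk cap ⊠ mk (wires 1)) = mk (Z 2 1 a) := by
  have hbend : (mk (wires 1) ⊠ mk (Z 1 2 0)) ⨟ (mk cap ⊠ mk (wires 1)) = mk (Z 2 1 0) := by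
    have h := congrArg colorSwap par_xsplit_seq_cap_par
    simpa using h
  rw [show mk (Z 1 2 a) = mk (Z 1 1 a) ⨟ mk (Z 1 2 0) from by rw [Z_seq_Z 1 1 2 le_rfl, add_zero], wires_par_seq, seq_assoc, hbend,
    par_Z_seq_Z 1 1 1 1 le_rfl, zero_add a]

/-- **Re-rooting at the merge**: a cup whose second leg feeds `F` and whose first leg is merged (green) with the first
output of `F` equals the phase-free green three-legged state whose last leg feeds `F` and whose middle leg is capped
with the first output of `F`. [cite: JeandelPerdrixVilmart2018, §2.2 (only topology matters)] -/
theorem cup_feed_merge_eq_state_feed_cap (F : ZXClass 1 3) :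
    mk cup ⨟ (mk (wires 1) ⊠ F) ⨟ ((mk (Z 2 1 0) ⊠ mk (wires 1)) ⊠ mk (wires 1)) = mk (Z 0 3 0) ⨟ (mk (wires 1) ⊠ ((mk (wires 1) ⊠ F) ⨟ ((mk cap ⊠ mk (wires 1)) ⊠ mk (wires 1)))) := by
  rw [Z_zero_three_eq_cup_split_par, wires_par_seq,
    show mk (wires 1) ⊠ (mk (wires 1) ⊠ F) = mk (wires 2) ⊠ F from by rw [← wires_par_wires 1 1]; exact (par_assoc' _ _ _).trans (cast_id _ _ _),
    seq_assoc (mk cup) (mk (Z 1 2 0) ⊠ mk (wires 1)), ← seq_assoc (mk (Z 1 2 0) ⊠ mk (wires 1)) (mk (wires 2) ⊠ F),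
    show (mk (Z 1 2 0) ⊠ mk (wires 1)) ⨟ (mk (wires 2) ⊠ F) = (mk (wires 1) ⊠ F) ⨟ (mk (Z 1 2 0) ⊠ mk (wires 3)) from by rw [interchange, seq_id, id_seq, interchange, id_seq, seq_id],
    seq_assoc (mk (wires 1) ⊠ F), show mk (wires 1) ⊠ ((mk cap ⊠ mk (wires 1)) ⊠ mk (wires 1)) = mk (wires 1) ⊠ (mk cap ⊠ mk (wires 2)) from by
      rw [← wires_par_wires 1 1]; exact congrArg _ ((par_assoc _ _ _).trans (cast_id _ _ _)),
    show mk (wires 1) ⊠ (mk cap ⊠ mk (wires 2)) = (mk (wires 1) ⊠ mk cap) ⊠ mk (wires 2) from (par_assoc' _ _ _).trans (cast_id _ _ _),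
    show mk (Z 1 2 0) ⊠ mk (wires 3) = (mk (Z 1 2 0) ⊠ mk (wires 1)) ⊠ mk (wires 2) from by rw [← wires_par_wires 1 2]; exact (par_assoc' _ _ _).trans (cast_id _ _ _),
    ← seq_par_wires, split_par_seq_par_cap, ← wires_par_wires 1 1,
    show mk (Z 2 1 0) ⊠ (mk (wires 1) ⊠ mk (wires 1)) = (mk (Z 2 1 0) ⊠ mk (wires 1)) ⊠ mk (wires 1) from (par_assoc' _ _ _).trans (cast_id _ _ _), seq_assoc]

/-- **Re-rooting the `b`-rooted triangle of fig. `…-proof-aux_04`** into the context of JPV's gadget `G(a,b)` of (C1):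
the green `b` state with legs `(H ⨾ Z(-π/2), H ⨾ Z^{(1,2)}(a), leaf)`, the red merge of the first leg with the first copy,
the leaves `xLeafL π a`, `xLeafL 0 b` merged, equals the phase-free green state whose legs carry `H`, nothing and `X(-π/2)`
and whose last two legs feed `G(a,b)`. [cite: JeandelPerdrixVilmart2018, §2.2, Appendix Lemma 17, proof of Lemma 34] -/
theorem bRooted_eq_gadget_context (a b : ZMod 8) :
    mk (Z 0 3 b) ⨟ (((mk hBox ⨟ mk (Z 1 1 (-2))) ⊠ (mk hBox ⨟ mk (Z 1 2 a))) ⊠ mk (wires 1)) ⨟ ((mk (X 2 1 0) ⊠ mk (xLeafL 4 a)) ⊠ mk (xLeafL 0 b)) ⨟ (mk (wires 1) ⊠ mk (Z 2 1 0)) =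
      mk (Z 0 3 0) ⨟ ((mk hBox ⊠ mk (wires 1)) ⊠ mk (X 1 1 (-2))) ⨟ (mk (wires 1) ⊠ ((mk hBox ⊠ mk (wires 1)) ⨟ (mk (Z 1 2 a) ⊠ mk (Z 1 2 b)) ⨟ ((mk (wires 1) ⊠ ((mk hBox ⊠ mk (wires 1)) ⨟ mk cap)) ⊠ mk (wires 1)) ⨟ (mk (xLeafL 4 a) ⊠ mk (xLeafR 0 b)) ⨟ mk (Z 2 1 0))) := by
  have hX : mk (X 2 1 0) = ((mk hBox ⊠ mk hBox) ⨟ mk (Z 2 1 0)) ⨟ mk hBox := by rw [X_eq_conj 2 1 0, hTensor_two, hTensor_one]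
  have hXm2 : (mk hBox ⨟ mk (Z 1 1 (-2))) ⨟ mk hBox = mk (X 1 1 (-2)) := by rw [← hTensor_one, rule_H']
  -- S1–S3: the red merge in green; `H ⨾ Z(-π/2) ⨾ H = X(-π/2)`; the Hadamards after the merge split off
  have hlayer : ((((mk hBox ⊠ mk hBox) ⨟ mk (Z 2 1 0)) ⨟ mk hBox) ⊠ mk (xLeafL 4 a)) ⊠ mk (xLeafL 0 b) = (((mk hBox ⊠ mk hBox) ⊠ mk (wires 1)) ⊠ mk (wires 1)) ⨟ (((mk (Z 2 1 0) ⊠ mk (wires 1)) ⊠ mk (wires 1)) ⨟ ((mk hBox ⊠ mk (xLeafL 4 a)) ⊠ mk (xLeafL 0 b))) := by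
    rw [interchange, interchange, interchange, interchange]; simp only [id_seq, seq_assoc]
  have h1 : mk (Z 0 3 b) ⨟ (((mk hBox ⨟ mk (Z 1 1 (-2))) ⊠ (mk hBox ⨟ mk (Z 1 2 a))) ⊠ mk (wires 1)) ⨟ ((mk (X 2 1 0) ⊠ mk (xLeafL 4 a)) ⊠ mk (xLeafL 0 b)) ⨟ (mk (wires 1) ⊠ mk (Z 2 1 0)) = mk (Z 0 3 b) ⨟ ((mk (X 1 1 (-2)) ⊠ ((mk hBox ⨟ mk (Z 1 2 a)) ⨟ (mk hBox ⊠ mk (wires 1)))) ⊠ mk (wires 1)) ⨟ (((mk (Z 2 1 0) ⊠ mk (wires 1)) ⊠ mk (wires 1)) ⨟ ((mk hBox ⊠ mk (xLeafL 4 a)) ⊠ mk (xLeafL 0 b))) ⨟ (mk (wires 1) ⊠ mk (Z 2 1 0)) := by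
    rw [hX, hlayer, ← seq_assoc (mk (Z 0 3 b) ⨟ (((mk hBox ⨟ mk (Z 1 1 (-2))) ⊠ (mk hBox ⨟ mk (Z 1 2 a))) ⊠ mk (wires 1))) (((mk hBox ⊠ mk hBox) ⊠ mk (wires 1)) ⊠ mk (wires 1)), seq_assoc (mk (Z 0 3 b)) (((mk hBox ⨟ mk (Z 1 1 (-2))) ⊠ (mk hBox ⨟ mk (Z 1 2 a))) ⊠ mk (wires 1)) (((mk hBox ⊠ mk hBox) ⊠ mk (wires 1)) ⊠ mk (wires 1)), ← seq_par_wires,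
      show (mk hBox ⊠ mk hBox) ⊠ mk (wires 1) = mk hBox ⊠ (mk hBox ⊠ mk (wires 1)) from (par_assoc _ _ _).trans (cast_id _ _ _), interchange, hXm2, seq_assoc (mk hBox) (mk (Z 1 2 a))]
  -- S4: root `b` as a cup feeding `Z^{(1,2)}(b)`; `X(-π/2)` slides to the other cup leg
  have hZ3b : mk (Z 0 3 b) = mk cup ⨟ (mk (wires 1) ⊠ mk (Z 1 2 b)) := by rw [← Z_zero_two, Z_seq_par_Z 0 1 1 2 le_rfl, zero_add]
  have h2 : mk (Z 0 3 b) ⨟ ((mk (X 1 1 (-2)) ⊠ ((mk hBox ⨟ mk (Z 1 2 a)) ⨟ (mk hBox ⊠ mk (wires 1)))) ⊠ mk (wires 1)) ⨟ (((mk (Z 2 1 0) ⊠ mk (wires 1)) ⊠ mk (wires 1)) ⨟ ((mk hBox ⊠ mk (xLeafL 4 a)) ⊠ mk (xLeafL 0 b))) ⨟ (mk (wires 1) ⊠ mk (Z 2 1 0)) = ((mk cup ⨟ (mk (wires 1) ⊠ (mk (X 1 1 (-2)) ⨟ (mk (Z 1 2 b) ⨟ (((mk hBox ⨟ mk (Z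 1 2 a)) ⨟ (mk hBox ⊠ mk (wires 1))) ⊠ mk (wires 1))))) ⨟ ((mk (Z 2 1 0) ⊠ mk (wires 1)) ⊠ mk (wires 1))) ⨟ ((mk hBox ⊠ mk (xLeafL 4 a)) ⊠ mk (xLeafL 0 b))) ⨟ (mk (wires 1) ⊠ mk (Z 2 1 0)) := by
    rw [hZ3b, seq_assoc (mk cup) (mk (wires 1) ⊠ mk (Z 1 2 b)), show (mk (wires 1) ⊠ mk (Z 1 2 b)) ⨟ ((mk (X 1 1 (-2)) ⊠ ((mk hBox ⨟ mk (Z 1 2 a)) ⨟ (mk hBox ⊠ mk (wires 1)))) ⊠ mk (wires 1)) = (mk (X 1 1 (-2)) ⊠ mk (wires 1)) ⨟ (mk (wires 1) ⊠ (mk (Z 1 2 b) ⨟ (((mk hBox ⨟ mk (Z 1 2 a)) ⨟ (mk hBox ⊠ mk (wires 1))) ⊠ mk (wires 1)))) from by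
        rw [show (mk (X 1 1 (-2)) ⊠ ((mk hBox ⨟ mk (Z 1 2 a)) ⨟ (mk hBox ⊠ mk (wires 1)))) ⊠ mk (wires 1) = mk (X 1 1 (-2)) ⊠ (((mk hBox ⨟ mk (Z 1 2 a)) ⨟ (mk hBox ⊠ mk (wires 1))) ⊠ mk (wires 1)) from (par_assoc _ _ _).trans (cast_id _ _ _), interchange, id_seq, interchange, seq_id, id_seq],
      ← seq_assoc (mk cup) (mk (X 1 1 (-2)) ⊠ mk (wires 1)), ← cup_seq_par_xphase, seq_assoc (mk cup) (mk (wires 1) ⊠ mk (X 1 1 (-2))), ← wires_par_seq,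
      ← seq_assoc (mk cup ⨟ (mk (wires 1) ⊠ (mk (X 1 1 (-2)) ⨟ (mk (Z 1 2 b) ⨟ (((mk hBox ⨟ mk (Z 1 2 a)) ⨟ (mk hBox ⊠ mk (wires 1))) ⊠ mk (wires 1)))))) ((mk (Z 2 1 0) ⊠ mk (wires 1)) ⊠ mk (wires 1)) ((mk hBox ⊠ mk (xLeafL 4 a)) ⊠ mk (xLeafL 0 b))]
  -- E5: re-root at the merge
  have h3 : ((mk cup ⨟ (mk (wires 1) ⊠ (mk (X 1 1 (-2)) ⨟ (mk (Z 1 2 b) ⨟ (((mk hBox ⨟ mk (Z 1 2 a)) ⨟ (mk hBox ⊠ mk (wires 1))) ⊠ mk (wires 1))))) ⨟ ((mk (Z 2 1 0) ⊠ mk (wires 1)) ⊠ mk (wires 1))) ⨟ ((mk hBox ⊠ mk (xLeafL 4 a)) ⊠ mk (xLeafL 0 b))) ⨟ (mk (wires 1) ⊠ mk (Z 2 1 0)) = ((mk (Z 0 3 0) ⨟ (mk (wires 1) ⊠ ((mk (wires 1) ⊠ (mk (X 1 1 (-2)) ⨟ (mk (Z 1 2 b) ⨟ (((mk hBox ⨟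 mk (Z 1 2 a)) ⨟ (mk hBox ⊠ mk (wires 1))) ⊠ mk (wires 1))))) ⨟ ((mk cap ⊠ mk (wires 1)) ⊠ mk (wires 1))))) ⨟ ((mk hBox ⊠ mk (xLeafL 4 a)) ⊠ mk (xLeafL 0 b))) ⨟ (mk (wires 1) ⊠ mk (Z 2 1 0)) := by rw [cup_feed_merge_eq_state_feed_cap]
  -- S5: the capped branch is the Hadamard-decorated merge `Z^{(2,1)}(a)`: a ladder
  have hcapA : (mk (wires 1) ⊠ ((mk hBox ⨟ mk (Z 1 2 a)) ⨟ (mk hBox ⊠ mk (wires 1)))) ⨟ (mk cap ⊠ mk (wires 1)) = (mk hBox ⊠ mk hBox) ⨟ mk (Z 2 1 a) := by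
    rw [wires_par_seq, wires_par_seq, seq_assoc, seq_assoc, show mk (wires 1) ⊠ (mk hBox ⊠ mk (wires 1)) = (mk (wires 1) ⊠ mk hBox) ⊠ mk (wires 1) from (par_assoc' _ _ _).trans (cast_id _ _ _),
      ← seq_par_wires, ← hBox_par_seq_cap_comm, seq_par_wires, ← seq_assoc (mk (wires 1) ⊠ mk (Z 1 2 a)) ((mk hBox ⊠ mk (wires 1)) ⊠ mk (wires 1)),
      show (mk hBox ⊠ mk (wires 1)) ⊠ mk (wires 1) = mk hBox ⊠ mk (wires 2) from by rw [← wires_par_wires 1 1]; exact (par_assoc _ _ _).trans (cast_id _ _ _),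
      show (mk (wires 1) ⊠ mk (Z 1 2 a)) ⨟ (mk hBox ⊠ mk (wires 2)) = (mk hBox ⊠ mk (wires 1)) ⨟ (mk (wires 1) ⊠ mk (Z 1 2 a)) from by rw [interchange, id_seq, seq_id, interchange, seq_id, id_seq],
      seq_assoc (mk hBox ⊠ mk (wires 1)), par_split_seq_cap_par, ← seq_assoc, interchange, id_seq, seq_id]
  have h4 : ((mk (wires 1) ⊠ (mk (X 1 1 (-2)) ⨟ (mk (Z 1 2 b) ⨟ (((mk hBox ⨟ mk (Z 1 2 a)) ⨟ (mk hBox ⊠ mk (wires 1))) ⊠ mk (wires 1))))) ⨟ ((mk cap ⊠ mk (wires 1)) ⊠ mk (wires 1))) = ((mk (wires 1) ⊠ mk (X 1 1 (-2))) ⨟ ((mk hBox ⊠ (mk (Z 1 2 b) ⨟ (mk hBox ⊠ mk (wires 1)))) ⨟ (mk (Z 2 1 a) ⊠ mk (wires 1)))) := by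
    rw [wires_par_seq, wires_par_seq, seq_assoc, seq_assoc, show mk (wires 1) ⊠ (((mk hBox ⨟ mk (Z 1 2 a)) ⨟ (mk hBox ⊠ mk (wires 1))) ⊠ mk (wires 1)) = (mk (wires 1) ⊠ ((mk hBox ⨟ mk (Z 1 2 a)) ⨟ (mk hBox ⊠ mk (wires 1)))) ⊠ mk (wires 1) from (par_assoc' _ _ _).trans (cast_id _ _ _),
      ← seq_par_wires, hcapA, seq_par_wires, ← seq_assoc (mk (wires 1) ⊠ mk (Z 1 2 b)),
      show (mk hBox ⊠ mk hBox) ⊠ mk (wires 1) = mk hBox ⊠ (mk hBox ⊠ mk (wires 1)) from (par_assoc _ _ _).trans (cast_id _ _ _),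
      show (mk (wires 1) ⊠ mk (Z 1 2 b)) ⨟ (mk hBox ⊠ (mk hBox ⊠ mk (wires 1))) = mk hBox ⊠ (mk (Z 1 2 b) ⨟ (mk hBox ⊠ mk (wires 1))) from by rw [interchange, id_seq]]
  -- S6: the ladder is the `H`-capped pair of copies; the outer Hadamard moves to the front
  have hsplit : ((mk hBox ⊠ mk (xLeafL 4 a)) ⊠ mk (xLeafR 0 b)) = (mk hBox ⊠ mk (wires 2)) ⨟ (mk (wires 1) ⊠ (mk (xLeafL 4 a) ⊠ mk (xLeafR 0 b))) := by
    rw [interchange, seq_id, id_seq]; exact ((par_assoc' (mk hBox) (mk (xLeafL 4 a)) (mk (xLeafR 0 b))).trans (cast_id _ _ _)).symm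
  have hc1 : ∀ R' : ZXClass 3 2, (mk (wires 1) ⊠ ((mk (wires 1) ⊠ ((mk hBox ⊠ mk (wires 1)) ⨟ mk cap)) ⊠ mk (wires 1))) ⨟ ((mk hBox ⊠ mk (wires 2)) ⨟ R') = (mk hBox ⊠ mk (wires 4)) ⨟ ((mk (wires 1) ⊠ ((mk (wires 1) ⊠ ((mk hBox ⊠ mk (wires 1)) ⨟ mk cap)) ⊠ mk (wires 1))) ⨟ R') := fun R' => by
    rw [← seq_assoc, interchange, id_seq, seq_id, ← seq_assoc, interchange, seq_id, id_seq]
  have hc2 : ∀ R' : ZXClass 5 2, (mk (wires 1) ⊠ (mk (Z 1 2 a) ⊠ mk (Z 1 2 b))) ⨟ ((mk hBox ⊠ mk (wires 4)) ⨟ R') = (mk hBox ⊠ mk (wires 2)) ⨟ ((mk (wires 1) ⊠ (mk (Z 1 2 a) ⊠ mk (Z 1 2 b))) ⨟ R') := fun R' => by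
    rw [← seq_assoc, interchange, id_seq, seq_id, ← seq_assoc, interchange, seq_id, id_seq]
  have hc3 : ∀ R' : ZXClass 3 2, (mk (wires 1) ⊠ (mk hBox ⊠ mk (wires 1))) ⨟ ((mk hBox ⊠ mk (wires 2)) ⨟ R') = (mk hBox ⊠ mk (wires 2)) ⨟ ((mk (wires 1) ⊠ (mk hBox ⊠ mk (wires 1))) ⨟ R') := fun R' => by
    rw [← seq_assoc, interchange, id_seq, seq_id, ← seq_assoc, interchange, seq_id, id_seq]
  have hc4 : ∀ R' : ZXClass 3 2, (mk (wires 1) ⊠ (mk (wires 1) ⊠ mk (X 1 1 (-2)))) ⨟ ((mk hBox ⊠ mk (wires 2)) ⨟ R') = ((mk hBox ⊠ mk (wires 1)) ⊠ mk (X 1 1 (-2))) ⨟ R' := fun R' => by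
    rw [← seq_assoc, interchange, id_seq, seq_id]; exact congrArg (· ⨟ R') ((par_assoc' _ _ _).trans (cast_id _ _ _))
  have h5 : ((mk (Z 0 3 0) ⨟ (mk (wires 1) ⊠ ((mk (wires 1) ⊠ mk (X 1 1 (-2))) ⨟ ((mk hBox ⊠ (mk (Z 1 2 b) ⨟ (mk hBox ⊠ mk (wires 1)))) ⨟ (mk (Z 2 1 a) ⊠ mk (wires 1)))))) ⨟ ((mk hBox ⊠ mk (xLeafL 4 a)) ⊠ mk (xLeafL 0 b))) ⨟ (mk (wires 1) ⊠ mk (Z 2 1 0)) = mk (Z 0 3 0) ⨟ ((mk hBox ⊠ mk (wires 1)) ⊠ mk (X 1 1 (-2))) ⨟ (mk (wires 1) ⊠ ((mk hBox ⊠ mk (wires 1)) ⨟ (mk (Z 1 2 a) ⊠ mk (Z 1 2 b)) ⨟ ((mk (wires 1) ⊠ ((mk hBox ⊠ mk (wires 1)) ⨟ mk cap)) ⊠ mk (wires 1)) ⨟ (mk (xLeafL 4 a) ⊠ mk (xLeafR 0 b)) ⨟ mk (Z 2 1 0))) := by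
    rw [hBox_par_split_hBox_seq_merge, xLeafL_eq_xLeafR 0 b, hsplit]
    simp only [wires_par_seq, seq_assoc]
    rw [show (mk (wires 1) ⊠ (mk hBox ⊠ mk (wires 1))) ⨟ (mk (wires 1) ⊠ mk cap) = mk (wires 1) ⊠ ((mk hBox ⊠ mk (wires 1)) ⨟ mk cap) from by rw [← wires_par_seq], hc1, hc2, hc3, hc4]
  rw [h1, h2, h3, h4, h5]

/-- **Re-rooting the `a`-rooted triangle of fig. `…-proof-aux_05`** into the context of the mirrored gadget of (C1):
the green `a` state with legs `(Z(-π/2), H ⨾ Z^{(1,2)}(b), leaf)`, a Hadamard on the first copy, the red merge of the first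
leg with it, the leaves `xLeafL 0 b`, `xLeafL π a` merged, equals the same context as in `bRooted_eq_gadget_context`
around the mirrored gadget. [cite: JeandelPerdrixVilmart2018, §2.2, Appendix Lemma 17, proof of Lemma 34] -/
theorem aRooted_eq_gadgetMirror_context (a b : ZMod 8) :
    mk (Z 0 3 a) ⨟ ((mk (Z 1 1 (-2)) ⊠ (mk hBox ⨟ mk (Z 1 2 b))) ⊠ mk (wires 1)) ⨟ (((mk (wires 1) ⊠ mk hBox) ⊠ mk (xLeafL 0 b)) ⊠ mk (xLeafL 4 a)) ⨟ ((mk (X 2 1 0) ⊠ mk (wires 1)) ⊠ mk (wires 1)) ⨟ (mk (wires 1) ⊠ mk (Z 2 1 0)) =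
      mk (Z 0 3 0) ⨟ ((mk hBox ⊠ mk (wires 1)) ⊠ mk (X 1 1 (-2))) ⨟ (mk (wires 1) ⊠ ((mk (wires 1) ⊠ mk hBox) ⨟ (mk (Z 1 2 b) ⊠ mk (Z 1 2 a)) ⨟ ((mk (wires 1) ⊠ ((mk hBox ⊠ mk (wires 1)) ⨟ mk cap)) ⊠ mk (wires 1)) ⨟ (mk (xLeafL 0 b) ⊠ mk (xLeafR 4 a)) ⨟ mk (Z 2 1 0))) := by
  have hX : mk (X 2 1 0) = ((mk hBox ⊠ mk hBox) ⨟ mk (Z 2 1 0)) ⨟ mk hBox := by rw [X_eq_conj 2 1 0, hTensor_two, hTensor_one]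
  have hXm2 : (mk hBox ⨟ mk (Z 1 1 (-2))) ⨟ mk hBox = mk (X 1 1 (-2)) := by rw [← hTensor_one, rule_H']
  have hXH : mk (X 1 1 (-2)) ⨟ mk hBox = mk hBox ⨟ mk (Z 1 1 (-2)) := by rw [← hXm2, seq_assoc, hBox_seq_hBox, seq_id]
  -- S1–S3: the red merge in green, its Hadamards distributed: one joins `Z(-π/2)`, one cancels on the copy, one moves past the leaves
  have hA : ∀ R' : ZXClass 4 2, (((mk (wires 1) ⊠ mk hBox) ⊠ mk (xLeafL 0 b)) ⊠ mk (xLeafL 4 a)) ⨟ ((((mk hBox ⊠ mk hBox) ⊠ mk (wires 1)) ⊠ mk (wires 1)) ⨟ R') = (((mk hBox ⊠ mk (wires 1)) ⊠ mk (wires 1)) ⊠ mk (wires 1)) ⨟ ((((mk (wires 1) ⊠ mk (wires 1)) ⊠ mk (xLeafL 0 b)) ⊠ mk (xLeafL 4 a)) ⨟ R') := fun R' => by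
    rw [← seq_assoc, ← seq_assoc]; congr 1; simp only [interchange, id_seq, seq_id, hBox_seq_hBox]
  have hB : ∀ R' : ZXClass 3 2, (((mk (wires 1) ⊠ mk (wires 1)) ⊠ mk (xLeafL 0 b)) ⊠ mk (xLeafL 4 a)) ⨟ (((mk (Z 2 1 0) ⊠ mk (wires 1)) ⊠ mk (wires 1)) ⨟ R') = ((mk (Z 2 1 0) ⊠ mk (wires 1)) ⊠ mk (wires 1)) ⨟ (((mk (wires 1) ⊠ mk (xLeafL 0 b)) ⊠ mk (xLeafL 4 a)) ⨟ R') := fun R' => by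
    rw [← seq_assoc, ← seq_assoc]; congr 1; simp only [interchange, id_seq, seq_id, wires_par_wires]
  have hC : ∀ R' : ZXClass 3 2, ((mk (wires 1) ⊠ mk (xLeafL 0 b)) ⊠ mk (xLeafL 4 a)) ⨟ (((mk hBox ⊠ mk (wires 1)) ⊠ mk (wires 1)) ⨟ R') = ((mk hBox ⊠ mk (xLeafL 0 b)) ⊠ mk (xLeafL 4 a)) ⨟ R' := fun R' => by
    rw [← seq_assoc]; congr 1; simp only [interchange, id_seq, seq_id]
  have hD : ∀ R' : ZXClass 4 2, ((mk (Z 1 1 (-2)) ⊠ (mk hBox ⨟ mk (Z 1 2 b))) ⊠ mk (wires 1)) ⨟ ((((mk hBox ⊠ mk (wires 1)) ⊠ mk (wires 1)) ⊠ mk (wires 1)) ⨟ R') = (((mk (Z 1 1 (-2)) ⨟ mk hBox) ⊠ (mk hBox ⨟ mk (Z 1 2 b))) ⊠ mk (wires 1)) ⨟ R' := fun R' => by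
    rw [← seq_assoc]; congr 1
    rw [show (((mk hBox ⊠ mk (wires 1)) ⊠ mk (wires 1)) ⊠ mk (wires 1)) = (mk hBox ⊠ mk (wires 2)) ⊠ mk (wires 1) from by rw [← wires_par_wires 1 1]; exact congrArg (· ⊠ mk (wires 1)) ((par_assoc _ _ _).trans (cast_id _ _ _)),
      interchange, seq_id, interchange, seq_id]
  have h1 : mk (Z 0 3 a) ⨟ ((mk (Z 1 1 (-2)) ⊠ (mk hBox ⨟ mk (Z 1 2 b))) ⊠ mk (wires 1)) ⨟ (((mk (wires 1) ⊠ mk hBox) ⊠ mk (xLeafL 0 b)) ⊠ mk (xLeafL 4 a)) ⨟ ((mk (X 2 1 0) ⊠ mk (wires 1)) ⊠ mk (wires 1)) ⨟ (mk (wires 1) ⊠ mk (Z 2 1 0)) = mk (Z 0 3 a) ⨟ (((mk (Z 1 1 (-2)) ⨟ mk hBox) ⊠ (mk hBox ⨟ mk (Z 1 2 b))) ⊠ mk (wires 1)) ⨟ (((mk (Z 2 1 0) ⊠ mk (wires 1)) ⊠ mk (wires 1)) ⨟ ((mk hBox ⊠ mk (xLeafL 0 b)) ⊠ mk (xLeafL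 4 a))) ⨟ (mk (wires 1) ⊠ mk (Z 2 1 0)) := by
    rw [hX]; simp only [seq_par_wires, seq_assoc]; rw [hA, hB, hC, hD]
  -- S4: root `a` as a cup feeding `Z^{(1,2)}(a)`; `Z(-π/2) ⨾ H` slides to the other cup leg as `H ⨾ Z(-π/2)`
  have hZ3a : mk (Z 0 3 a) = mk cup ⨟ (mk (wires 1) ⊠ mk (Z 1 2 a)) := by rw [← Z_zero_two, Z_seq_par_Z 0 1 1 2 le_rfl, zero_add]
  have h2 : mk (Z 0 3 a) ⨟ (((mk (Z 1 1 (-2)) ⨟ mk hBox) ⊠ (mk hBox ⨟ mk (Z 1 2 b))) ⊠ mk (wires 1)) ⨟ (((mk (Z 2 1 0) ⊠ mk (wires 1)) ⊠ mk (wires 1)) ⨟ ((mk hBox ⊠ mk (xLeafL 0 b)) ⊠ mk (xLeafL 4 a))) ⨟ (mk (wires 1) ⊠ mk (Z 2 1 0)) = ((mk cup ⨟ (mk (wires 1) ⊠ ((mk hBox ⨟ mk (Z 1 1 (-2))) ⨟ (mk (Z 1 2 a) ⨟ ((mk hBox ⨟ mk (Z 1 2 b)) ⊠ mk (wires 1)))))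 ⨟ ((mk (Z 2 1 0) ⊠ mk (wires 1)) ⊠ mk (wires 1))) ⨟ ((mk hBox ⊠ mk (xLeafL 0 b)) ⊠ mk (xLeafL 4 a))) ⨟ (mk (wires 1) ⊠ mk (Z 2 1 0)) := by
    rw [hZ3a, seq_assoc (mk cup) (mk (wires 1) ⊠ mk (Z 1 2 a)), show (mk (wires 1) ⊠ mk (Z 1 2 a)) ⨟ (((mk (Z 1 1 (-2)) ⨟ mk hBox) ⊠ (mk hBox ⨟ mk (Z 1 2 b))) ⊠ mk (wires 1)) = ((mk (Z 1 1 (-2)) ⨟ mk hBox) ⊠ mk (wires 1)) ⨟ (mk (wires 1) ⊠ (mk (Z 1 2 a) ⨟ ((mk hBox ⨟ mk (Z 1 2 b)) ⊠ mk (wires 1)))) from by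
        rw [show (((mk (Z 1 1 (-2)) ⨟ mk hBox) ⊠ (mk hBox ⨟ mk (Z 1 2 b))) ⊠ mk (wires 1)) = (mk (Z 1 1 (-2)) ⨟ mk hBox) ⊠ ((mk hBox ⨟ mk (Z 1 2 b)) ⊠ mk (wires 1)) from (par_assoc _ _ _).trans (cast_id _ _ _), interchange, id_seq, interchange, seq_id, id_seq],
      ← seq_assoc (mk cup) ((mk (Z 1 1 (-2)) ⨟ mk hBox) ⊠ mk (wires 1)), ← hb_cup_slide_seq cup_seq_hBox_par_comm.symm (hb_cup_seq_par_phase_comm (-2)),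
      seq_assoc (mk cup) (mk (wires 1) ⊠ (mk hBox ⨟ mk (Z 1 1 (-2)))), ← wires_par_seq, ← seq_assoc (mk cup ⨟ (mk (wires 1) ⊠ ((mk hBox ⨟ mk (Z 1 1 (-2))) ⨟ (mk (Z 1 2 a) ⨟ ((mk hBox ⨟ mk (Z 1 2 b)) ⊠ mk (wires 1)))))) ((mk (Z 2 1 0) ⊠ mk (wires 1)) ⊠ mk (wires 1)) ((mk hBox ⊠ mk (xLeafL 0 b)) ⊠ mk (xLeafL 4 a))]
  -- E5: re-root at the merge
  have h3 : ((mk cup ⨟ (mk (wires 1) ⊠ ((mk hBox ⨟ mk (Z 1 1 (-2))) ⨟ (mk (Z 1 2 a) ⨟ ((mk hBox ⨟ mk (Z 1 2 b)) ⊠ mk (wires 1))))) ⨟ ((mk (Z 2 1 0) ⊠ mk (wires 1)) ⊠ mk (wires 1))) ⨟ ((mk hBox ⊠ mk (xLeafL 0 b)) ⊠ mk (xLeafL 4 a))) ⨟ (mk (wires 1) ⊠ mk (Z 2 1 0)) = ((mk (Z 0 3 0) ⨟ (mk (wires 1) ⊠ ((mk (wires 1) ⊠ ((mk hBox ⨟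 mk (Z 1 1 (-2))) ⨟ (mk (Z 1 2 a) ⨟ ((mk hBox ⨟ mk (Z 1 2 b)) ⊠ mk (wires 1))))) ⨟ ((mk cap ⊠ mk (wires 1)) ⊠ mk (wires 1))))) ⨟ ((mk hBox ⊠ mk (xLeafL 0 b)) ⊠ mk (xLeafL 4 a))) ⨟ (mk (wires 1) ⊠ mk (Z 2 1 0)) := by rw [cup_feed_merge_eq_state_feed_cap]
  -- S5: the capped branch is the Hadamard-fed merge `Z^{(2,1)}(b)`: a ladder
  have hcapB : (mk (wires 1) ⊠ (mk hBox ⨟ mk (Z 1 2 b))) ⨟ (mk cap ⊠ mk (wires 1)) = (mk (wires 1) ⊠ mk hBox) ⨟ mk (Z 2 1 b) := by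
    rw [wires_par_seq, seq_assoc, par_split_seq_cap_par]
  have hE : (mk (wires 1) ⊠ ((mk hBox ⨟ mk (Z 1 2 b)) ⊠ mk (wires 1))) ⨟ ((mk cap ⊠ mk (wires 1)) ⊠ mk (wires 1)) = (mk (wires 1) ⊠ (mk hBox ⊠ mk (wires 1))) ⨟ (mk (Z 2 1 b) ⊠ mk (wires 1)) := by
    rw [show mk (wires 1) ⊠ ((mk hBox ⨟ mk (Z 1 2 b)) ⊠ mk (wires 1)) = (mk (wires 1) ⊠ (mk hBox ⨟ mk (Z 1 2 b))) ⊠ mk (wires 1) from (par_assoc' _ _ _).trans (cast_id _ _ _),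
      ← seq_par_wires, hcapB, seq_par_wires, show (mk (wires 1) ⊠ mk hBox) ⊠ mk (wires 1) = mk (wires 1) ⊠ (mk hBox ⊠ mk (wires 1)) from (par_assoc _ _ _).trans (cast_id _ _ _)]
  have h4 : ((mk (wires 1) ⊠ ((mk hBox ⨟ mk (Z 1 1 (-2))) ⨟ (mk (Z 1 2 a) ⨟ ((mk hBox ⨟ mk (Z 1 2 b)) ⊠ mk (wires 1))))) ⨟ ((mk cap ⊠ mk (wires 1)) ⊠ mk (wires 1))) = ((mk (wires 1) ⊠ (mk hBox ⨟ mk (Z 1 1 (-2)))) ⨟ ((mk (wires 1) ⊠ (mk (Z 1 2 a) ⨟ (mk hBox ⊠ mk (wires 1)))) ⨟ (mk (Z 2 1 b) ⊠ mk (wires 1)))) := by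
    simp only [wires_par_seq, seq_assoc]; rw [hE]
  -- S6: the ladder is the `H`-capped pair of copies; the decorations of the root legs line up with the context
  have hlad : (mk (wires 1) ⊠ (mk (Z 1 2 a) ⨟ (mk hBox ⊠ mk (wires 1)))) ⨟ (mk (Z 2 1 b) ⊠ mk (wires 1)) = (mk (Z 1 2 b) ⊠ mk (Z 1 2 a)) ⨟ ((mk (wires 1) ⊠ ((mk hBox ⊠ mk (wires 1)) ⨟ mk cap)) ⊠ mk (wires 1)) := by
    have h := congrArg ((mk hBox ⊠ mk (wires 1)) ⨟ ·) (hBox_par_split_hBox_seq_merge b a)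
    rw [← seq_assoc, ← seq_assoc, interchange, hBox_seq_hBox, id_seq, ← seq_assoc, interchange, hBox_seq_hBox, seq_id, wires_par_wires, id_seq] at h
    exact h
  have hsplit : (mk hBox ⊠ mk (xLeafL 0 b)) ⊠ mk (xLeafR 4 a) = (mk hBox ⊠ mk (wires 2)) ⨟ (mk (wires 1) ⊠ (mk (xLeafL 0 b) ⊠ mk (xLeafR 4 a))) := by
    rw [interchange, seq_id, id_seq]; exact ((par_assoc' (mk hBox) (mk (xLeafL 0 b)) (mk (xLeafR 4 a))).trans (cast_id _ _ _)).symm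
  have hc1 : ∀ R' : ZXClass 3 2, (mk (wires 1) ⊠ ((mk (wires 1) ⊠ ((mk hBox ⊠ mk (wires 1)) ⨟ mk cap)) ⊠ mk (wires 1))) ⨟ ((mk hBox ⊠ mk (wires 2)) ⨟ R') = (mk hBox ⊠ mk (wires 4)) ⨟ ((mk (wires 1) ⊠ ((mk (wires 1) ⊠ ((mk hBox ⊠ mk (wires 1)) ⨟ mk cap)) ⊠ mk (wires 1))) ⨟ R') := fun R' => by
    rw [← seq_assoc, interchange, id_seq, seq_id, ← seq_assoc, interchange, seq_id, id_seq]
  have hc2 : ∀ R' : ZXClass 5 2, (mk (wires 1) ⊠ (mk (Z 1 2 b) ⊠ mk (Z 1 2 a))) ⨟ ((mk hBox ⊠ mk (wires 4)) ⨟ R') = (mk hBox ⊠ mk (wires 2)) ⨟ ((mk (wires 1) ⊠ (mk (Z 1 2 b) ⊠ mk (Z 1 2 a))) ⨟ R') := fun R' => by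
    rw [← seq_assoc, interchange, id_seq, seq_id, ← seq_assoc, interchange, seq_id, id_seq]
  have hc5 : ∀ R' : ZXClass 3 2, (mk (wires 1) ⊠ (mk (wires 1) ⊠ mk (Z 1 1 (-2)))) ⨟ ((mk hBox ⊠ mk (wires 2)) ⨟ R') = (mk hBox ⊠ mk (wires 2)) ⨟ ((mk (wires 1) ⊠ (mk (wires 1) ⊠ mk (Z 1 1 (-2)))) ⨟ R') := fun R' => by
    rw [← seq_assoc, interchange, id_seq, seq_id, ← seq_assoc, interchange, seq_id, id_seq]
  have hc6 : ∀ R' : ZXClass 3 2, (mk (wires 1) ⊠ (mk (wires 1) ⊠ mk hBox)) ⨟ ((mk hBox ⊠ mk (wires 2)) ⨟ R') = (mk hBox ⊠ mk (wires 2)) ⨟ ((mk (wires 1) ⊠ (mk (wires 1) ⊠ mk hBox)) ⨟ R') := fun R' => by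
    rw [← seq_assoc, interchange, id_seq, seq_id, ← seq_assoc, interchange, seq_id, id_seq]
  have hfront : ∀ R' : ZXClass 3 2, (mk hBox ⊠ mk (wires 2)) ⨟ ((mk (wires 1) ⊠ (mk (wires 1) ⊠ mk hBox)) ⨟ ((mk (wires 1) ⊠ (mk (wires 1) ⊠ mk (Z 1 1 (-2)))) ⨟ R')) =
      ((mk hBox ⊠ mk (wires 1)) ⊠ mk (X 1 1 (-2))) ⨟ ((mk (wires 1) ⊠ (mk (wires 1) ⊠ mk hBox)) ⨟ R') := fun R' => by
    rw [← seq_assoc, ← seq_assoc, ← seq_assoc ((mk hBox ⊠ mk (wires 1)) ⊠ mk (X 1 1 (-2)))]; congr 1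
    rw [interchange, seq_id, id_seq, interchange, seq_id, ← wires_par_seq, ← hXH, wires_par_seq,
      show mk hBox ⊠ ((mk (wires 1) ⊠ mk (X 1 1 (-2))) ⨟ (mk (wires 1) ⊠ mk hBox)) = (mk hBox ⊠ (mk (wires 1) ⊠ mk (X 1 1 (-2)))) ⨟ (mk (wires 1) ⊠ (mk (wires 1) ⊠ mk hBox)) from by symm; rw [interchange, seq_id]]
    exact congrArg (· ⨟ _) ((par_assoc' _ _ _).trans (cast_id _ _ _))
  have h5 : ((mk (Z 0 3 0) ⨟ (mk (wires 1) ⊠ ((mk (wires 1) ⊠ (mk hBox ⨟ mk (Z 1 1 (-2)))) ⨟ ((mk (wires 1) ⊠ (mk (Z 1 2 a) ⨟ (mk hBox ⊠ mk (wires 1)))) ⨟ (mk (Z 2 1 b) ⊠ mk (wires 1)))))) ⨟ ((mk hBox ⊠ mk (xLeafL 0 b)) ⊠ mk (xLeafL 4 a))) ⨟ (mk (wires 1) ⊠ mk (Z 2 1 0)) = mk (Z 0 3 0) ⨟ ((mk hBox ⊠ mk (wires 1)) ⊠ mk (X 1 1 (-2))) ⨟ (mk (wires 1) ⊠ ((mk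 (wires 1) ⊠ mk hBox) ⨟ (mk (Z 1 2 b) ⊠ mk (Z 1 2 a)) ⨟ ((mk (wires 1) ⊠ ((mk hBox ⊠ mk (wires 1)) ⨟ mk cap)) ⊠ mk (wires 1)) ⨟ (mk (xLeafL 0 b) ⊠ mk (xLeafR 4 a)) ⨟ mk (Z 2 1 0))) := by
    rw [hlad, xLeafL_eq_xLeafR 4 a, hsplit]
    simp only [wires_par_seq, seq_assoc]
    rw [show (mk (wires 1) ⊠ (mk hBox ⊠ mk (wires 1))) ⨟ (mk (wires 1) ⊠ mk cap) = mk (wires 1) ⊠ ((mk hBox ⊠ mk (wires 1)) ⨟ mk cap) from by rw [← wires_par_seq], hc1, hc2, hc5, hc6, hfront]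
  rw [h1, h2, h3, h4, h5]

/-! ### The pendant `Z^{(0,1)} ⨾ T` of the ladder (figs. `…-proof-aux_00–02`) -/

/-- `∪ ⨾ (𝕀 ⊗ (Tᵗ ⨾ Z^{(1,0)})) = Z^{(0,1)} ⨾ T`. [cite: JeandelPerdrixVilmart2018, §2.2, §6] -/
theorem cup_seq_par_triangleT_effect : mk cup ⨟ (mk (wires 1) ⊠ ((mk triangle).transpose ⨟ mk (Z 1 0 0))) = mk (Z 0 1 0) ⨟ mk triangle := by
  rw [wires_par_seq, ← seq_assoc, hb_cup_seq_par_triangleT, seq_assoc, slide, ← seq_assoc, cup_seq_par_effect, par_empty]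

/-- The pendant state `Z^{(0,1)} ⨾ T` on the second input of a green merge is the pendant effect `Tᵗ ⨾ Z^{(1,0)}` on the
second output of a green copy. [cite: JeandelPerdrixVilmart2018, §2.2, §6] -/
theorem pendant_state_merge_eq : (mk (wires 1) ⊠ (mk (Z 0 1 0) ⨟ mk triangle)) ⨟ mk (Z 2 1 0) = mk (Z 1 2 0) ⨟ (mk (wires 1) ⊠ ((mk triangle).transpose ⨟ mk (Z 1 0 0))) := by
  rw [← par_cup_seq_merge_par, seq_assoc, show (mk (Z 2 1 0) ⊠ mk (wires 1)) ⨟ (mk (wires 1) ⊠ ((mk triangle).transpose ⨟ mk (Z 1 0 0))) = (mk (wires 2) ⊠ ((mk triangle).transpose ⨟ mk (Z 1 0 0))) ⨟ mk (Z 2 1 0) from by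
      rw [interchange, seq_id, id_seq, par_eq_seq_right (mk (Z 2 1 0)) ((mk triangle).transpose ⨟ mk (Z 1 0 0)), par_empty],
    ← seq_assoc, show mk (wires 2) ⊠ ((mk triangle).transpose ⨟ mk (Z 1 0 0)) = mk (wires 1) ⊠ (mk (wires 1) ⊠ ((mk triangle).transpose ⨟ mk (Z 1 0 0))) from by rw [← wires_par_wires 1 1]; exact (par_assoc _ _ _).trans (cast_id _ _ _),
    ← wires_par_seq, cup_seq_par_triangleT_effect]

/-- `σ ⨾ (𝕀 ⊗ E) = E ⊗ 𝕀` for an effect `E`. [cite: JeandelPerdrixVilmart2018, §2.2] -/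
theorem swap_seq_par_effect (F : ZXClass 1 0) : mk swap ⨟ (mk (wires 1) ⊠ F) = F ⊠ mk (wires 1) := by
  rw [← swap_seq_effect_par F, ← seq_assoc, swap_seq_swap, id_seq]

/-- **Appendix Lemma 33 on the ladder's node** (figs. `…-proof-aux_00–02`): the green node fed by the pendant
`Z^{(0,1)} ⨾ T`, whose first output carries `T ⨾ H`, is `√2 ⊗` a copy whose first output carries `X(π) ⨾ T`:
`((𝕀 ⊗ (Z ⨾ T)) ⨾ Z^{(2,2)}) ⨾ ((T ⨾ H) ⊗ 𝕀) = √2 ⊗ (Z^{(1,2)} ⨾ ((X(π) ⨾ T) ⊗ 𝕀))`.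
[cite: JeandelPerdrixVilmart2018, Appendix Lemma 33, proof of Lemma 34] -/
theorem pendant_node_triangle_hBox :
    ((mk (wires 1) ⊠ (mk (Z 0 1 0) ⨟ mk triangle)) ⨟ mk (Z 2 2 0)) ⨟ ((mk triangle ⨟ mk hBox) ⊠ mk (wires 1)) = mk (dumbbell 0 0) ⊠ (mk (Z 1 2 0) ⨟ ((mk (X 1 1 4) ⨟ mk triangle) ⊠ mk (wires 1))) := by
  rw [show mk (Z 2 2 0) = mk (Z 2 1 0) ⨟ mk (Z 1 2 0) from by rw [Z_seq_Z 2 1 2 le_rfl, add_zero], ← seq_assoc, pendant_state_merge_eq, seq_assoc (mk (Z 1 2 0)),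
    show (mk (wires 1) ⊠ ((mk triangle).transpose ⨟ mk (Z 1 0 0))) ⨟ mk (Z 1 2 0) = mk (Z 1 2 0) ⊠ ((mk triangle).transpose ⨟ mk (Z 1 0 0)) from by rw [par_eq_seq_right (mk (Z 1 2 0)) ((mk triangle).transpose ⨟ mk (Z 1 0 0)), par_empty],
    show mk (Z 1 2 0) ⊠ ((mk triangle).transpose ⨟ mk (Z 1 0 0)) = (mk (Z 1 2 0) ⊠ mk (wires 1)) ⨟ (mk (wires 2) ⊠ ((mk triangle).transpose ⨟ mk (Z 1 0 0))) from par_eq_seq_left _ _, ← seq_assoc, Z_seq_Z_par 1 1 1 2 le_rfl, add_zero (0 : ZMod 8), show mk (Z 1 (2 + 1) 0) = mk (Z 1 3 0) ⨟ (mk (wires 1) ⊠ mk swap) from Z_one_three_seq_par_swap.symm, seq_assoc, seq_assoc, show mk (wires 2) ⊠ ((mk triangle).transpose ⨟ mk (Z 1 0 0)) = mk (wires 1) ⊠ (mk (wires 1) ⊠ ((mk triangle).transpose ⨟ mk (Z 1 0 0))) from by rw [← wires_par_wires 1 1]; exact (par_assoc _ _ _).trans (cast_id _ _ _),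
    ← seq_assoc (mk (wires 1) ⊠ mk swap), ← wires_par_seq, swap_seq_par_effect,
    show mk (Z 1 3 0) = mk (Z 1 2 0) ⨟ (mk (Z 1 2 0) ⊠ mk (wires 1)) from by rw [Z_seq_Z_par 1 1 1 2 le_rfl, add_zero], seq_assoc,
    show mk (wires 1) ⊠ (((mk triangle).transpose ⨟ mk (Z 1 0 0)) ⊠ mk (wires 1)) = (mk (wires 1) ⊠ ((mk triangle).transpose ⨟ mk (Z 1 0 0))) ⊠ mk (wires 1) from (par_assoc' _ _ _).trans (cast_id _ _ _), ← seq_par_wires, ← seq_par_wires,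
    show (mk (wires 1) ⊠ ((mk triangle).transpose ⨟ mk (Z 1 0 0))) ⨟ (mk triangle ⨟ mk hBox) = (mk triangle ⨟ mk hBox) ⊠ ((mk triangle).transpose ⨟ mk (Z 1 0 0)) from by rw [par_eq_seq_right (mk triangle ⨟ mk hBox) ((mk triangle).transpose ⨟ mk (Z 1 0 0)), par_empty],
    split_seq_triangle_hBox_par_pendant, show (mk (dumbbell 0 0) ⊠ (mk (X 1 1 4) ⨟ mk triangle)) ⊠ mk (wires 1) = mk (dumbbell 0 0) ⊠ ((mk (X 1 1 4) ⨟ mk triangle) ⊠ mk (wires 1)) from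
      (par_assoc _ _ _).trans (cast_id _ _ _),
    show ∀ (A : ZXClass 1 2) (s : ZXClass 0 0) (B : ZXClass 2 2), A ⨟ (s ⊠ B) = s ⊠ (A ⨟ B) from fun A s B => by rw [scalar_par_seq_right, empty_par, cast_id]]

/-- **A red phase in front of a green copy is a bialgebra square with the phase as a copied red state**:
`X(b) ⨾ Z^{(1,2)} = √2 ⊗ (((X(b) ⨾ Z^{(1,2)}) ⊗ Z^{(1,2)}) ⨾ (𝕀 ⊗ σ ⊗ 𝕀) ⨾ (X^{(2,1)} ⊗ X^{(2,1)}))` ((B2) fed with the red state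
`X(b)`). [cite: JeandelPerdrixVilmart2018, Fig. 1 (B2), (S1)] -/
theorem xphase_seq_split_eq_square (b : ZMod 8) :
    mk (X 1 1 b) ⨟ mk (Z 1 2 0) =
      mk (dumbbell 0 0) ⊠ ((((mk (X 0 1 b) ⨟ mk (Z 1 2 0)) ⊠ mk (Z 1 2 0)) ⨟ ((mk (wires 1) ⊠ mk swap) ⊠ mk (wires 1))) ⨟ (mk (X 2 1 0) ⊠ mk (X 2 1 0))) := by
  rw [show mk (X 1 1 b) = (mk (X 0 1 b) ⊠ mk (wires 1)) ⨟ mk (X 2 1 0) from by rw [X_par_seq_X 0 1 1 1 le_rfl, add_zero b], seq_assoc, ← rule_B2,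
    show ∀ (A : ZXClass 1 2) (s : ZXClass 0 0) (B : ZXClass 2 2), A ⨟ (s ⊠ B) = s ⊠ (A ⨟ B) from fun A s B => by rw [scalar_par_seq_right, empty_par, cast_id],
    ← seq_assoc (mk (X 0 1 b) ⊠ mk (wires 1)), ← seq_assoc (mk (X 0 1 b) ⊠ mk (wires 1)), interchange, id_seq]

/-! ### The bialgebra square of figs. `…-proof-aux_02/03` -/

/-- The two drawings of CNOT agree: `(𝕀 ⊗ Z^{(1,2)}) ⨾ (X^{(2,1)} ⊗ 𝕀) = (X^{(1,2)} ⊗ 𝕀) ⨾ (𝕀 ⊗ Z^{(2,1)})`.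
This is `cnot21_eq` of `ZXCalculusTriangleLemmas`; the proofs below (and `ZXCalculusHangingBranchBent`)
now rewrite with `cnot21_eq` directly and this name is kept only as a deprecated alias (librarian
dedup-02119, dedup-02409). [cite: JeandelPerdrixVilmart2018, §2.2] -/
@[deprecated cnot21_eq (since := "2026-08-16")]
theorem cnot_alt : (mk (wires 1) ⊠ mk (Z 1 2 0)) ⨟ (mk (X 2 1 0) ⊠ mk (wires 1)) = ((mk (X 1 2 0) ⊠ mk (wires 1)) ⨟ (mk (wires 1) ⊠ mk (Z 2 1 0))) :=
  cnot21_eq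

/-- A red state merged (green) into a wire is a red effect on a (green) copy of it:
`(𝕀 ⊗ X(b)) ⨾ Z^{(2,1)} = Z^{(1,2)} ⨾ (X^{(1,0)}(b) ⊗ 𝕀)`. [cite: JeandelPerdrixVilmart2018, §2.2] -/
theorem par_xstate_seq_merge_eq_split_par_xeffect (b : ZMod 8) : (mk (wires 1) ⊠ mk (X 0 1 b)) ⨟ mk (Z 2 1 0) = (mk (Z 1 2 0) ⨟ (mk (X 1 0 b) ⊠ mk (wires 1))) := by
  rw [← cup_seq_par_xeffect, wires_par_seq, show mk (wires 1) ⊠ (mk (wires 1) ⊠ mk (X 1 0 b)) = mk (wires 2) ⊠ mk (X 1 0 b) from by rw [← wires_par_wires 1 1]; exact (par_assoc' _ _ _).trans (cast_id _ _ _),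
    seq_assoc, show (mk (wires 2) ⊠ mk (X 1 0 b)) ⨟ mk (Z 2 1 0) = (mk (Z 2 1 0) ⊠ mk (wires 1)) ⨟ (mk (wires 1) ⊠ mk (X 1 0 b)) from by
      rw [interchange, id_seq, seq_id, par_eq_seq_right (mk (Z 2 1 0)) (mk (X 1 0 b)), par_empty],
    ← seq_assoc, par_cup_seq_merge_par]
  nth_rewrite 1 [← Z_seq_swap 1 0]; rw [seq_assoc, swap_seq_par_effect]

/-- **A red phase behind one output of a green copy is a bialgebra square** (figs. `…-proof-aux_02/03`): the red `π/2`
of the transposed triangle on the rung, split as a red state merged in, expands by (B2) into a red copy, a green node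
carrying the red leaf, a green copy and a red merge:
`Z^{(1,2)} ⨾ (𝕀 ⊗ X(b)) = √2 ⊗ (X^{(1,2)} ⨾ ((Z^{(1,2)} ⨾ (X^{(1,0)}(b) ⊗ 𝕀)) ⊗ Z^{(1,2)}) ⨾ (X^{(2,1)} ⊗ 𝕀))`.
[cite: JeandelPerdrixVilmart2018, Fig. 1 (B2), proof of Appendix Lemma 34] -/
theorem split_par_xphase_eq_square (b : ZMod 8) :
    mk (Z 1 2 0) ⨟ (mk (wires 1) ⊠ mk (X 1 1 b)) = mk (dumbbell 0 0) ⊠ (mk (X 1 2 0) ⨟ (((mk (Z 1 2 0) ⨟ (mk (X 1 0 b) ⊠ mk (wires 1))) ⊠ mk (Z 1 2 0)) ⨟ (mk (X 2 1 0) ⊠ mk (wires 1)))) := by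
  have hfeed : mk (Z 1 2 0) ⨟ (mk (wires 1) ⊠ mk (X 1 1 b)) = (mk (wires 1) ⊠ mk (X 0 1 b)) ⨟ ((mk (Z 1 2 0) ⊠ mk (wires 1)) ⨟ (mk (wires 1) ⊠ mk (X 2 1 0))) := by
    rw [show mk (X 1 1 b) = (mk (wires 1) ⊠ mk (X 0 1 b)) ⨟ mk (X 2 1 0) from by rw [par_X_seq_X 1 0 1 1 le_rfl, zero_add b], wires_par_seq, ← seq_assoc,
      show mk (wires 1) ⊠ (mk (wires 1) ⊠ mk (X 0 1 b)) = mk (wires 2) ⊠ mk (X 0 1 b) from by rw [← wires_par_wires 1 1]; exact (par_assoc' _ _ _).trans (cast_id _ _ _),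
      show mk (Z 1 2 0) ⨟ (mk (wires 2) ⊠ mk (X 0 1 b)) = (mk (wires 1) ⊠ mk (X 0 1 b)) ⨟ (mk (Z 1 2 0) ⊠ mk (wires 1)) from by
        rw [← par_eq_seq_right (mk (Z 1 2 0)) (mk (X 0 1 b)), par_eq_seq_left (mk (Z 1 2 0)) (mk (X 0 1 b)), par_empty], seq_assoc]
  have hNC : (mk (wires 1) ⊠ mk (X 0 1 b)) ⨟ ((mk (X 1 2 0) ⊠ mk (wires 1)) ⨟ (mk (wires 1) ⊠ mk (Z 2 1 0))) = mk (X 1 2 0) ⨟ (mk (wires 1) ⊠ (mk (Z 1 2 0) ⨟ (mk (X 1 0 b) ⊠ mk (wires 1)))) := by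
    rw [← seq_assoc, show (mk (wires 1) ⊠ mk (X 0 1 b)) ⨟ (mk (X 1 2 0) ⊠ mk (wires 1)) = mk (X 1 2 0) ⨟ (mk (wires 1) ⊠ (mk (wires 1) ⊠ mk (X 0 1 b))) from by
        rw [interchange, id_seq, seq_id, par_eq_seq_left (mk (X 1 2 0)) (mk (X 0 1 b)), par_empty, ← wires_par_wires 1 1]
        exact congrArg _ ((par_assoc _ _ _).trans (cast_id _ _ _)),
      seq_assoc, ← wires_par_seq, par_xstate_seq_merge_eq_split_par_xeffect]
  rw [hfeed, rule_B2_cnot, show ∀ (A : ZXClass 1 2) (s : ZXClass 0 0) (B : ZXClass 2 2), A ⨟ (s ⊠ B) = s ⊠ (A ⨟ B) from fun A s B => by rw [scalar_par_seq_right, empty_par, cast_id],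
    ← seq_assoc (mk (wires 1) ⊠ mk (X 0 1 b)) (((mk (X 1 2 0) ⊠ mk (wires 1)) ⨟ (mk (wires 1) ⊠ mk (Z 2 1 0))) ⨟ mk swap) ((mk (X 1 2 0) ⊠ mk (wires 1)) ⨟ (mk (wires 1) ⊠ mk (Z 2 1 0))), ← seq_assoc (mk (wires 1) ⊠ mk (X 0 1 b)) ((mk (X 1 2 0) ⊠ mk (wires 1)) ⨟ (mk (wires 1) ⊠ mk (Z 2 1 0))) (mk swap), hNC,
    seq_assoc (mk (X 1 2 0)) (mk (wires 1) ⊠ (mk (Z 1 2 0) ⨟ (mk (X 1 0 b) ⊠ mk (wires 1)))) (mk swap), show (mk (wires 1) ⊠ (mk (Z 1 2 0) ⨟ (mk (X 1 0 b) ⊠ mk (wires 1)))) ⨟ mk swap = mk swap ⨟ ((mk (Z 1 2 0) ⨟ (mk (X 1 0 b) ⊠ mk (wires 1))) ⊠ mk (wires 1)) from (swap_seq_par_one_one _ _).symm,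
    ← seq_assoc (mk (X 1 2 0)) (mk swap), X_seq_swap, seq_assoc (mk (X 1 2 0)) ((mk (Z 1 2 0) ⨟ (mk (X 1 0 b) ⊠ mk (wires 1))) ⊠ mk (wires 1)) ((mk (X 1 2 0) ⊠ mk (wires 1)) ⨟ (mk (wires 1) ⊠ mk (Z 2 1 0))), ← cnot21_eq,
    ← seq_assoc ((mk (Z 1 2 0) ⨟ (mk (X 1 0 b) ⊠ mk (wires 1))) ⊠ mk (wires 1)) (mk (wires 1) ⊠ mk (Z 1 2 0)) (mk (X 2 1 0) ⊠ mk (wires 1)), show ((mk (Z 1 2 0) ⨟ (mk (X 1 0 b) ⊠ mk (wires 1))) ⊠ mk (wires 1)) ⨟ (mk (wires 1) ⊠ mk (Z 1 2 0)) = (mk (Z 1 2 0) ⨟ (mk (X 1 0 b) ⊠ mk (wires 1))) ⊠ mk (Z 1 2 0) from by rw [interchange, seq_id, id_seq]]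

/-! ### Small tools for figs. `…-proof-aux_02/03` -/

/-- The scalar `Z ⨾ X^{(1,0)}` is `√2`: `Z^{(0,1)} ⨾ X^{(1,0)} = X^{(0,1)} ⨾ Z^{(1,0)}`. [cite: JeandelPerdrixVilmart2018, Fig. 1 (H)] -/
theorem Z_state_seq_X_effect_eq_dumbbell : mk (Z 0 1 0) ⨟ mk (X 1 0 0) = mk (dumbbell 0 0) := by
  rw [Z_eq_conj 0 1 0, X_eq_conj 1 0 0, hTensor_zero, hTensor_one, id_seq, seq_id, seq_assoc, ← seq_assoc (mk hBox) (mk hBox), hBox_seq_hBox, id_seq]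
  rfl

/-- **The rung of fig. `…-proof-aux_02` expanded** (def. of the triangle and (K1)):
`Tᵗ ⨾ X(π) = X(π/2) ⨾ Z(π/4) ⨾ xLeafL π (π/4) ⨾ Gn_π`. [cite: JeandelPerdrixVilmart2018, §6 (def. of the triangle), Fig. 1 (K), proof of Appendix Lemma 34] -/
theorem triangleT_seq_X_pi :
    (mk triangle).transpose ⨟ mk (X 1 1 4) = mk (X 1 1 2) ⨟ mk (Z 1 1 1) ⨟ mk (xLeafL 4 1) ⨟ (mk (Z 1 2 0) ⨟ (mk (wires 1) ⊠ (mk (X 1 2 4) ⨟ (mk (Z 1 0 (-1)) ⊠ mk (Z 1 0 (-1)))))) := by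
  rw [triangle_transpose_explicit, seq_assoc, gadgetNode_seq_X_pi, ← seq_assoc, seq_assoc (mk (X 1 1 2) ⨟ mk (Z 1 1 1)), xLeafL_zero_seq_X_pi]

/-- `pendant_node_triangle_hBox` with the pendant on the first input and the triangle on the second output (the layout of
fig. `…-proof-aux_00`): `(((Z ⨾ T) ⊗ 𝕀) ⨾ Z^{(2,2)}) ⨾ (𝕀 ⊗ (T ⨾ H)) = √2 ⊗ (Z^{(1,2)} ⨾ (𝕀 ⊗ (X(π) ⨾ T)))`.
[cite: JeandelPerdrixVilmart2018, Appendix Lemma 33, proof of Lemma 34] -/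
theorem pendant_node_triangle_hBox' :
    (((mk (Z 0 1 0) ⨟ mk triangle) ⊠ mk (wires 1)) ⨟ mk (Z 2 2 0)) ⨟ (mk (wires 1) ⊠ (mk triangle ⨟ mk hBox)) = mk (dumbbell 0 0) ⊠ (mk (Z 1 2 0) ⨟ (mk (wires 1) ⊠ (mk (X 1 1 4) ⨟ mk triangle))) := by
  rw [← par_state_seq_swap (mk (wires 1)) (mk (Z 0 1 0) ⨟ mk triangle), seq_assoc _ (mk swap), swap_seq_Z, ← Z_seq_swap 2 0, seq_assoc, seq_assoc, swap_seq_par_one_one,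
    ← seq_assoc (mk (Z 2 2 0)), ← seq_assoc (mk (wires 1) ⊠ (mk (Z 0 1 0) ⨟ mk triangle)) (mk (Z 2 2 0) ⨟ ((mk triangle ⨟ mk hBox) ⊠ mk (wires 1))) (mk swap), ← seq_assoc (mk (wires 1) ⊠ (mk (Z 0 1 0) ⨟ mk triangle)) (mk (Z 2 2 0)) ((mk triangle ⨟ mk hBox) ⊠ mk (wires 1)),
    pendant_node_triangle_hBox,
    show ∀ (s : ZXClass 0 0) (A : ZXClass 1 2) (B : ZXClass 2 2), (s ⊠ A) ⨟ B = s ⊠ (A ⨟ B) from fun s A B => by rw [scalar_par_seq_left, empty_par, cast_id],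
    seq_assoc, ← swap_seq_par_one_one, ← seq_assoc, Z_seq_swap]

/-- **Appendix Lemma 33 at the node `g26` of fig. `…-proof-aux_01`**: the branch that merges the pendant `Z ⨾ T` and then
carries `T ⨾ H` is `√2 ⊗ (X(π) ⨾ T)`: `((𝕀 ⊗ (Z ⨾ T)) ⨾ Z^{(2,1)}) ⨾ T ⨾ H = √2 ⊗ (X(π) ⨾ T)`.
[cite: JeandelPerdrixVilmart2018, Appendix Lemma 33, proof of Lemma 34] -/
theorem pendant_branch_triangle_hBox :
    ((mk (wires 1) ⊠ (mk (Z 0 1 0) ⨟ mk triangle)) ⨟ mk (Z 2 1 0)) ⨟ mk triangle ⨟ mk hBox = mk (dumbbell 0 0) ⊠ (mk (X 1 1 4) ⨟ mk triangle) := by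
  rw [pendant_state_merge_eq, seq_assoc, seq_assoc, ← seq_assoc (mk (wires 1) ⊠ ((mk triangle).transpose ⨟ mk (Z 1 0 0))),
    show (mk (wires 1) ⊠ ((mk triangle).transpose ⨟ mk (Z 1 0 0))) ⨟ mk triangle = mk triangle ⊠ ((mk triangle).transpose ⨟ mk (Z 1 0 0)) from by rw [par_eq_seq_right (mk triangle) ((mk triangle).transpose ⨟ mk (Z 1 0 0)), par_empty],
    show (mk triangle ⊠ ((mk triangle).transpose ⨟ mk (Z 1 0 0))) ⨟ mk hBox = (mk triangle ⨟ mk hBox) ⊠ ((mk triangle).transpose ⨟ mk (Z 1 0 0)) from by rw [par_eq_seq_right (mk triangle ⨟ mk hBox) ((mk triangle).transpose ⨟ mk (Z 1 0 0)), par_empty, par_eq_seq_right (mk triangle) ((mk triangle).transpose ⨟ mk (Z 1 0 0)), par_empty, seq_assoc],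
    split_seq_triangle_hBox_par_pendant]

/-- The green node with a red `π/2` leaf of figs. `…-proof-aux_03–06` is a `-π/2` green phase (up to scalars):
`Z^{(1,2)} ⨾ (X^{(1,0)}(π/2) ⊗ 𝕀) = 1/√2 ⊗ Z^{(0,0)}(π/2) ⊗ Z(-π/2)`. [cite: JeandelPerdrixVilmart2018, Appendix Lemma 10, (S1)] -/
theorem split_par_xeffect_two : mk (Z 1 2 0) ⨟ (mk (X 1 0 2) ⊠ mk (wires 1)) = mk invSqrtTwo ⊠ (mk (Z 0 0 2) ⊠ mk (Z 1 1 (-2))) := by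
  rw [X_effect_two, show (mk invSqrtTwo ⊠ (mk (Z 0 0 2) ⊠ mk (Z 1 0 (-2)))) ⊠ mk (wires 1) = mk invSqrtTwo ⊠ (mk (Z 0 0 2) ⊠ (mk (Z 1 0 (-2)) ⊠ mk (wires 1))) from
      (par_assoc _ _ _).trans ((cast_id _ _ _).trans (congrArg _ ((par_assoc _ _ _).trans (cast_id _ _ _)))),
    show ∀ (A : ZXClass 1 2) (s : ZXClass 0 0) (B : ZXClass 2 1), A ⨟ (s ⊠ B) = s ⊠ (A ⨟ B) from fun A s B => by rw [scalar_par_seq_right, empty_par, cast_id],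
    show ∀ (A : ZXClass 1 2) (s : ZXClass 0 0) (B : ZXClass 2 1), A ⨟ (s ⊠ B) = s ⊠ (A ⨟ B) from fun A s B => by rw [scalar_par_seq_right, empty_par, cast_id],
    Z_seq_Z_par 1 1 1 0 le_rfl, add_zero (-2 : ZMod 8)]

end ZXClass

end Literature.Computability.QuantumComplexity


namespace Literature.Computability.QuantumComplexity

open ZXDiagram

namespace ZXClass

/-! ### The auxiliary computation of Appendix Lemma 34 (figs. `…-proof-aux_00–10`): the ladder state collapses -/

/-- Scalar mover (bookkeeping): `(s ⊗ A) ⨾ B = s ⊗ (A ⨾ B)` for `A : 0 → 3`, `B : 3 → 2`. [folklore] -/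
private theorem mvl_0_3_2 (s : ZXClass 0 0) (A : ZXClass 0 3) (B : ZXClass 3 2) : (s ⊠ A) ⨟ B = s ⊠ (A ⨟ B) := by
  rw [scalar_par_seq_left, empty_par, cast_id]

/-- Scalar mover (bookkeeping): `(s ⊗ A) ⨾ B = s ⊗ (A ⨾ B)` for `A : 0 → 3`, `B : 3 → 3`. [folklore] -/
private theorem mvl_0_3_3 (s : ZXClass 0 0) (A : ZXClass 0 3) (B : ZXClass 3 3) : (s ⊠ A) ⨟ B = s ⊠ (A ⨟ B) := by
  rw [scalar_par_seq_left, empty_par, cast_id]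

/-- Scalar mover (bookkeeping): `(s ⊗ A) ⨾ B = s ⊗ (A ⨾ B)` for `A : 0 → 2`, `B : 2 → 3`. [folklore] -/
private theorem mvl_0_2_3 (s : ZXClass 0 0) (A : ZXClass 0 2) (B : ZXClass 2 3) : (s ⊠ A) ⨟ B = s ⊠ (A ⨟ B) := by
  rw [scalar_par_seq_left, empty_par, cast_id]

/-- Scalar mover (bookkeeping): `A ⨾ (s ⊗ B) = s ⊗ (A ⨾ B)` for `A : 0 → 2`, `B : 2 → 3`. [folklore] -/
private theorem mvr_0_2_3 (A : ZXClass 0 2) (s : ZXClass 0 0) (B : ZXClass 2 3) : A ⨟ (s ⊠ B) = s ⊠ (A ⨟ B) := by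
  rw [scalar_par_seq_right, empty_par, cast_id]

/-- First step of the auxiliary computation (figs. `…-proof-aux_00–02`, Appendix Lemma 33 at the pendant node):
the ladder state equals `√2 ⊗` the same state with the pendant node replaced by a copy whose rung carries
`X(π) ⨾ T ⨾ H` (a pair of Hadamards being inserted on the rung).
[cite: JeandelPerdrixVilmart2018, Appendix Lemma 33, proof of Lemma 34] -/
theorem ladder_pendant (a : ZMod 8) :
    ((mk (Z 0 1 0) ⨟ mk triangle) ⊠ mk (X 0 1 a)) ⨟ (mk (wires 1) ⊠ mk (Z 1 2 0)) ⨟ ((mk (wires 1) ⊠ mk (X 1 1 a)) ⊠ mk (wires 1))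
      ⨟ (mk (Z 2 2 0) ⊠ mk (wires 1)) ⨟ ((mk (wires 1) ⊠ mk triangle) ⊠ mk (wires 1)) ⨟ (mk (wires 1) ⊠ mk (X 2 1 0))
      ⨟ (mk (X 1 2 0) ⊠ mk (wires 1)) ⨟ (mk (wires 1) ⊠ mk (Z 2 1 0)) =
    mk (dumbbell 0 0) ⊠ (mk (X 0 1 a) ⨟ mk (Z 1 2 0) ⨟ (mk (X 1 1 a) ⊠ mk (wires 1))
      ⨟ ((mk (Z 1 2 0) ⨟ (mk (wires 1) ⊠ (mk (X 1 1 4) ⨟ mk triangle ⨟ mk hBox))) ⊠ mk (wires 1))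
      ⨟ (mk (wires 1) ⊠ mk (X 2 1 0)) ⨟ (mk (X 1 2 0) ⊠ mk (wires 1)) ⨟ (mk (wires 1) ⊠ mk (Z 2 1 0))) := by
  -- the pendant block, with a pair of Hadamards inserted on the rung
  have hblk : (((mk (Z 0 1 0) ⨟ mk triangle) ⊠ mk (wires 1)) ⨟ mk (Z 2 2 0)) ⨟ (mk (wires 1) ⊠ mk triangle) =
      mk (dumbbell 0 0) ⊠ (mk (Z 1 2 0) ⨟ (mk (wires 1) ⊠ (mk (X 1 1 4) ⨟ mk triangle ⨟ mk hBox))) := by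
    rw [show mk (wires 1) ⊠ mk triangle = (mk (wires 1) ⊠ (mk triangle ⨟ mk hBox)) ⨟ (mk (wires 1) ⊠ mk hBox) from by
        rw [← wires_par_seq, seq_assoc, hBox_seq_hBox, seq_id],
      ← seq_assoc, pendant_node_triangle_hBox', scalar_par_one_two_seq_two, seq_assoc (mk (Z 1 2 0)), ← wires_par_seq]
  -- isolate the pendant block inside the ladder
  have hpre : ((mk (Z 0 1 0) ⨟ mk triangle) ⊠ mk (X 0 1 a)) ⨟ (mk (wires 1) ⊠ mk (Z 1 2 0)) ⨟ ((mk (wires 1) ⊠ mk (X 1 1 a)) ⊠ mk (wires 1))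
      ⨟ (mk (Z 2 2 0) ⊠ mk (wires 1)) ⨟ ((mk (wires 1) ⊠ mk triangle) ⊠ mk (wires 1)) =
      mk (X 0 1 a) ⨟ mk (Z 1 2 0) ⨟ (mk (X 1 1 a) ⊠ mk (wires 1))
        ⨟ (((((mk (Z 0 1 0) ⨟ mk triangle) ⊠ mk (wires 1)) ⨟ mk (Z 2 2 0)) ⨟ (mk (wires 1) ⊠ mk triangle)) ⊠ mk (wires 1)) := by
    rw [par_eq_seq_right (mk (Z 0 1 0) ⨟ mk triangle) (mk (X 0 1 a)), empty_par, cast_id, seq_assoc (mk (X 0 1 a)), slide, empty_par, cast_id,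
      seq_assoc (mk (X 0 1 a)), seq_assoc (mk (Z 1 2 0)),
      show (mk (wires 1) ⊠ mk (X 1 1 a)) ⊠ mk (wires 1) = mk (wires 1) ⊠ (mk (X 1 1 a) ⊠ mk (wires 1)) from (par_assoc _ _ _).trans (cast_id _ _ _),
      slide, empty_par, cast_id, ← seq_assoc (mk (Z 1 2 0)), ← seq_assoc (mk (X 0 1 a)), ← wires_par_wires 1 1,
      show (mk (Z 0 1 0) ⨟ mk triangle) ⊠ (mk (wires 1) ⊠ mk (wires 1)) = ((mk (Z 0 1 0) ⨟ mk triangle) ⊠ mk (wires 1)) ⊠ mk (wires 1) from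
        (par_assoc' _ _ _).trans (cast_id _ _ _),
      seq_assoc _ (((mk (Z 0 1 0) ⨟ mk triangle) ⊠ mk (wires 1)) ⊠ mk (wires 1)) (mk (Z 2 2 0) ⊠ mk (wires 1)), ← seq_par_wires,
      seq_assoc _ ((((mk (Z 0 1 0) ⨟ mk triangle) ⊠ mk (wires 1)) ⨟ mk (Z 2 2 0)) ⊠ mk (wires 1)), ← seq_par_wires]
    simp only [seq_assoc]
  rw [hpre, hblk, show (mk (dumbbell 0 0) ⊠ (mk (Z 1 2 0) ⨟ (mk (wires 1) ⊠ (mk (X 1 1 4) ⨟ mk triangle ⨟ mk hBox)))) ⊠ mk (wires 1) =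
      mk (dumbbell 0 0) ⊠ ((mk (Z 1 2 0) ⨟ (mk (wires 1) ⊠ (mk (X 1 1 4) ⨟ mk triangle ⨟ mk hBox))) ⊠ mk (wires 1)) from
      (par_assoc _ _ _).trans (cast_id _ _ _), mvr_0_2_3, mvl_0_3_2, mvl_0_2_3, mvl_0_3_2]

/-- The root of the ladder in green (figs. `…-proof-aux_00/01`): a red `α` state copied, with `X(α)` on the first copy,
is a green `α` pair with a Hadamard on the first leg and the leaf `xLeafL 0 α` then a Hadamard on the second:
`X(α) ⨾ Z^{(1,2)} ⨾ (X(α) ⊗ 𝕀) = Z^{(0,2)}(α) ⨾ (H ⊗ xLeafL 0 α) ⨾ (𝕀 ⊗ H)`. [cite: JeandelPerdrixVilmart2018, Fig. 1 (H), proof of Appendix Lemma 34] -/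
theorem xstate_copy_xphase_eq (a : ZMod 8) :
    mk (X 0 1 a) ⨟ mk (Z 1 2 0) ⨟ (mk (X 1 1 a) ⊠ mk (wires 1)) = mk (Z 0 2 a) ⨟ (mk hBox ⊠ mk (xLeafL 0 a)) ⨟ (mk (wires 1) ⊠ mk hBox) := by
  rw [← Z_state_seq_hBox, seq_assoc (mk (Z 0 1 a)), hBox_seq_Z_split, ← seq_assoc (mk (Z 0 1 a)), seq_assoc, interchange, seq_id, hBox_seq_X_phase,
    show (mk (Z 1 1 a) ⨟ mk hBox) ⊠ mk hBox = (mk (Z 1 1 a) ⊠ mk (wires 1)) ⨟ (mk hBox ⊠ mk hBox) from by rw [interchange, id_seq],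
    ← seq_assoc, ← Z_pair_par_xLeafL_eq, seq_assoc, interchange, id_seq, show mk (xLeafL 0 a) ⨟ mk hBox = (mk (xLeafL 0 a) ⨟ mk (wires 1)) ⨟ mk hBox from by rw [seq_id],
    show mk hBox = (mk hBox ⨟ mk (wires 1)) from (seq_id _).symm, ← interchange, seq_id, seq_id, seq_assoc]

/-- `(H ⊗ H) ⨾ X^{(2,1)} = Z^{(2,1)} ⨾ H`. [cite: JeandelPerdrixVilmart2018, Fig. 1 (H)] -/
theorem hBoxes_seq_X_merge : (mk hBox ⊠ mk hBox) ⨟ mk (X 2 1 0) = mk (Z 2 1 0) ⨟ mk hBox := by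
  rw [X_merge_eq, ← seq_assoc, ← seq_assoc, interchange, hBox_seq_hBox, wires_par_wires, id_seq]

/-- The bottom of the ladder in the colours of fig. `…-proof-aux_01`: a Hadamard on the second wire, the red copy
of the first wire and the green merge become the green copy (through Hadamards) and the red merge followed by a
Hadamard: `(𝕀 ⊗ H) ⨾ (X^{(1,2)} ⊗ 𝕀) ⨾ (𝕀 ⊗ Z^{(2,1)}) = ((H ⨾ Z^{(1,2)}) ⊗ 𝕀) ⨾ (H ⊗ (X^{(2,1)} ⨾ H))`.
[cite: JeandelPerdrixVilmart2018, Fig. 1 (H), proof of Appendix Lemma 34] -/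
theorem hWire_xsplit_merge_eq :
    (mk (wires 1) ⊠ mk hBox) ⨟ (mk (X 1 2 0) ⊠ mk (wires 1)) ⨟ (mk (wires 1) ⊠ mk (Z 2 1 0)) =
      ((mk hBox ⨟ mk (Z 1 2 0)) ⊠ mk (wires 1)) ⨟ (mk hBox ⊠ (mk (X 2 1 0) ⨟ mk hBox)) := by
  have h1 : (mk (wires 1) ⊠ mk hBox) ⨟ (mk (X 1 2 0) ⊠ mk (wires 1)) = ((mk hBox ⨟ mk (Z 1 2 0)) ⊠ mk (wires 1)) ⨟ ((mk hBox ⊠ mk hBox) ⊠ mk hBox) := by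
    rw [interchange, id_seq, seq_id]; symm; rw [interchange, id_seq, ← X_split_eq]
  have h2 : mk (wires 1) ⊠ mk (Z 2 1 0) = (mk (wires 1) ⊠ (mk hBox ⊠ mk hBox)) ⨟ (mk (wires 1) ⊠ (mk (X 2 1 0) ⨟ mk hBox)) := by
    rw [← wires_par_seq, ← seq_assoc, hBoxes_seq_X_merge, seq_assoc, hBox_seq_hBox, seq_id]
  have h3 : ((mk hBox ⊠ mk hBox) ⊠ mk hBox) ⨟ (mk (wires 1) ⊠ (mk hBox ⊠ mk hBox)) = (mk hBox ⊠ mk (wires 1)) ⊠ mk (wires 1) := by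
    rw [show mk (wires 1) ⊠ (mk hBox ⊠ mk hBox) = (mk (wires 1) ⊠ mk hBox) ⊠ mk hBox from (par_assoc' _ _ _).trans (cast_id _ _ _), interchange, hBox_seq_hBox,
      interchange, seq_id, hBox_seq_hBox]
  have h4 : ((mk hBox ⊠ mk (wires 1)) ⊠ mk (wires 1)) ⨟ (mk (wires 1) ⊠ (mk (X 2 1 0) ⨟ mk hBox)) = mk hBox ⊠ (mk (X 2 1 0) ⨟ mk hBox) := by
    rw [show (mk hBox ⊠ mk (wires 1)) ⊠ mk (wires 1) = mk hBox ⊠ mk (wires 2) from by rw [← wires_par_wires 1 1]; exact (par_assoc _ _ _).trans (cast_id _ _ _),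
      interchange, seq_id, id_seq]
  rw [h1, h2, seq_assoc, ← seq_assoc ((mk hBox ⊠ mk hBox) ⊠ mk hBox), h3, h4]

/-- Second step of the auxiliary computation (figs. `…-proof-aux_01/02`, colour changes only): the root in green,
the Hadamards of the rung and of the second wire absorbed by recolouring the two bottom nodes.
[cite: JeandelPerdrixVilmart2018, Fig. 1 (H), proof of Appendix Lemma 34] -/
theorem ladder_colour (a : ZMod 8) :
    mk (X 0 1 a) ⨟ mk (Z 1 2 0) ⨟ (mk (X 1 1 a) ⊠ mk (wires 1))
      ⨟ ((mk (Z 1 2 0) ⨟ (mk (wires 1) ⊠ (mk (X 1 1 4) ⨟ mk triangle ⨟ mk hBox))) ⊠ mk (wires 1))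
      ⨟ (mk (wires 1) ⊠ mk (X 2 1 0)) ⨟ (mk (X 1 2 0) ⊠ mk (wires 1)) ⨟ (mk (wires 1) ⊠ mk (Z 2 1 0)) =
    mk (Z 0 2 a) ⨟ (mk hBox ⊠ mk (xLeafL 0 a)) ⨟ ((mk (Z 1 2 0) ⨟ (mk (wires 1) ⊠ (mk (X 1 1 4) ⨟ mk triangle))) ⊠ mk (wires 1))
      ⨟ (mk (wires 1) ⊠ mk (Z 2 1 0)) ⨟ ((mk hBox ⨟ mk (Z 1 2 0)) ⊠ mk (wires 1)) ⨟ (mk hBox ⊠ (mk (X 2 1 0) ⨟ mk hBox)) := by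
  -- the rung's trailing Hadamard and the second wire's Hadamard meet at the red merge, which turns green
  have hrung : (mk (Z 1 2 0) ⨟ (mk (wires 1) ⊠ (mk (X 1 1 4) ⨟ mk triangle ⨟ mk hBox))) ⊠ mk (wires 1) =
      ((mk (Z 1 2 0) ⨟ (mk (wires 1) ⊠ (mk (X 1 1 4) ⨟ mk triangle))) ⊠ mk (wires 1)) ⨟ ((mk (wires 1) ⊠ mk hBox) ⊠ mk (wires 1)) := by
    symm; rw [← seq_par_wires, seq_assoc, ← wires_par_seq]
  have hmid0 : (mk (wires 2) ⊠ mk hBox) ⨟ ((mk (wires 1) ⊠ mk hBox) ⊠ mk (wires 1)) ⨟ (mk (wires 1) ⊠ mk (X 2 1 0)) = (mk (wires 1) ⊠ mk (Z 2 1 0)) ⨟ (mk (wires 1) ⊠ mk hBox) := by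
    rw [← wires_par_wires 1 1, show (mk (wires 1) ⊠ mk (wires 1)) ⊠ mk hBox = mk (wires 1) ⊠ (mk (wires 1) ⊠ mk hBox) from (par_assoc _ _ _).trans (cast_id _ _ _),
      show (mk (wires 1) ⊠ mk hBox) ⊠ mk (wires 1) = mk (wires 1) ⊠ (mk hBox ⊠ mk (wires 1)) from (par_assoc _ _ _).trans (cast_id _ _ _),
      ← wires_par_seq, ← wires_par_seq, interchange, id_seq, seq_id, hBoxes_seq_X_merge, wires_par_seq]
  have hmid : ∀ R : ZXClass 2 2, (mk (wires 2) ⊠ mk hBox) ⨟ (((mk (wires 1) ⊠ mk hBox) ⊠ mk (wires 1)) ⨟ ((mk (wires 1) ⊠ mk (X 2 1 0)) ⨟ R)) =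
      (mk (wires 1) ⊠ mk (Z 2 1 0)) ⨟ ((mk (wires 1) ⊠ mk hBox) ⨟ R) := fun R => by
    rw [← seq_assoc, ← seq_assoc, hmid0, seq_assoc]
  have hbot := hWire_xsplit_merge_eq
  rw [seq_assoc] at hbot
  rw [xstate_copy_xphase_eq, hrung, seq_assoc _ (mk (wires 1) ⊠ mk hBox), ← seq_assoc (mk (wires 1) ⊠ mk hBox),
    show (mk (wires 1) ⊠ mk hBox) ⨟ ((mk (Z 1 2 0) ⨟ (mk (wires 1) ⊠ (mk (X 1 1 4) ⨟ mk triangle))) ⊠ mk (wires 1)) =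
      ((mk (Z 1 2 0) ⨟ (mk (wires 1) ⊠ (mk (X 1 1 4) ⨟ mk triangle))) ⊠ mk (wires 1)) ⨟ (mk (wires 2) ⊠ mk hBox) from (slide _ _).symm]
  simp only [seq_assoc]
  rw [hmid, hbot]

/-- Scalar mover (bookkeeping): `(s ⊗ A) ⨾ B = s ⊗ (A ⨾ B)` for `A : 2 → 3`, `B : 3 → 2`. [folklore] -/
private theorem mvl_2_3_2 (s : ZXClass 0 0) (A : ZXClass 2 3) (B : ZXClass 3 2) : (s ⊠ A) ⨟ B = s ⊠ (A ⨟ B) := by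
  rw [scalar_par_seq_left, empty_par, cast_id]

/-- **The rung of fig. `…-proof-aux_02` becomes the bialgebra square of fig. `…-proof-aux_03`**: the copy whose second
output carries `X(π) ⨾ T` equals `Z^{(0,0)}(π/2) ⊗` a red copy, a green `-π/2` phase (the red `π/2` leaf of the square)
and a green `π/4` copy, the red merge, then the leaf `xLeafL π (π/4)` and the `π` gadget node of the transposed triangle.
[cite: JeandelPerdrixVilmart2018, Fig. 1 (B2), (K), §6 (def. of the triangle), proof of Appendix Lemma 34] -/
theorem rung_square :
    mk (Z 1 2 0) ⨟ (mk (wires 1) ⊠ (mk (X 1 1 4) ⨟ mk triangle)) =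
      mk (Z 0 0 2) ⊠ (mk (X 1 2 0) ⨟ (mk (Z 1 1 (-2)) ⊠ mk (Z 1 2 1))
        ⨟ (mk (X 2 1 0) ⊠ (mk (xLeafL 4 1) ⨟ (mk (Z 1 2 0) ⨟ (mk (wires 1) ⊠ (mk (X 1 2 4) ⨟ (mk (Z 1 0 (-1)) ⊠ mk (Z 1 0 (-1))))))))) := by
  rw [X_pi_seq_triangle, triangleT_seq_X_pi, wires_par_seq 1 (mk (X 1 1 2) ⨟ mk (Z 1 1 1) ⨟ mk (xLeafL 4 1)) _,
    wires_par_seq 1 (mk (X 1 1 2) ⨟ mk (Z 1 1 1)) _, wires_par_seq 1 (mk (X 1 1 2)) _, ← seq_assoc, ← seq_assoc, ← seq_assoc,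
    split_par_xphase_eq_square, split_par_xeffect_two,
    show (mk invSqrtTwo ⊠ (mk (Z 0 0 2) ⊠ mk (Z 1 1 (-2)))) ⊠ mk (Z 1 2 0) = mk invSqrtTwo ⊠ (mk (Z 0 0 2) ⊠ (mk (Z 1 1 (-2)) ⊠ mk (Z 1 2 0))) from
      (par_assoc _ _ _).trans ((cast_id _ _ _).trans (congrArg _ ((par_assoc _ _ _).trans (cast_id _ _ _)))),
    mvl_2_3_2, mvl_2_3_2, one_two_seq_scalar_par_two, one_two_seq_scalar_par_two, scalar_par_scalar_par (mk (dumbbell 0 0)) (mk invSqrtTwo), invSqrtTwo_par_sqrt_two_par_cancel, cast_id,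
    scalar_par_one_two_seq_two, scalar_par_one_two_seq_two, scalar_par_one_two_seq_two]
  congr 1
  simp only [seq_assoc]
  rw [← seq_assoc (mk (X 2 1 0) ⊠ mk (wires 1)) (mk (wires 1) ⊠ mk (Z 1 1 1)),
    show (mk (X 2 1 0) ⊠ mk (wires 1)) ⨟ (mk (wires 1) ⊠ mk (Z 1 1 1)) = (mk (wires 1) ⊠ (mk (wires 1) ⊠ mk (Z 1 1 1))) ⨟ (mk (X 2 1 0) ⊠ mk (wires 1)) from by
      symm
      rw [show mk (wires 1) ⊠ (mk (wires 1) ⊠ mk (Z 1 1 1)) = mk (wires 2) ⊠ mk (Z 1 1 1) from by rw [← wires_par_wires 1 1]; exact (par_assoc' _ _ _).trans (cast_id _ _ _),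
        interchange, id_seq, seq_id, interchange, id_seq, seq_id],
    seq_assoc (mk (wires 1) ⊠ (mk (wires 1) ⊠ mk (Z 1 1 1))), ← seq_assoc (mk (Z 1 1 (-2)) ⊠ mk (Z 1 2 0)) (mk (wires 1) ⊠ (mk (wires 1) ⊠ mk (Z 1 1 1))),
    interchange, seq_id, Z_seq_par_Z 1 1 1 1 le_rfl, zero_add, ← seq_assoc (mk (X 2 1 0) ⊠ mk (wires 1)) (mk (wires 1) ⊠ mk (xLeafL 4 1)),
    interchange, id_seq, seq_id, interchange, seq_id]

/-- Third step of the auxiliary computation (figs. `…-proof-aux_02/03`): the rung expanded into the bialgebra square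
(`rung_square`) inside the ladder. [cite: JeandelPerdrixVilmart2018, Fig. 1 (B2), proof of Appendix Lemma 34] -/
theorem ladder_square (a : ZMod 8) :
    mk (Z 0 2 a) ⨟ (mk hBox ⊠ mk (xLeafL 0 a)) ⨟ ((mk (Z 1 2 0) ⨟ (mk (wires 1) ⊠ (mk (X 1 1 4) ⨟ mk triangle))) ⊠ mk (wires 1))
      ⨟ (mk (wires 1) ⊠ mk (Z 2 1 0)) ⨟ ((mk hBox ⨟ mk (Z 1 2 0)) ⊠ mk (wires 1)) ⨟ (mk hBox ⊠ (mk (X 2 1 0) ⨟ mk hBox)) =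
    mk (Z 0 0 2) ⊠ (mk (Z 0 2 a) ⨟ (mk hBox ⊠ mk (xLeafL 0 a))
      ⨟ ((mk (X 1 2 0) ⨟ (mk (Z 1 1 (-2)) ⊠ mk (Z 1 2 1))
          ⨟ (mk (X 2 1 0) ⊠ (mk (xLeafL 4 1) ⨟ (mk (Z 1 2 0) ⨟ (mk (wires 1) ⊠ (mk (X 1 2 4) ⨟ (mk (Z 1 0 (-1)) ⊠ mk (Z 1 0 (-1))))))))) ⊠ mk (wires 1))
      ⨟ (mk (wires 1) ⊠ mk (Z 2 1 0)) ⨟ ((mk hBox ⨟ mk (Z 1 2 0)) ⊠ mk (wires 1)) ⨟ (mk hBox ⊠ (mk (X 2 1 0) ⨟ mk hBox))) := by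
  rw [rung_square, show ∀ (s : ZXClass 0 0) (A : ZXClass 1 2), (s ⊠ A) ⊠ mk (wires 1) = s ⊠ (A ⊠ mk (wires 1)) from fun s A => (par_assoc _ _ _).trans (cast_id _ _ _),
    mvr_0_2_3, mvl_0_3_2, mvl_0_2_3, mvl_0_3_2]

/-- A gadget node (a copy whose second output ends in an effect `E`) commutes through the merge (first input):
`((Z^{(1,2)} ⨾ (𝕀 ⊗ E)) ⊗ 𝕀) ⨾ Z^{(2,1)} = Z^{(2,1)} ⨾ Z^{(1,2)} ⨾ (𝕀 ⊗ E)`. [cite: JeandelPerdrixVilmart2018, Fig. 1 (S1)] -/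
theorem gadgetNode_par_seq_merge (E : ZXClass 1 0) :
    ((mk (Z 1 2 0) ⨟ (mk (wires 1) ⊠ E)) ⊠ mk (wires 1)) ⨟ mk (Z 2 1 0) = mk (Z 2 1 0) ⨟ (mk (Z 1 2 0) ⨟ (mk (wires 1) ⊠ E)) := by
  nth_rewrite 1 [← Z_seq_swap 1 0]
  rw [seq_assoc, swap_seq_par_effect, seq_par_wires, show (E ⊠ mk (wires 1)) ⊠ mk (wires 1) = E ⊠ mk (wires 2) from by
      rw [← wires_par_wires 1 1]; exact (par_assoc _ _ _).trans (cast_id _ _ _),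
    seq_assoc, show (E ⊠ mk (wires 2)) ⨟ mk (Z 2 1 0) = (mk (wires 1) ⊠ mk (Z 2 1 0)) ⨟ (E ⊠ mk (wires 1)) from by
      rw [← par_eq_seq_right E (mk (Z 2 1 0)), par_eq_seq_left E (mk (Z 2 1 0)), empty_par, cast_id],
    ← seq_assoc, Z_ladder, add_zero, show mk (Z 2 2 0) = mk (Z 2 1 0) ⨟ mk (Z 1 2 0) from by rw [Z_seq_Z 2 1 2 le_rfl, add_zero], seq_assoc]
  nth_rewrite 1 [← Z_seq_swap 1 0]
  rw [seq_assoc (mk (Z 1 2 0)) (mk swap), swap_seq_effect_par]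

/-- Fourth step of the auxiliary computation (figs. `…-proof-aux_03/04`): the red copy of the square in green absorbs
the root's Hadamard and fuses with the root (now three-legged, with Hadamards on two legs); the leaf of the third leg,
the square, the leaf of the rung and the merge are regrouped as the `b`-rooted block of `bRooted_eq_gadget_context`
(root `α`, copy phase `π/4`), the `π` gadget node having moved through the merge.
[cite: JeandelPerdrixVilmart2018, Fig. 1 (H), (S1), proof of Appendix Lemma 34] -/
theorem ladder_regroup (a : ZMod 8) :
    mk (Z 0 2 a) ⨟ (mk hBox ⊠ mk (xLeafL 0 a))
      ⨟ ((mk (X 1 2 0) ⨟ (mk (Z 1 1 (-2)) ⊠ mk (Z 1 2 1))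
          ⨟ (mk (X 2 1 0) ⊠ (mk (xLeafL 4 1) ⨟ (mk (Z 1 2 0) ⨟ (mk (wires 1) ⊠ (mk (X 1 2 4) ⨟ (mk (Z 1 0 (-1)) ⊠ mk (Z 1 0 (-1))))))))) ⊠ mk (wires 1))
      ⨟ (mk (wires 1) ⊠ mk (Z 2 1 0)) ⨟ ((mk hBox ⨟ mk (Z 1 2 0)) ⊠ mk (wires 1)) ⨟ (mk hBox ⊠ (mk (X 2 1 0) ⨟ mk hBox)) =
    (mk (Z 0 3 a) ⨟ (((mk hBox ⨟ mk (Z 1 1 (-2))) ⊠ (mk hBox ⨟ mk (Z 1 2 1))) ⊠ mk (xLeafL 0 a)) ⨟ ((mk (X 2 1 0) ⊠ mk (xLeafL 4 1)) ⊠ mk (wires 1))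
        ⨟ (mk (wires 1) ⊠ mk (Z 2 1 0)))
      ⨟ ((mk (wires 1) ⊠ (mk (Z 1 2 0) ⨟ (mk (wires 1) ⊠ (mk (X 1 2 4) ⨟ (mk (Z 1 0 (-1)) ⊠ mk (Z 1 0 (-1)))))))
        ⨟ ((mk hBox ⨟ mk (Z 1 2 0)) ⊠ mk (wires 1)) ⨟ (mk hBox ⊠ (mk (X 2 1 0) ⨟ mk hBox))) := by
  -- the Hadamard of the root's first leg turns the red copy green; the copy fuses with the root
  have hroot : mk (Z 0 2 a) ⨟ (mk hBox ⊠ mk (xLeafL 0 a))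
      ⨟ ((mk (X 1 2 0) ⨟ (mk (Z 1 1 (-2)) ⊠ mk (Z 1 2 1))
          ⨟ (mk (X 2 1 0) ⊠ (mk (xLeafL 4 1) ⨟ (mk (Z 1 2 0) ⨟ (mk (wires 1) ⊠ (mk (X 1 2 4) ⨟ (mk (Z 1 0 (-1)) ⊠ mk (Z 1 0 (-1))))))))) ⊠ mk (wires 1)) =
      mk (Z 0 3 a) ⨟ (((mk hBox ⨟ mk (Z 1 1 (-2))) ⊠ (mk hBox ⨟ mk (Z 1 2 1))) ⊠ mk (xLeafL 0 a)) ⨟ ((mk (X 2 1 0) ⊠ mk (xLeafL 4 1)) ⊠ mk (wires 1))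
        ⨟ ((mk (wires 1) ⊠ (mk (Z 1 2 0) ⨟ (mk (wires 1) ⊠ (mk (X 1 2 4) ⨟ (mk (Z 1 0 (-1)) ⊠ mk (Z 1 0 (-1))))))) ⊠ mk (wires 1)) := by
    rw [seq_assoc, interchange, seq_id, ← seq_assoc (mk hBox), ← seq_assoc (mk hBox), hBox_seq_X_split, seq_assoc (mk (Z 1 2 0)), interchange,
      show mk (X 2 1 0) ⊠ (mk (xLeafL 4 1) ⨟ (mk (Z 1 2 0) ⨟ (mk (wires 1) ⊠ (mk (X 1 2 4) ⨟ (mk (Z 1 0 (-1)) ⊠ mk (Z 1 0 (-1))))))) =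
        (mk (X 2 1 0) ⊠ mk (xLeafL 4 1)) ⨟ (mk (wires 1) ⊠ (mk (Z 1 2 0) ⨟ (mk (wires 1) ⊠ (mk (X 1 2 4) ⨟ (mk (Z 1 0 (-1)) ⊠ mk (Z 1 0 (-1))))))) from by
        rw [interchange, seq_id],
      show ∀ (P : ZXClass 2 3) (Q : ZXClass 3 2) (R : ZXClass 2 2), ((mk (Z 1 2 0) ⨟ P) ⨟ (Q ⨟ R)) ⊠ mk (xLeafL 0 a) =
        (mk (Z 1 2 0) ⊠ mk (wires 1)) ⨟ ((P ⊠ mk (xLeafL 0 a)) ⨟ ((Q ⊠ mk (wires 1)) ⨟ (R ⊠ mk (wires 1)))) from fun P Q R => by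
        symm; rw [← seq_assoc, ← seq_assoc, interchange, id_seq, interchange, seq_id, interchange, seq_id]; simp only [seq_assoc],
      ← seq_assoc (mk (Z 0 2 a)), Z_seq_Z_par 0 1 1 2 le_rfl, zero_add a]
    simp only [seq_assoc]
  rw [hroot]
  simp only [seq_assoc]
  rw [show ∀ R : ZXClass 2 2, ((mk (wires 1) ⊠ (mk (Z 1 2 0) ⨟ (mk (wires 1) ⊠ (mk (X 1 2 4) ⨟ (mk (Z 1 0 (-1)) ⊠ mk (Z 1 0 (-1))))))) ⊠ mk (wires 1)) ⨟ ((mk (wires 1) ⊠ mk (Z 2 1 0)) ⨟ R) =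
      (mk (wires 1) ⊠ mk (Z 2 1 0)) ⨟ ((mk (wires 1) ⊠ (mk (Z 1 2 0) ⨟ (mk (wires 1) ⊠ (mk (X 1 2 4) ⨟ (mk (Z 1 0 (-1)) ⊠ mk (Z 1 0 (-1))))))) ⨟ R) from fun R => by
    rw [← seq_assoc, ← seq_assoc, show (mk (wires 1) ⊠ (mk (Z 1 2 0) ⨟ (mk (wires 1) ⊠ (mk (X 1 2 4) ⨟ (mk (Z 1 0 (-1)) ⊠ mk (Z 1 0 (-1))))))) ⊠ mk (wires 1) =
      mk (wires 1) ⊠ ((mk (Z 1 2 0) ⨟ (mk (wires 1) ⊠ (mk (X 1 2 4) ⨟ (mk (Z 1 0 (-1)) ⊠ mk (Z 1 0 (-1)))))) ⊠ mk (wires 1)) from (par_assoc _ _ _).trans (cast_id _ _ _),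
      ← wires_par_seq, gadgetNode_par_seq_merge, wires_par_seq]]

/-- Fifth step of the auxiliary computation (figs. `…-proof-aux_04/05`, rule (C) in the form `c1Gadget_eq_mirror`): the
`b`-rooted block equals the `a`-rooted block. [cite: JeandelPerdrixVilmart2018, Appendix Lemma 17 (C1), proof of Lemma 34] -/
theorem bRooted_eq_aRooted (a : ZMod 8) :
    mk (Z 0 3 a) ⨟ (((mk hBox ⨟ mk (Z 1 1 (-2))) ⊠ (mk hBox ⨟ mk (Z 1 2 1))) ⊠ mk (xLeafL 0 a)) ⨟ ((mk (X 2 1 0) ⊠ mk (xLeafL 4 1)) ⊠ mk (wires 1))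
        ⨟ (mk (wires 1) ⊠ mk (Z 2 1 0)) =
      mk (Z 0 3 1) ⨟ ((mk (Z 1 1 (-2)) ⊠ (mk hBox ⨟ mk (Z 1 2 a))) ⊠ mk (wires 1)) ⨟ (((mk (wires 1) ⊠ mk hBox) ⊠ mk (xLeafL 0 a)) ⊠ mk (xLeafL 4 1))
        ⨟ ((mk (X 2 1 0) ⊠ mk (wires 1)) ⊠ mk (wires 1)) ⨟ (mk (wires 1) ⊠ mk (Z 2 1 0)) := by
  rw [show ((mk hBox ⨟ mk (Z 1 1 (-2))) ⊠ (mk hBox ⨟ mk (Z 1 2 1))) ⊠ mk (xLeafL 0 a) = (((mk hBox ⨟ mk (Z 1 1 (-2))) ⊠ (mk hBox ⨟ mk (Z 1 2 1))) ⊠ mk (wires 1)) ⨟ (mk (wires 3) ⊠ mk (xLeafL 0 a))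
      from par_eq_seq_left _ _, ← seq_assoc (mk (Z 0 3 a)) _ (mk (wires 3) ⊠ mk (xLeafL 0 a)), seq_assoc _ (mk (wires 3) ⊠ mk (xLeafL 0 a)),
    show (mk (wires 3) ⊠ mk (xLeafL 0 a)) ⨟ ((mk (X 2 1 0) ⊠ mk (xLeafL 4 1)) ⊠ mk (wires 1)) = (mk (X 2 1 0) ⊠ mk (xLeafL 4 1)) ⊠ mk (xLeafL 0 a) from by
      rw [interchange, id_seq, seq_id], bRooted_eq_gadget_context, c1Gadget_eq_mirror, ← aRooted_eq_gadgetMirror_context]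

/-- Sixth step of the auxiliary computation (figs. `…-proof-aux_05/06`, the Hopf cut `zphase_branch_hopf`): the
`-π/2` phase joins the root (`π/4 - π/2 = -π/4`), the Hadamard of the green copy below joins the cut block, and the
state falls apart into the red copy of a green `α` state (with `Z(α)` on the first copy) and the pendant
`Z(-π/4) ⨾ xLeafL π (π/4)` merged into the second copy, followed by the `π` gadget node, the green copy and the
recoloured bottom. [cite: JeandelPerdrixVilmart2018, Appendix (Hopf law), proof of Lemma 34] -/
theorem ladder_hopf (a : ZMod 8) :
    (mk (Z 0 3 1) ⨟ ((mk (Z 1 1 (-2)) ⊠ (mk hBox ⨟ mk (Z 1 2 a))) ⊠ mk (wires 1)) ⨟ (((mk (wires 1) ⊠ mk hBox) ⊠ mk (xLeafL 0 a)) ⊠ mk (xLeafL 4 1))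
        ⨟ ((mk (X 2 1 0) ⊠ mk (wires 1)) ⊠ mk (wires 1)) ⨟ (mk (wires 1) ⊠ mk (Z 2 1 0)))
      ⨟ ((mk (wires 1) ⊠ (mk (Z 1 2 0) ⨟ (mk (wires 1) ⊠ (mk (X 1 2 4) ⨟ (mk (Z 1 0 (-1)) ⊠ mk (Z 1 0 (-1))))))) ⨟ ((mk hBox ⨟ mk (Z 1 2 0)) ⊠ mk (wires 1)) ⨟ (mk hBox ⊠ (mk (X 2 1 0) ⨟ mk hBox))) =
    mk invSqrtTwo ⊠ (mk invSqrtTwo ⊠ (((mk (Z 0 1 a) ⨟ mk (X 1 2 0) ⨟ (mk (Z 1 1 a) ⊠ mk (wires 1))) ⊠ (mk (Z 0 1 (-1)) ⨟ mk (xLeafL 4 1)))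
      ⨟ (mk (wires 1) ⊠ mk (Z 2 1 0)) ⨟ (mk (wires 1) ⊠ (mk (Z 1 2 0) ⨟ (mk (wires 1) ⊠ (mk (X 1 2 4) ⨟ (mk (Z 1 0 (-1)) ⊠ mk (Z 1 0 (-1))))))) ⨟ (mk (Z 1 2 0) ⊠ mk (wires 1)) ⨟ (mk hBox ⊠ (mk (X 2 1 0) ⨟ mk hBox)))) := by
  -- the `-π/2` phase joins the root
  have hroot : mk (Z 0 3 1) ⨟ ((mk (Z 1 1 (-2)) ⊠ (mk hBox ⨟ mk (Z 1 2 a))) ⊠ mk (wires 1)) = mk (Z 0 3 (-1)) ⨟ ((mk (wires 1) ⊠ (mk hBox ⨟ mk (Z 1 2 a))) ⊠ mk (wires 1)) := by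
    rw [par_eq_seq_left (mk (Z 1 1 (-2))) (mk hBox ⨟ mk (Z 1 2 a)), seq_par_wires, ← seq_assoc,
      show (mk (Z 1 1 (-2)) ⊠ mk (wires 1)) ⊠ mk (wires 1) = mk (Z 1 1 (-2)) ⊠ mk (wires 2) from by rw [← wires_par_wires 1 1]; exact (par_assoc _ _ _).trans (cast_id _ _ _),
      Z_seq_Z_par 0 1 2 1 le_rfl, show (-2 : ZMod 8) + 1 = -1 from by decide]
  -- the leaf of the third leg moves below the red merge
  have hxl : ∀ R : ZXClass 3 2, (((mk (wires 1) ⊠ mk hBox) ⊠ mk (xLeafL 0 a)) ⊠ mk (xLeafL 4 1)) ⨟ (((mk (X 2 1 0) ⊠ mk (wires 1)) ⊠ mk (wires 1)) ⨟ R) =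
      ((mk (wires 1) ⊠ (mk hBox ⊠ mk (xLeafL 0 a))) ⊠ mk (wires 1)) ⨟ (((mk (X 2 1 0) ⊠ mk (wires 1)) ⊠ mk (wires 1)) ⨟ ((mk (wires 2) ⊠ mk (xLeafL 4 1)) ⨟ R)) := fun R => by
    rw [← seq_assoc, ← seq_assoc, ← seq_assoc, interchange, seq_id]; symm
    rw [show mk (wires 1) ⊠ (mk hBox ⊠ mk (xLeafL 0 a)) = (mk (wires 1) ⊠ mk hBox) ⊠ mk (xLeafL 0 a) from (par_assoc' _ _ _).trans (cast_id _ _ _),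
      interchange, id_seq, interchange, seq_id, id_seq]
  -- the Hadamard of the bottom copy moves up to the cut block
  have hc1 : ∀ R : ZXClass 2 2, (mk (wires 1) ⊠ (mk (Z 1 2 0) ⨟ (mk (wires 1) ⊠ (mk (X 1 2 4) ⨟ (mk (Z 1 0 (-1)) ⊠ mk (Z 1 0 (-1))))))) ⨟ ((mk hBox ⊠ mk (wires 1)) ⨟ R) = (mk hBox ⊠ mk (wires 1)) ⨟ ((mk (wires 1) ⊠ (mk (Z 1 2 0) ⨟ (mk (wires 1) ⊠ (mk (X 1 2 4) ⨟ (mk (Z 1 0 (-1)) ⊠ mk (Z 1 0 (-1))))))) ⨟ R) := fun R => by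
    rw [← seq_assoc, interchange, id_seq, seq_id, ← seq_assoc, interchange, seq_id, id_seq]
  have hc2 : ∀ R : ZXClass 2 2, (mk (wires 1) ⊠ mk (Z 2 1 0)) ⨟ ((mk hBox ⊠ mk (wires 1)) ⨟ R) = ((mk hBox ⊠ mk (wires 1)) ⊠ mk (wires 1)) ⨟ ((mk (wires 1) ⊠ mk (Z 2 1 0)) ⨟ R) := fun R => by
    rw [← seq_assoc, interchange, id_seq, seq_id, ← seq_assoc, show (mk hBox ⊠ mk (wires 1)) ⊠ mk (wires 1) = mk hBox ⊠ mk (wires 2) from by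
      rw [← wires_par_wires 1 1]; exact (par_assoc _ _ _).trans (cast_id _ _ _), interchange, seq_id, id_seq]
  have hc3 : ∀ R : ZXClass 3 2, (mk (wires 2) ⊠ mk (xLeafL 4 1)) ⨟ (((mk hBox ⊠ mk (wires 1)) ⊠ mk (wires 1)) ⨟ R) = ((mk hBox ⊠ mk (wires 1)) ⊠ mk (wires 1)) ⨟ ((mk (wires 2) ⊠ mk (xLeafL 4 1)) ⨟ R) := fun R => by
    rw [← seq_assoc, interchange, id_seq, seq_id, ← seq_assoc, interchange, seq_id, id_seq]
  -- the Hopf cut, in continuation form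
  have hh : ∀ R : ZXClass 3 2, mk (Z 0 3 (-1)) ⨟ (((mk (wires 1) ⊠ (mk hBox ⨟ mk (Z 1 2 a))) ⊠ mk (wires 1)) ⨟ (((mk (wires 1) ⊠ (mk hBox ⊠ mk (xLeafL 0 a))) ⊠ mk (wires 1))
      ⨟ (((mk (X 2 1 0) ⊠ mk (wires 1)) ⊠ mk (wires 1)) ⨟ (((mk hBox ⊠ mk (wires 1)) ⊠ mk (wires 1)) ⨟ R)))) =
      (mk invSqrtTwo ⊠ (mk invSqrtTwo ⊠ (((mk (Z 0 1 a) ⨟ mk (X 1 2 0)) ⨟ (mk (Z 1 1 a) ⊠ mk (wires 1))) ⊠ mk (Z 0 1 (-1))))) ⨟ R := fun R => by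
    rw [← seq_assoc, ← seq_assoc, ← seq_assoc, ← seq_assoc, zphase_branch_hopf]
  rw [hroot]
  simp only [seq_assoc]
  rw [hxl, seq_par_wires, seq_assoc (mk hBox ⊠ mk (wires 1)), hc1, hc2, hc3, hh, mvl_0_3_2, mvl_0_3_2, ← seq_assoc _ (mk (wires 2) ⊠ mk (xLeafL 4 1)),
    interchange, seq_id]
  simp only [seq_assoc]

/-- The pendant of fig. `…-proof-aux_06` in phase form: the green `-π/4` state through the leaf `xLeafL π (π/4)` is the
hanging gadget (a red node with two green `-π/4` leaves), up to unit scalars: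
`Z(-π/4) ⨾ xLeafL π (π/4) = 1/√2 ⊗ db(π,π/4) ⊗ ((Z(-π/4) ⊗ Z(-π/4)) ⨾ X^{(2,1)})`.
[cite: JeandelPerdrixVilmart2018, Appendix Lemma 17, proof of Lemma 34 (figs. `…-proof-aux_06/07`)] -/
theorem pendant_eq_gadget :
    mk (Z 0 1 (-1)) ⨟ mk (xLeafL 4 1) = mk invSqrtTwo ⊠ (mk (dumbbell 4 1) ⊠ ((mk (Z 0 1 (-1)) ⊠ mk (Z 0 1 (-1))) ⨟ mk (X 2 1 0))) := by
  have hL : mk (xLeafL 4 1) = mk invSqrtTwo ⊠ (mk (dumbbell 4 1) ⊠ mk (xLeafL 0 (-1))) := by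
    have h := congrArg (mk invSqrtTwo ⊠ ·) (dumbbell_four_par_xLeafL_neg 0 1)
    simp only [invSqrtTwo_par_sqrt_two_par_cancel, cast_id, show (0 : ZMod 8) + 4 = 4 from by decide] at h
    exact h.symm
  rw [hL, state_seq_scalar_par, state_seq_scalar_par, ← Z_state_par_seq_X_merge (-1) 0, ← seq_assoc,
    show mk (Z 0 1 (-1)) ⨟ (mk (Z 0 1 (-1)) ⊠ mk (wires 1)) = mk (Z 0 1 (-1)) ⊠ mk (Z 0 1 (-1)) from by
      rw [par_eq_seq_right (mk (Z 0 1 (-1))) (mk (Z 0 1 (-1))), empty_par, cast_id]]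

/-- Last steps of the auxiliary computation before the tail (figs. `…-proof-aux_06–08`): the pendant becomes the hanging
gadget merged into the second copy, i.e. the plain gadget node on that wire (`par_gadget_transpose_seq_merge`); the plain
and the `π` gadget nodes cancel (`gadgetNode_seq_gadgetNode_pi`, supplementarity); the green `α` phase fuses with the
green copy below. [cite: JeandelPerdrixVilmart2018, Appendix Lemma 19 (supplementarity), proof of Lemma 34] -/
theorem ladder_gadgets (a : ZMod 8) :
    ((mk (Z 0 1 a) ⨟ mk (X 1 2 0) ⨟ (mk (Z 1 1 a) ⊠ mk (wires 1))) ⊠ (mk (Z 0 1 (-1)) ⨟ mk (xLeafL 4 1)))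
      ⨟ (mk (wires 1) ⊠ mk (Z 2 1 0)) ⨟ (mk (wires 1) ⊠ (mk (Z 1 2 0) ⨟ (mk (wires 1) ⊠ (mk (X 1 2 4) ⨟ (mk (Z 1 0 (-1)) ⊠ mk (Z 1 0 (-1))))))) ⨟ (mk (Z 1 2 0) ⊠ mk (wires 1)) ⨟ (mk hBox ⊠ (mk (X 2 1 0) ⨟ mk hBox)) =
    mk invSqrtTwo ⊠ (mk (dumbbell 4 1) ⊠ (mk (dumbbell 4 (-2)) ⊠
      (((mk (Z 0 1 a) ⨟ mk (X 1 2 0)) ⨟ (mk (Z 1 2 a) ⊠ mk (wires 1))) ⨟ (mk hBox ⊠ (mk (X 2 1 0) ⨟ mk hBox))))) := by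
  rw [pendant_eq_gadget, show ∀ (P : ZXClass 0 2) (G : ZXClass 0 1), P ⊠ (mk invSqrtTwo ⊠ (mk (dumbbell 4 1) ⊠ G)) = mk invSqrtTwo ⊠ (mk (dumbbell 4 1) ⊠ (P ⊠ G)) from fun P G => by
      rw [show P ⊠ (mk invSqrtTwo ⊠ (mk (dumbbell 4 1) ⊠ G)) = (P ⊠ mk invSqrtTwo) ⊠ (mk (dumbbell 4 1) ⊠ G) from (par_assoc' _ _ _).trans (cast_id _ _ _),
        ← scalar_par_state_two_comm, show (mk invSqrtTwo ⊠ P) ⊠ (mk (dumbbell 4 1) ⊠ G) = mk invSqrtTwo ⊠ (P ⊠ (mk (dumbbell 4 1) ⊠ G)) from (par_assoc _ _ _).trans (cast_id _ _ _),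
        show P ⊠ (mk (dumbbell 4 1) ⊠ G) = (P ⊠ mk (dumbbell 4 1)) ⊠ G from (par_assoc' _ _ _).trans (cast_id _ _ _), ← scalar_par_state_two_comm,
        show (mk (dumbbell 4 1) ⊠ P) ⊠ G = mk (dumbbell 4 1) ⊠ (P ⊠ G) from (par_assoc _ _ _).trans (cast_id _ _ _)],
    mvl_0_3_2, mvl_0_3_2, scalar_par_state_two_seq_two, scalar_par_state_two_seq_two, mvl_0_2_3, mvl_0_2_3, mvl_0_3_2, mvl_0_3_2]
  congr 1; congr 1
  rw [par_eq_seq_left _ ((mk (Z 0 1 (-1)) ⊠ mk (Z 0 1 (-1))) ⨟ mk (X 2 1 0)), par_empty, seq_assoc _ (mk (wires 2) ⊠ ((mk (Z 0 1 (-1)) ⊠ mk (Z 0 1 (-1))) ⨟ mk (X 2 1 0))),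
    ← wires_par_wires 1 1, show (mk (wires 1) ⊠ mk (wires 1)) ⊠ ((mk (Z 0 1 (-1)) ⊠ mk (Z 0 1 (-1))) ⨟ mk (X 2 1 0)) = mk (wires 1) ⊠ (mk (wires 1) ⊠ ((mk (Z 0 1 (-1)) ⊠ mk (Z 0 1 (-1))) ⨟ mk (X 2 1 0))) from
      (par_assoc _ _ _).trans (cast_id _ _ _),
    ← wires_par_seq, par_gadget_transpose_seq_merge, seq_assoc _ (mk (wires 1) ⊠ (mk (Z 1 2 0) ⨟ (mk (wires 1) ⊠ (mk (X 1 2 0) ⨟ (mk (Z 1 0 (-1)) ⊠ mk (Z 1 0 (-1))))))), ← wires_par_seq, gadgetNode_seq_gadgetNode_pi,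
    show mk (wires 1) ⊠ (mk (dumbbell 4 (-2)) ⊠ mk (wires 1)) = mk (dumbbell 4 (-2)) ⊠ mk (wires 2) from by
      rw [show mk (wires 1) ⊠ (mk (dumbbell 4 (-2)) ⊠ mk (wires 1)) = (mk (wires 1) ⊠ mk (dumbbell 4 (-2))) ⊠ mk (wires 1) from (par_assoc' _ _ _).trans (cast_id _ _ _),
        ← scalar_par_wires, ← wires_par_wires 1 1]; exact (par_assoc _ _ _).trans (cast_id _ _ _),
    show ∀ (P : ZXClass 0 2), P ⨟ (mk (dumbbell 4 (-2)) ⊠ mk (wires 2)) = mk (dumbbell 4 (-2)) ⊠ P from fun P => by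
      conv_rhs => rw [← seq_id P]
      rw [scalar_par_seq_right, empty_par, cast_id],
    mvl_0_2_3, mvl_0_3_2]
  congr 1
  rw [seq_assoc _ (mk (Z 1 1 a) ⊠ mk (wires 1)) (mk (Z 1 2 0) ⊠ mk (wires 1)), ← seq_par_wires, Z_seq_Z 1 1 2 le_rfl, add_zero]

/-- **The auxiliary computation of Appendix Lemma 34** (figs. `…-proof-aux_00–10`): the ladder state — a red `α`
state copied (green), one copy through `X(α)` into a green node fed by `Z^{(0,1)} ⨾ T` and emitting a triangle towards
the red merge of the other copy, then the green copy of the merge and the red merge of the remaining legs — collapses to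
two red `α` states: `ladder(α) = 1/√2 ⊗ (X(α) ⊗ X(α))`.
[cite: JeandelPerdrixVilmart2018, Appendix, proof of Lemma 34 (auxiliary statement)] -/
theorem ladderState_eq (a : ZMod 8) :
    ((mk (Z 0 1 0) ⨟ mk triangle) ⊠ mk (X 0 1 a)) ⨟ (mk (wires 1) ⊠ mk (Z 1 2 0)) ⨟ ((mk (wires 1) ⊠ mk (X 1 1 a)) ⊠ mk (wires 1))
      ⨟ (mk (Z 2 2 0) ⊠ mk (wires 1)) ⨟ ((mk (wires 1) ⊠ mk triangle) ⊠ mk (wires 1)) ⨟ (mk (wires 1) ⊠ mk (X 2 1 0))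
      ⨟ (mk (X 1 2 0) ⊠ mk (wires 1)) ⨟ (mk (wires 1) ⊠ mk (Z 2 1 0)) =
    mk invSqrtTwo ⊠ (mk (X 0 1 a) ⊠ mk (X 0 1 a)) := by
  have hB8 : ((mk (Z 0 1 a) ⨟ mk (X 1 2 0)) ⨟ (mk (Z 1 2 a) ⊠ mk (wires 1))) ⨟ (mk hBox ⊠ (mk (X 2 1 0) ⨟ mk hBox)) =
      mk invSqrtTwo ⊠ (mk invSqrtTwo ⊠ (mk (X 0 1 a) ⊠ mk (X 0 1 a))) := by
    have h := congrArg (mk invSqrtTwo ⊠ ·) (ladder_tail a)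
    simp only [invSqrtTwo_par_sqrt_two_par_cancel, cast_id] at h
    exact h
  rw [ladder_pendant, ladder_colour, ladder_square, ladder_regroup, bRooted_eq_aRooted, ladder_hopf, ladder_gadgets, hB8, Z_dot_two_eq,
    scalar_par_scalar_par (mk (dumbbell 0 0)) (mk (dumbbell 4 1)), scalar_par_scalar_par (mk (dumbbell 0 0)) (mk invSqrtTwo), invSqrtTwo_par_sqrt_two_par_cancel, cast_id,
    scalar_par_scalar_par (mk (dumbbell 4 1)) (mk invSqrtTwo), scalar_par_scalar_par (mk (dumbbell 4 1)) (mk invSqrtTwo),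
    show ∀ R : ZXClass 0 2, mk (dumbbell 4 1) ⊠ (mk (dumbbell 4 1) ⊠ R) = mk (dumbbell 4 2) ⊠ (mk (dumbbell 0 0) ⊠ R) from fun R => by
      rw [show mk (dumbbell 4 1) ⊠ (mk (dumbbell 4 1) ⊠ R) = (mk (dumbbell 4 1) ⊠ mk (dumbbell 4 1)) ⊠ R from (par_assoc' _ _ _).trans (cast_id _ _ _), dumbbell_four_mul,
        show (1 : ZMod 8) + 1 = 2 from by decide]; exact (par_assoc _ _ _).trans (cast_id _ _ _),
    scalar_par_scalar_par (mk (dumbbell 0 0)) (mk (dumbbell 4 (-2))),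
    show ∀ R : ZXClass 0 2, mk (dumbbell 4 2) ⊠ (mk (dumbbell 4 (-2)) ⊠ R) = mk (dumbbell 0 0) ⊠ (mk (dumbbell 0 0) ⊠ R) from fun R => by
      rw [show mk (dumbbell 4 2) ⊠ (mk (dumbbell 4 (-2)) ⊠ R) = (mk (dumbbell 4 2) ⊠ mk (dumbbell 4 (-2))) ⊠ R from (par_assoc' _ _ _).trans (cast_id _ _ _),
        dumbbell_four_par_dumbbell_four_neg]; exact (par_assoc _ _ _).trans (cast_id _ _ _),
    scalar_par_scalar_par (mk invSqrtTwo) (mk (dumbbell 0 0)), scalar_par_scalar_par (mk invSqrtTwo) (mk (dumbbell 0 0)),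
    scalar_par_scalar_par (mk invSqrtTwo) (mk (dumbbell 0 0)), scalar_par_scalar_par (mk invSqrtTwo) (mk (dumbbell 0 0)),
    scalar_par_scalar_par (mk (dumbbell 0 0)) (mk invSqrtTwo), invSqrtTwo_par_sqrt_two_par_cancel, cast_id,
    scalar_par_scalar_par (mk (dumbbell 0 0)) (mk invSqrtTwo), invSqrtTwo_par_sqrt_two_par_cancel, cast_id,
    scalar_par_scalar_par (mk (dumbbell 0 0)) (mk invSqrtTwo), invSqrtTwo_par_sqrt_two_par_cancel, cast_id]

/-! ### Appendix Lemma 34, main computation (figs. `…-proof-fin_00–06`): tools -/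

/-- A red copy followed by the other CNOT (red copy on the first copy, green merge with the second):
`X^{(1,2)} ⨾ (X^{(1,2)} ⊗ 𝕀) ⨾ (𝕀 ⊗ Z^{(2,1)}) = ½ ⊗ (𝕀 ⊗ Z^{(0,1)})` (red fusion and Hopf).
[cite: JeandelPerdrixVilmart2018, Fig. 1 (S1), Appendix (Hopf law)] -/
theorem xsplit_seq_notc :
    mk (X 1 2 0) ⨟ ((mk (X 1 2 0) ⊠ mk (wires 1)) ⨟ (mk (wires 1) ⊠ mk (Z 2 1 0))) = mk invSqrtTwo ⊠ (mk invSqrtTwo ⊠ (mk (wires 1) ⊠ mk (Z 0 1 0))) := by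
  rw [← seq_assoc, hb_xsplit_seq_xsplit_par, show mk (X 1 3 0) = mk (X 1 2 0) ⨟ (mk (wires 1) ⊠ mk (X 1 2 0)) from by rw [X_seq_par_X 1 1 1 2 le_rfl, add_zero],
    seq_assoc, ← wires_par_seq, xsplit_seq_merge_eq, ← scalar_par_wires_par_one, ← scalar_par_wires_par_one, one_two_seq_scalar_par_two, one_two_seq_scalar_par_two,
    wires_par_seq, ← seq_assoc, X_seq_par_X 1 1 1 0 le_rfl, add_zero (0 : ZMod 8), show mk (X 1 (1 + 0) 0) = mk (wires 1) from X_one_one, id_seq]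

/-- Scalar mover (bookkeeping): `(s ⊗ A) ⨾ B = s ⊗ (A ⨾ B)` for `A : 2 → 3`, `B : 3 → 1`. [folklore] -/
private theorem mvl_2_3_1 (s : ZXClass 0 0) (A : ZXClass 2 3) (B : ZXClass 3 1) : (s ⊠ A) ⨟ B = s ⊠ (A ⨟ B) := by
  rw [scalar_par_seq_left, empty_par, cast_id]

/-- Scalar mover (bookkeeping): `A ⨾ (s ⊗ B) = s ⊗ (A ⨾ B)` for `A : 3 → 2`, `B : 2 → 1`. [folklore] -/
private theorem mvr_3_2_1 (A : ZXClass 3 2) (s : ZXClass 0 0) (B : ZXClass 2 1) : A ⨟ (s ⊠ B) = s ⊠ (A ⨟ B) := by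
  rw [scalar_par_seq_right, empty_par, cast_id]

/-- The Hopf cut of the main computation (figs. `…-proof-fin_01/02`), two-wire form: a red copy of the first wire, the green
merge of its second copy with the second wire, then the red merge: `(X^{(1,2)} ⊗ 𝕀) ⨾ (𝕀 ⊗ Z^{(2,1)}) ⨾ X^{(2,1)} = ½ ⊗ (𝕀 ⊗ Z^{(1,0)})`.
[cite: JeandelPerdrixVilmart2018, Appendix (Hopf law), proof of Lemma 34] -/
theorem xsplit_par_seq_par_merge_seq_xmerge :
    (mk (X 1 2 0) ⊠ mk (wires 1)) ⨟ (mk (wires 1) ⊠ mk (Z 2 1 0)) ⨟ mk (X 2 1 0) = mk invSqrtTwo ⊠ (mk invSqrtTwo ⊠ (mk (wires 1) ⊠ mk (Z 1 0 0))) := by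
  rw [← split_par_seq_par_cap, wires_par_seq, show mk (wires 1) ⊠ (mk (Z 1 2 0) ⊠ mk (wires 1)) = (mk (wires 1) ⊠ mk (Z 1 2 0)) ⊠ mk (wires 1) from (par_assoc' _ _ _).trans (cast_id _ _ _),
    show mk (wires 1) ⊠ (mk (wires 1) ⊠ mk cap) = mk (wires 2) ⊠ mk cap from by rw [← wires_par_wires 1 1]; exact (par_assoc' _ _ _).trans (cast_id _ _ _),
    seq_assoc, seq_assoc, show (mk (wires 2) ⊠ mk cap) ⨟ mk (X 2 1 0) = (mk (X 2 1 0) ⊠ mk (wires 1) ⊠ mk (wires 1)) ⨟ (mk (wires 1) ⊠ mk cap) from by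
      rw [show mk (X 2 1 0) ⊠ mk (wires 1) ⊠ mk (wires 1) = mk (X 2 1 0) ⊠ mk (wires 2) from by rw [← wires_par_wires 1 1]; exact (par_assoc _ _ _).trans (cast_id _ _ _),
        interchange, id_seq, seq_id, par_eq_seq_right (mk (X 2 1 0)) (mk cap), par_empty],
    ← seq_assoc ((mk (wires 1) ⊠ mk (Z 1 2 0)) ⊠ mk (wires 1)), ← seq_par_wires, cnot21_eq, ← seq_assoc (mk (X 1 2 0) ⊠ mk (wires 1)), ← seq_par_wires,
    xsplit_seq_notc, show ∀ (s : ZXClass 0 0) (A : ZXClass 1 2), (s ⊠ A) ⊠ mk (wires 1) = s ⊠ (A ⊠ mk (wires 1)) from fun s A => (par_assoc _ _ _).trans (cast_id _ _ _),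
    show ∀ (s : ZXClass 0 0) (A : ZXClass 1 2), (s ⊠ A) ⊠ mk (wires 1) = s ⊠ (A ⊠ mk (wires 1)) from fun s A => (par_assoc _ _ _).trans (cast_id _ _ _),
    mvl_2_3_1, mvl_2_3_1, show (mk (wires 1) ⊠ mk (Z 0 1 0)) ⊠ mk (wires 1) = mk (wires 1) ⊠ (mk (Z 0 1 0) ⊠ mk (wires 1)) from (par_assoc _ _ _).trans (cast_id _ _ _),
    ← wires_par_seq, state_par_seq_cap]

/-- The Hopf cut of the main computation (figs. `…-proof-fin_01/02`): the red copy of the ladder's first wire, the green node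
merging its second copy, the ladder's second wire and the plugged input, then the red merge with the copied input:
`((X^{(1,2)} ⊗ 𝕀) ⊗ 𝕀) ⨾ (𝕀 ⊗ Z^{(3,1)}) ⨾ X^{(2,1)} = ½ ⊗ (𝕀 ⊗ ∩)`. [cite: JeandelPerdrixVilmart2018, Appendix (Hopf law), proof of Lemma 34] -/
theorem hopf_block :
    ((mk (X 1 2 0) ⊠ mk (wires 1)) ⊠ mk (wires 1)) ⨟ (mk (wires 1) ⊠ mk (Z 3 1 0)) ⨟ mk (X 2 1 0) = mk invSqrtTwo ⊠ (mk invSqrtTwo ⊠ (mk (wires 1) ⊠ mk cap)) := by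
  rw [show mk (Z 3 1 0) = (mk (wires 1) ⊠ mk (Z 2 1 0)) ⨟ mk (Z 2 1 0) from by rw [par_Z_seq_Z 1 2 1 1 le_rfl, add_zero], wires_par_seq, ← seq_assoc,
    show ((mk (X 1 2 0) ⊠ mk (wires 1)) ⊠ mk (wires 1)) ⨟ (mk (wires 1) ⊠ (mk (wires 1) ⊠ mk (Z 2 1 0))) = (mk (wires 1) ⊠ mk (Z 2 1 0)) ⨟ (mk (X 1 2 0) ⊠ mk (wires 1)) from by
      rw [show (mk (X 1 2 0) ⊠ mk (wires 1)) ⊠ mk (wires 1) = mk (X 1 2 0) ⊠ mk (wires 2) from by rw [← wires_par_wires 1 1]; exact (par_assoc _ _ _).trans (cast_id _ _ _),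
        show mk (wires 1) ⊠ (mk (wires 1) ⊠ mk (Z 2 1 0)) = mk (wires 2) ⊠ mk (Z 2 1 0) from by rw [← wires_par_wires 1 1]; exact (par_assoc' _ _ _).trans (cast_id _ _ _),
        interchange, id_seq, seq_id, interchange, id_seq, seq_id],
    seq_assoc, seq_assoc, ← seq_assoc (mk (X 1 2 0) ⊠ mk (wires 1)), xsplit_par_seq_par_merge_seq_xmerge, mvr_3_2_1, mvr_3_2_1, ← wires_par_seq,
    Z_seq_Z 2 1 0 le_rfl, add_zero, Z_two_zero]

/-- A green merge with its output capped against a wire is the three-legged effect: `(Z^{(2,1)} ⊗ 𝕀) ⨾ ∩ = Z^{(3,0)}`.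
[cite: JeandelPerdrixVilmart2018, Fig. 1 (S1)] -/
theorem merge_par_seq_cap : (mk (Z 2 1 0) ⊠ mk (wires 1)) ⨟ mk cap = mk (Z 3 0 0) := by
  rw [← Z_two_zero, Z_par_seq_Z 2 1 1 0 le_rfl, add_zero]

/-- The red version: `(X^{(2,1)} ⊗ 𝕀) ⨾ ∩ = X^{(3,0)}`. [cite: JeandelPerdrixVilmart2018, Fig. 1 (S1), (H)] -/
theorem xmerge_par_seq_cap : (mk (X 2 1 0) ⊠ mk (wires 1)) ⨟ mk cap = mk (X 3 0 0) := by
  rw [← X_two_zero, X_par_seq_X 2 1 1 0 le_rfl, add_zero]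

/-- A green copy of the last of three wires followed by the three-legged effect on the first two wires and the first copy
is the three-to-one spider: `(𝕀² ⊗ Z^{(1,2)}) ⨾ (Z^{(3,0)} ⊗ 𝕀) = Z^{(3,1)}`. [cite: JeandelPerdrixVilmart2018, Fig. 1 (S1)] -/
theorem wires_two_par_split_seq_effect_par :
    (mk (wires 2) ⊠ mk (Z 1 2 0)) ⨟ (mk (Z 3 0 0) ⊠ mk (wires 1)) = mk (Z 3 1 0) := by
  rw [← merge_par_seq_cap, seq_par_wires, ← seq_assoc, show (mk (Z 2 1 0) ⊠ mk (wires 1)) ⊠ mk (wires 1) = mk (Z 2 1 0) ⊠ mk (wires 2) from by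
      rw [← wires_par_wires 1 1]; exact (par_assoc _ _ _).trans (cast_id _ _ _),
    show (mk (wires 2) ⊠ mk (Z 1 2 0)) ⨟ (mk (Z 2 1 0) ⊠ mk (wires 2)) = (mk (Z 2 1 0) ⊠ mk (wires 1)) ⨟ (mk (wires 1) ⊠ mk (Z 1 2 0)) from by
      rw [interchange, id_seq, seq_id, par_eq_seq_left (mk (Z 2 1 0)) (mk (Z 1 2 0))],
    seq_assoc, par_split_seq_cap_par, Z_par_seq_Z 2 1 1 1 le_rfl, add_zero]

/-- **Bending a state's leg into a red merge**: for a two-legged state `S`, merging (red) its second leg with a wire equals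
copying (red) the wire and capping the first copy against the second leg:
`(S ⊗ 𝕀) ⨾ (𝕀 ⊗ X^{(2,1)}) = X^{(1,2)} ⨾ (((S ⊗ 𝕀) ⨾ (𝕀 ⊗ ∩)) ⊗ 𝕀)`. [cite: JeandelPerdrixVilmart2018, §2.2 (only topology matters)] -/
theorem state_par_seq_par_xmerge (S : ZXClass 0 2) :
    (S ⊠ mk (wires 1)) ⨟ (mk (wires 1) ⊠ mk (X 2 1 0)) = mk (X 1 2 0) ⨟ (((S ⊠ mk (wires 1)) ⨟ (mk (wires 1) ⊠ mk cap)) ⊠ mk (wires 1)) := by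
  rw [← par_xsplit_seq_cap_par, wires_par_seq, ← seq_assoc,
    show mk (wires 1) ⊠ (mk (wires 1) ⊠ mk (X 1 2 0)) = mk (wires 2) ⊠ mk (X 1 2 0) from by rw [← wires_par_wires 1 1]; exact (par_assoc' _ _ _).trans (cast_id _ _ _),
    show (S ⊠ mk (wires 1)) ⨟ (mk (wires 2) ⊠ mk (X 1 2 0)) = mk (X 1 2 0) ⨟ (S ⊠ mk (wires 2)) from by
      rw [interchange, id_seq, seq_id, par_eq_seq_right S (mk (X 1 2 0)), empty_par, cast_id],
    seq_assoc, show mk (wires 1) ⊠ (mk cap ⊠ mk (wires 1)) = (mk (wires 1) ⊠ mk cap) ⊠ mk (wires 1) from (par_assoc' _ _ _).trans (cast_id _ _ _),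
    ← wires_par_wires 1 1, show S ⊠ (mk (wires 1) ⊠ mk (wires 1)) = (S ⊠ mk (wires 1)) ⊠ mk (wires 1) from (par_assoc' _ _ _).trans (cast_id _ _ _), ← seq_par_wires]

/-- The triangle slides around a cap as its transpose: `(T ⊗ 𝕀) ⨾ ∩ = (𝕀 ⊗ Tᵗ) ⨾ ∩`. [cite: JeandelPerdrixVilmart2018, §2.2] -/
theorem triangle_par_seq_cap : (mk triangle ⊠ mk (wires 1)) ⨟ mk cap = (mk (wires 1) ⊠ (mk triangle).transpose) ⨟ mk cap := by
  have h := congrArg transpose hb_cup_seq_par_triangle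
  simp at h
  exact h.symm

/-! ### Appendix Lemma 34, main computation: the plugged ladder re-rooted (figs. `…-proof-fin_01/02`) -/

/-- Scalar mover (bookkeeping): `A ⨾ (s ⊗ B) = s ⊗ (A ⨾ B)` for `A : 1 → 3`, `B : 3 → 1`. [folklore] -/
private theorem mvr_1_3_1 (A : ZXClass 1 3) (s : ZXClass 0 0) (B : ZXClass 3 1) : A ⨟ (s ⊠ B) = s ⊠ (A ⨟ B) := by
  rw [scalar_par_seq_right, empty_par, cast_id]

/-- The ladder plugged into a green copy and a red merge (its second output capped against the first copy, its first output
merged with the second copy), regrouped: the state `A'` of its first six layers next to the input, then the Hopf block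
`hopf_block`. [cite: JeandelPerdrixVilmart2018, Fig. 1 (S1), proof of Appendix Lemma 34] -/
theorem pluggedLadder_eq_hopf_block (a : ZMod 8) :
    mk (Z 1 2 0) ⨟ ((((((mk (Z 0 1 0) ⨟ mk triangle) ⊠ mk (X 0 1 a)) ⨟ (mk (wires 1) ⊠ mk (Z 1 2 0)) ⨟ ((mk (wires 1) ⊠ mk (X 1 1 a)) ⊠ mk (wires 1)) ⨟ (mk (Z 2 2 0) ⊠ mk (wires 1)) ⨟ ((mk (wires 1) ⊠ mk triangle) ⊠ mk (wires 1)) ⨟ (mk (wires 1) ⊠ mk (X 2 1 0)) ⨟ (mk (X 1 2 0) ⊠ mk (wires 1)) ⨟ (mk (wires 1) ⊠ mk (Z 2 1 0))) ⊠ mk (wires 1)) ⨟ (mk (wires 1) ⊠ mk cap)) ⊠ mk (wires 1)) ⨟ mk (X 2 1 0) =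
      ((((mk (Z 0 1 0) ⨟ mk triangle) ⊠ mk (X 0 1 a)) ⨟ (mk (wires 1) ⊠ mk (Z 1 2 0)) ⨟ ((mk (wires 1) ⊠ mk (X 1 1 a)) ⊠ mk (wires 1)) ⨟ (mk (Z 2 2 0) ⊠ mk (wires 1)) ⨟ ((mk (wires 1) ⊠ mk triangle) ⊠ mk (wires 1)) ⨟ (mk (wires 1) ⊠ mk (X 2 1 0))) ⊠ mk (wires 1)) ⨟ (((mk (X 1 2 0) ⊠ mk (wires 1)) ⊠ mk (wires 1)) ⨟ (mk (wires 1) ⊠ mk (Z 3 1 0)) ⨟ mk (X 2 1 0)) := by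
  -- the cap fuses the final merge of the ladder into a three-legged effect
  have hcap : ((((mk (Z 0 1 0) ⨟ mk triangle) ⊠ mk (X 0 1 a)) ⨟ (mk (wires 1) ⊠ mk (Z 1 2 0)) ⨟ ((mk (wires 1) ⊠ mk (X 1 1 a)) ⊠ mk (wires 1)) ⨟ (mk (Z 2 2 0) ⊠ mk (wires 1)) ⨟ ((mk (wires 1) ⊠ mk triangle) ⊠ mk (wires 1)) ⨟ (mk (wires 1) ⊠ mk (X 2 1 0)) ⨟ (mk (X 1 2 0) ⊠ mk (wires 1)) ⨟ (mk (wires 1) ⊠ mk (Z 2 1 0))) ⊠ mk (wires 1)) ⨟ (mk (wires 1) ⊠ mk cap) = ((((mk (Z 0 1 0) ⨟ mk triangle) ⊠ mk (X 0 1 a)) ⨟ (mk (wires 1) ⊠ mk (Z 1 2 0)) ⨟ ((mk (wires 1) ⊠ mk (X 1 1 a)) ⊠ mk (wires 1)) ⨟ (mk (Z 2 2 0) ⊠ mk (wires 1)) ⨟ ((mk (wires 1) ⊠ mk triangle) ⊠ mk (wires 1)) ⨟ (mk (wires 1) ⊠ mk (X 2 1 0)) ⨟ (mk (X 1 2 0)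 ⊠ mk (wires 1))) ⊠ mk (wires 1)) ⨟ (mk (wires 1) ⊠ mk (Z 3 0 0)) := by
    rw [seq_par_wires _ (mk (wires 1) ⊠ mk (Z 2 1 0)) 1, seq_assoc _ ((mk (wires 1) ⊠ mk (Z 2 1 0)) ⊠ mk (wires 1)),
      show (mk (wires 1) ⊠ mk (Z 2 1 0)) ⊠ mk (wires 1) = mk (wires 1) ⊠ (mk (Z 2 1 0) ⊠ mk (wires 1)) from (par_assoc _ _ _).trans (cast_id _ _ _), ← wires_par_seq, merge_par_seq_cap]
  rw [hcap, seq_par_wires _ (mk (wires 1) ⊠ mk (Z 3 0 0)) 1, ← seq_assoc (mk (Z 1 2 0)),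
    show ((((mk (Z 0 1 0) ⨟ mk triangle) ⊠ mk (X 0 1 a)) ⨟ (mk (wires 1) ⊠ mk (Z 1 2 0)) ⨟ ((mk (wires 1) ⊠ mk (X 1 1 a)) ⊠ mk (wires 1)) ⨟ (mk (Z 2 2 0) ⊠ mk (wires 1)) ⨟ ((mk (wires 1) ⊠ mk triangle) ⊠ mk (wires 1)) ⨟ (mk (wires 1) ⊠ mk (X 2 1 0)) ⨟ (mk (X 1 2 0) ⊠ mk (wires 1))) ⊠ mk (wires 1)) ⊠ mk (wires 1) = (((mk (Z 0 1 0) ⨟ mk triangle) ⊠ mk (X 0 1 a)) ⨟ (mk (wires 1) ⊠ mk (Z 1 2 0)) ⨟ ((mk (wires 1) ⊠ mk (X 1 1 a)) ⊠ mk (wires 1)) ⨟ (mk (Z 2 2 0) ⊠ mk (wires 1)) ⨟ ((mk (wires 1) ⊠ mk triangle) ⊠ mk (wires 1)) ⨟ (mk (wires 1) ⊠ mk (X 2 1 0)) ⨟ (mk (X 1 2 0) ⊠ mk (wires 1))) ⊠ mk (wires 2) from by rw [← wires_par_wires 1 1]; exact (par_assoc _ _ _).trans (cast_id _ _ _),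
    show mk (Z 1 2 0) ⨟ ((((mk (Z 0 1 0) ⨟ mk triangle) ⊠ mk (X 0 1 a)) ⨟ (mk (wires 1) ⊠ mk (Z 1 2 0)) ⨟ ((mk (wires 1) ⊠ mk (X 1 1 a)) ⊠ mk (wires 1)) ⨟ (mk (Z 2 2 0) ⊠ mk (wires 1)) ⨟ ((mk (wires 1) ⊠ mk triangle) ⊠ mk (wires 1)) ⨟ (mk (wires 1) ⊠ mk (X 2 1 0)) ⨟ (mk (X 1 2 0) ⊠ mk (wires 1))) ⊠ mk (wires 2)) = (((mk (Z 0 1 0) ⨟ mk triangle) ⊠ mk (X 0 1 a)) ⨟ (mk (wires 1) ⊠ mk (Z 1 2 0)) ⨟ ((mk (wires 1) ⊠ mk (X 1 1 a)) ⊠ mk (wires 1)) ⨟ (mk (Z 2 2 0) ⊠ mk (wires 1)) ⨟ ((mk (wires 1) ⊠ mk triangle) ⊠ mk (wires 1)) ⨟ (mk (wires 1) ⊠ mk (X 2 1 0)) ⨟ (mk (X 1 2 0) ⊠ mk (wires 1))) ⊠ mk (Z 1 2 0) from by rw [par_eq_seq_right (((mk (Z 0 1 0) ⨟ mk triangle)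 ⊠ mk (X 0 1 a)) ⨟ (mk (wires 1) ⊠ mk (Z 1 2 0)) ⨟ ((mk (wires 1) ⊠ mk (X 1 1 a)) ⊠ mk (wires 1)) ⨟ (mk (Z 2 2 0) ⊠ mk (wires 1)) ⨟ ((mk (wires 1) ⊠ mk triangle) ⊠ mk (wires 1)) ⨟ (mk (wires 1) ⊠ mk (X 2 1 0)) ⨟ (mk (X 1 2 0) ⊠ mk (wires 1))) (mk (Z 1 2 0)), empty_par, cast_id],
    par_eq_seq_left (((mk (Z 0 1 0) ⨟ mk triangle) ⊠ mk (X 0 1 a)) ⨟ (mk (wires 1) ⊠ mk (Z 1 2 0)) ⨟ ((mk (wires 1) ⊠ mk (X 1 1 a)) ⊠ mk (wires 1)) ⨟ (mk (Z 2 2 0) ⊠ mk (wires 1)) ⨟ ((mk (wires 1) ⊠ mk triangle) ⊠ mk (wires 1)) ⨟ (mk (wires 1) ⊠ mk (X 2 1 0)) ⨟ (mk (X 1 2 0) ⊠ mk (wires 1))) (mk (Z 1 2 0)), seq_assoc _ (mk (wires 3) ⊠ mk (Z 1 2 0)),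
    show (mk (wires 3) ⊠ mk (Z 1 2 0)) ⨟ ((mk (wires 1) ⊠ mk (Z 3 0 0)) ⊠ mk (wires 1)) = mk (wires 1) ⊠ mk (Z 3 1 0) from by
      rw [← wires_par_wires 1 2, show (mk (wires 1) ⊠ mk (wires 2)) ⊠ mk (Z 1 2 0) = mk (wires 1) ⊠ (mk (wires 2) ⊠ mk (Z 1 2 0)) from (par_assoc _ _ _).trans (cast_id _ _ _),
        show (mk (wires 1) ⊠ mk (Z 3 0 0)) ⊠ mk (wires 1) = mk (wires 1) ⊠ (mk (Z 3 0 0) ⊠ mk (wires 1)) from (par_assoc _ _ _).trans (cast_id _ _ _), ← wires_par_seq, wires_two_par_split_seq_effect_par],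
    seq_par_wires _ (mk (X 1 2 0) ⊠ mk (wires 1)) 1]
  simp only [seq_assoc]

/-- After the Hopf cut: the plugged ladder is `½ ⊗` the state `A₆` of its first five layers with the red merge turned into a
three-legged red effect joining the rung, the second copy of the root and the input.
[cite: JeandelPerdrixVilmart2018, Appendix (Hopf law), proof of Lemma 34] -/
theorem pluggedLadder_eq_effect (a : ZMod 8) :
    mk (Z 1 2 0) ⨟ ((((((mk (Z 0 1 0) ⨟ mk triangle) ⊠ mk (X 0 1 a)) ⨟ (mk (wires 1) ⊠ mk (Z 1 2 0)) ⨟ ((mk (wires 1) ⊠ mk (X 1 1 a)) ⊠ mk (wires 1)) ⨟ (mk (Z 2 2 0) ⊠ mk (wires 1)) ⨟ ((mk (wires 1) ⊠ mk triangle) ⊠ mk (wires 1)) ⨟ (mk (wires 1) ⊠ mk (X 2 1 0)) ⨟ (mk (X 1 2 0) ⊠ mk (wires 1)) ⨟ (mk (wires 1) ⊠ mk (Z 2 1 0))) ⊠ mk (wires 1)) ⨟ (mk (wires 1) ⊠ mk cap)) ⊠ mk (wires 1)) ⨟ mk (X 2 1 0) =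
      mk invSqrtTwo ⊠ (mk invSqrtTwo ⊠ (((((mk (Z 0 1 0) ⨟ mk triangle) ⊠ mk (X 0 1 a)) ⨟ (mk (wires 1) ⊠ mk (Z 1 2 0)) ⨟ ((mk (wires 1) ⊠ mk (X 1 1 a)) ⊠ mk (wires 1)) ⨟ (mk (Z 2 2 0) ⊠ mk (wires 1)) ⨟ ((mk (wires 1) ⊠ mk triangle) ⊠ mk (wires 1))) ⊠ mk (wires 1)) ⨟ (mk (wires 1) ⊠ mk (X 3 0 0)))) := by
  rw [pluggedLadder_eq_hopf_block, hopf_block, mvr_1_3_1, mvr_1_3_1, seq_par_wires _ (mk (wires 1) ⊠ mk (X 2 1 0)) 1, seq_assoc,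
    show (mk (wires 1) ⊠ mk (X 2 1 0)) ⊠ mk (wires 1) = mk (wires 1) ⊠ (mk (X 2 1 0) ⊠ mk (wires 1)) from (par_assoc _ _ _).trans (cast_id _ _ _), ← wires_par_seq, xmerge_par_seq_cap]

/-- **Re-rooting the cut ladder** (fig. `…-proof-fin_02`): the state `A₆` (pendant, root, `X(α)`, the pendant's node, the
rung) with the three-legged red effect on (rung, second copy of the root, input) equals, read from the input: a red `π/2`
copy (the rung's `X(π/2)` fused in), the root as a merge with the red `α` state followed by `X(α)` on the first copy, the
rest of the transposed rung (`Z(π/4)`, the leaf, the gadget node) on the second copy, and the merge with the pendant.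
[cite: JeandelPerdrixVilmart2018, §2.2 (only topology matters), §6 (def. of the triangle), proof of Appendix Lemma 34] -/
theorem effect_reroot (a : ZMod 8) :
    ((((mk (Z 0 1 0) ⨟ mk triangle) ⊠ mk (X 0 1 a)) ⨟ (mk (wires 1) ⊠ mk (Z 1 2 0)) ⨟ ((mk (wires 1) ⊠ mk (X 1 1 a)) ⊠ mk (wires 1)) ⨟ (mk (Z 2 2 0) ⊠ mk (wires 1)) ⨟ ((mk (wires 1) ⊠ mk triangle) ⊠ mk (wires 1))) ⊠ mk (wires 1)) ⨟ (mk (wires 1) ⊠ mk (X 3 0 0)) = mk (X 1 2 2) ⨟ (((mk (X 0 1 a) ⊠ mk (wires 1)) ⨟ mk (Z 2 1 0) ⨟ mk (X 1 1 a)) ⊠ (mk (Z 1 1 1) ⨟ mk (xLeafL 0 1) ⨟ (mk (Z 1 2 0) ⨟ (mk (wires 1) ⊠ (mk (X 1 2 0) ⨟ (mk (Z 1 0 (-1)) ⊠ mk (Z 1 0 (-1)))))))) ⨟ (((mk (Z 0 1 0) ⨟ mk triangle) ⊠ mk (wires 2)) ⨟ mk (Z 3 1 0)) := by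
  have hB3 : ((mk (Z 0 1 0) ⨟ mk triangle) ⊠ mk (X 0 1 a)) ⨟ (mk (wires 1) ⊠ mk (Z 1 2 0)) ⨟ ((mk (wires 1) ⊠ mk (X 1 1 a)) ⊠ mk (wires 1)) = (mk (Z 0 1 0) ⨟ mk triangle) ⊠ (mk (X 0 1 a) ⨟ mk (Z 1 2 0) ⨟ (mk (X 1 1 a) ⊠ mk (wires 1))) := by
    rw [interchange, seq_id, show (mk (wires 1) ⊠ mk (X 1 1 a)) ⊠ mk (wires 1) = mk (wires 1) ⊠ (mk (X 1 1 a) ⊠ mk (wires 1)) from (par_assoc _ _ _).trans (cast_id _ _ _), interchange, seq_id]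
  have hBhat : ((mk (X 0 1 a) ⨟ mk (Z 1 2 0) ⨟ (mk (X 1 1 a) ⊠ mk (wires 1))) ⊠ mk (wires 1)) ⨟ (mk (wires 1) ⊠ mk cap) = ((mk (X 0 1 a) ⊠ mk (wires 1)) ⨟ mk (Z 2 1 0) ⨟ mk (X 1 1 a)) := by
    rw [seq_par_wires, show (mk (X 1 1 a) ⊠ mk (wires 1)) ⊠ mk (wires 1) = mk (X 1 1 a) ⊠ mk (wires 2) from by rw [← wires_par_wires 1 1]; exact (par_assoc _ _ _).trans (cast_id _ _ _),
      seq_assoc, show (mk (X 1 1 a) ⊠ mk (wires 2)) ⨟ (mk (wires 1) ⊠ mk cap) = (mk (wires 1) ⊠ mk cap) ⨟ mk (X 1 1 a) from by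
        rw [interchange, seq_id, id_seq, par_eq_seq_right (mk (X 1 1 a)) (mk cap), par_empty],
      ← seq_assoc, seq_par_wires, seq_assoc (mk (X 0 1 a) ⊠ mk (wires 1)), split_par_seq_par_cap]
  have hc5 : ∀ R' : ZXClass 3 1, (((mk (wires 1) ⊠ mk triangle) ⊠ mk (wires 1)) ⊠ mk (wires 1)) ⨟ ((mk (wires 1) ⊠ (mk (wires 1) ⊠ mk (X 2 1 0))) ⨟ R') = (mk (wires 2) ⊠ mk (X 2 1 0)) ⨟ (((mk (wires 1) ⊠ mk triangle) ⊠ mk (wires 1)) ⨟ R') := fun R' => by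
    rw [← seq_assoc, ← seq_assoc, show ((mk (wires 1) ⊠ mk triangle) ⊠ mk (wires 1)) ⊠ mk (wires 1) = (mk (wires 1) ⊠ mk triangle) ⊠ mk (wires 2) from by rw [← wires_par_wires 1 1]; exact (par_assoc _ _ _).trans (cast_id _ _ _),
      show mk (wires 1) ⊠ (mk (wires 1) ⊠ mk (X 2 1 0)) = mk (wires 2) ⊠ mk (X 2 1 0) from by rw [← wires_par_wires 1 1]; exact (par_assoc' _ _ _).trans (cast_id _ _ _),
      interchange, seq_id, id_seq, interchange, id_seq, seq_id]
  have hc4 : ∀ R' : ZXClass 3 1, ((mk (Z 2 2 0) ⊠ mk (wires 1)) ⊠ mk (wires 1)) ⨟ ((mk (wires 2) ⊠ mk (X 2 1 0)) ⨟ R') = (mk (wires 2) ⊠ mk (X 2 1 0)) ⨟ ((mk (Z 2 2 0) ⊠ mk (wires 1)) ⨟ R') := fun R' => by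
    rw [← seq_assoc, ← seq_assoc, show (mk (Z 2 2 0) ⊠ mk (wires 1)) ⊠ mk (wires 1) = mk (Z 2 2 0) ⊠ mk (wires 2) from by rw [← wires_par_wires 1 1]; exact (par_assoc _ _ _).trans (cast_id _ _ _),
      interchange, seq_id, id_seq, interchange, id_seq, seq_id]
  have hfront : ∀ R' : ZXClass 3 1, ((((mk (Z 0 1 0) ⨟ mk triangle) ⊠ mk (X 0 1 a)) ⨟ (mk (wires 1) ⊠ mk (Z 1 2 0)) ⨟ ((mk (wires 1) ⊠ mk (X 1 1 a)) ⊠ mk (wires 1))) ⊠ mk (wires 1)) ⨟ ((mk (wires 2) ⊠ mk (X 2 1 0)) ⨟ R') = ((mk (Z 0 1 0) ⨟ mk triangle) ⊠ (mk (X 1 2 0) ⨟ (((mk (X 0 1 a) ⊠ mk (wires 1)) ⨟ mk (Z 2 1 0) ⨟ mk (X 1 1 a)) ⊠ mk (wires 1)))) ⨟ R' := fun R' => by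
    rw [← seq_assoc, hB3, ← wires_par_wires 1 1, show ((mk (Z 0 1 0) ⨟ mk triangle) ⊠ (mk (X 0 1 a) ⨟ mk (Z 1 2 0) ⨟ (mk (X 1 1 a) ⊠ mk (wires 1)))) ⊠ mk (wires 1) = (mk (Z 0 1 0) ⨟ mk triangle) ⊠ ((mk (X 0 1 a) ⨟ mk (Z 1 2 0) ⨟ (mk (X 1 1 a) ⊠ mk (wires 1))) ⊠ mk (wires 1)) from (par_assoc _ _ _).trans (cast_id _ _ _),
      show (mk (wires 1) ⊠ mk (wires 1)) ⊠ mk (X 2 1 0) = mk (wires 1) ⊠ (mk (wires 1) ⊠ mk (X 2 1 0)) from (par_assoc _ _ _).trans (cast_id _ _ _), interchange, seq_id,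
      state_par_seq_par_xmerge, hBhat]
  have hT : ((mk (wires 1) ⊠ mk triangle) ⊠ mk (wires 1)) ⨟ (mk (wires 1) ⊠ mk cap) = (mk (wires 2) ⊠ (mk triangle).transpose) ⨟ (mk (wires 1) ⊠ mk cap) := by
    rw [show (mk (wires 1) ⊠ mk triangle) ⊠ mk (wires 1) = mk (wires 1) ⊠ (mk triangle ⊠ mk (wires 1)) from (par_assoc _ _ _).trans (cast_id _ _ _), ← wires_par_seq,
      triangle_par_seq_cap, wires_par_seq, show mk (wires 1) ⊠ (mk (wires 1) ⊠ (mk triangle).transpose) = mk (wires 2) ⊠ (mk triangle).transpose from by rw [← wires_par_wires 1 1]; exact (par_assoc' _ _ _).trans (cast_id _ _ _)]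
  have hZT : ∀ R' : ZXClass 3 1, (mk (Z 2 2 0) ⊠ mk (wires 1)) ⨟ ((mk (wires 2) ⊠ (mk triangle).transpose) ⨟ R') = (mk (wires 2) ⊠ (mk triangle).transpose) ⨟ ((mk (Z 2 2 0) ⊠ mk (wires 1)) ⨟ R') := fun R' => by
    rw [← seq_assoc, ← seq_assoc, interchange, seq_id, id_seq, interchange, id_seq, seq_id]
  have hZ31 : (mk (Z 2 2 0) ⊠ mk (wires 1)) ⨟ (mk (wires 1) ⊠ mk cap) = mk (Z 3 1 0) := by
    rw [show mk (Z 2 2 0) = mk (Z 2 1 0) ⨟ mk (Z 1 2 0) from by rw [Z_seq_Z 2 1 2 le_rfl, add_zero], seq_par_wires, seq_assoc, split_par_seq_par_cap,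
      Z_par_seq_Z 2 1 1 1 le_rfl, add_zero (0 : ZMod 8)]
  have hpdT : ((mk (Z 0 1 0) ⨟ mk triangle) ⊠ (mk (X 1 2 0) ⨟ (((mk (X 0 1 a) ⊠ mk (wires 1)) ⨟ mk (Z 2 1 0) ⨟ mk (X 1 1 a)) ⊠ mk (wires 1)))) ⨟ (mk (wires 2) ⊠ (mk triangle).transpose) = (mk (Z 0 1 0) ⨟ mk triangle) ⊠ (mk (X 1 2 0) ⨟ (((mk (X 0 1 a) ⊠ mk (wires 1)) ⨟ mk (Z 2 1 0) ⨟ mk (X 1 1 a)) ⊠ (mk triangle).transpose)) := by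
    rw [← wires_par_wires 1 1, show (mk (wires 1) ⊠ mk (wires 1)) ⊠ (mk triangle).transpose = mk (wires 1) ⊠ (mk (wires 1) ⊠ (mk triangle).transpose) from (par_assoc _ _ _).trans (cast_id _ _ _), interchange, seq_id, seq_assoc,
      interchange, seq_id, id_seq]
  rw [show mk (X 3 0 0) = (mk (wires 1) ⊠ mk (X 2 1 0)) ⨟ mk cap from by rw [← X_two_zero, par_X_seq_X 1 2 1 0 le_rfl, add_zero], wires_par_seq,
    seq_par_wires _ ((mk (wires 1) ⊠ mk triangle) ⊠ mk (wires 1)) 1, seq_par_wires _ (mk (Z 2 2 0) ⊠ mk (wires 1)) 1]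
  simp only [seq_assoc]
  simp only [seq_assoc] at hfront hpdT
  rw [hc5, hc4, hfront, hT, hZT, hZ31, ← seq_assoc, hpdT, par_eq_seq_right (mk (Z 0 1 0) ⨟ mk triangle) (mk (X 1 2 0) ⨟ (((mk (X 0 1 a) ⊠ mk (wires 1)) ⨟ (mk (Z 2 1 0) ⨟ mk (X 1 1 a))) ⊠ (mk triangle).transpose)), empty_par, cast_id, seq_assoc,
    triangle_transpose_explicit, seq_assoc (mk (X 1 1 2)) (mk (Z 1 1 1)) (mk (xLeafL 0 1)), seq_assoc (mk (X 1 1 2)) _ (mk (Z 1 2 0) ⨟ (mk (wires 1) ⊠ (mk (X 1 2 0) ⨟ (mk (Z 1 0 (-1)) ⊠ mk (Z 1 0 (-1)))))),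
    show ((mk (X 0 1 a) ⊠ mk (wires 1)) ⨟ (mk (Z 2 1 0) ⨟ mk (X 1 1 a))) ⊠ (mk (X 1 1 2) ⨟ (mk (Z 1 1 1) ⨟ mk (xLeafL 0 1) ⨟ (mk (Z 1 2 0) ⨟ (mk (wires 1) ⊠ (mk (X 1 2 0) ⨟ (mk (Z 1 0 (-1)) ⊠ mk (Z 1 0 (-1)))))))) = (mk (wires 1) ⊠ mk (X 1 1 2)) ⨟ (((mk (X 0 1 a) ⊠ mk (wires 1)) ⨟ (mk (Z 2 1 0) ⨟ mk (X 1 1 a))) ⊠ (mk (Z 1 1 1) ⨟ mk (xLeafL 0 1) ⨟ (mk (Z 1 2 0) ⨟ (mk (wires 1) ⊠ (mk (X 1 2 0) ⨟ (mk (Z 1 0 (-1)) ⊠ mk (Z 1 0 (-1)))))))) from by rw [interchange, id_seq],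
    ← seq_assoc (mk (X 1 2 0)), X_seq_par_X 1 1 1 1 le_rfl]
  simp only [seq_assoc, zero_add]

/-- **KEY STEP B of the main computation of Appendix Lemma 34** (figs. `…-proof-fin_01/02`): `√2 ⊗` the ladder plugged
into a green copy and a red merge is `1/√2 ⊗` the re-rooted form `effect_reroot`.
[cite: JeandelPerdrixVilmart2018, Appendix, proof of Lemma 34 (inverse rule, Hopf law, def. of the triangle)] -/
theorem sqrt_two_par_pluggedLadder (a : ZMod 8) :
    mk (dumbbell 0 0) ⊠ (mk (Z 1 2 0) ⨟ ((((((mk (Z 0 1 0) ⨟ mk triangle) ⊠ mk (X 0 1 a)) ⨟ (mk (wires 1) ⊠ mk (Z 1 2 0)) ⨟ ((mk (wires 1) ⊠ mk (X 1 1 a)) ⊠ mk (wires 1)) ⨟ (mk (Z 2 2 0) ⊠ mk (wires 1)) ⨟ ((mk (wires 1) ⊠ mk triangle) ⊠ mk (wires 1)) ⨟ (mk (wires 1) ⊠ mk (X 2 1 0)) ⨟ (mk (X 1 2 0) ⊠ mk (wires 1)) ⨟ (mk (wires 1) ⊠ mk (Z 2 1 0))) ⊠ mk (wires 1)) ⨟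 (mk (wires 1) ⊠ mk cap)) ⊠ mk (wires 1)) ⨟ mk (X 2 1 0)) = mk invSqrtTwo ⊠ (mk (X 1 2 2) ⨟ (((mk (X 0 1 a) ⊠ mk (wires 1)) ⨟ mk (Z 2 1 0) ⨟ mk (X 1 1 a)) ⊠ (mk (Z 1 1 1) ⨟ mk (xLeafL 0 1) ⨟ (mk (Z 1 2 0) ⨟ (mk (wires 1) ⊠ (mk (X 1 2 0) ⨟ (mk (Z 1 0 (-1)) ⊠ mk (Z 1 0 (-1)))))))) ⨟ (((mk (Z 0 1 0) ⨟ mk triangle) ⊠ mk (wires 2)) ⨟ mk (Z 3 1 0))) := by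
  rw [pluggedLadder_eq_effect, effect_reroot, scalar_par_scalar_par (mk (dumbbell 0 0)) (mk invSqrtTwo), invSqrtTwo_par_sqrt_two_par_cancel, cast_id]

/-! ### Appendix Lemma 34, main computation: the bialgebra square (figs. `…-proof-fin_02–04`) -/

/-- **Re-rooting the root of the ladder** (towards fig. `…-proof-fin_04`): the red `π/2` copy whose first copy merges (green)
with the red `α` state and continues through `X(α)` equals the red `α` state copied (green), its first copy through `X(π/2)`
merged (red) with the wire, its second copy through `X(α)`, outputs exchanged.
[cite: JeandelPerdrixVilmart2018, §2.2 (only topology matters), proof of Appendix Lemma 34] -/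
theorem xsplit_two_seq_rootMerge_par (a : ZMod 8) :
    mk (X 1 2 2) ⨟ (((mk (X 0 1 a) ⊠ mk (wires 1)) ⨟ mk (Z 2 1 0) ⨟ mk (X 1 1 a)) ⊠ mk (wires 1)) = (mk (wires 1) ⊠ (mk (X 0 1 a) ⨟ mk (Z 1 2 0) ⨟ (mk (X 1 1 2) ⊠ mk (X 1 1 a)))) ⨟ (mk (X 2 1 0) ⊠ mk (wires 1)) ⨟ mk swap := by
  symm
  rw [wires_par_seq 1 (mk (X 0 1 a) ⨟ mk (Z 1 2 0)) _, wires_par_seq 1 (mk (X 0 1 a)) _, seq_assoc _ (mk (wires 1) ⊠ (mk (X 1 1 2) ⊠ mk (X 1 1 a))),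
    show (mk (wires 1) ⊠ (mk (X 1 1 2) ⊠ mk (X 1 1 a))) ⨟ (mk (X 2 1 0) ⊠ mk (wires 1)) = (mk (X 2 1 0) ⊠ mk (wires 1)) ⨟ (mk (X 1 1 2) ⊠ mk (X 1 1 a)) from by
      rw [show mk (wires 1) ⊠ (mk (X 1 1 2) ⊠ mk (X 1 1 a)) = (mk (wires 1) ⊠ mk (X 1 1 2)) ⊠ mk (X 1 1 a) from (par_assoc' _ _ _).trans (cast_id _ _ _), interchange, seq_id,
        par_X_seq_X 1 1 1 1 le_rfl, zero_add, show mk (X (1 + 1) 1 2) = mk (X 2 1 0) ⨟ mk (X 1 1 2) from by rw [X_seq_X 2 1 1 le_rfl, zero_add], interchange, id_seq],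
    seq_assoc (mk (wires 1) ⊠ mk (X 0 1 a)) (mk (wires 1) ⊠ mk (Z 1 2 0)) _, ← seq_assoc (mk (wires 1) ⊠ mk (Z 1 2 0)) (mk (X 2 1 0) ⊠ mk (wires 1)) _, cnot21_eq,
    seq_assoc (mk (X 1 2 0) ⊠ mk (wires 1)) (mk (wires 1) ⊠ mk (Z 2 1 0)) _, ← seq_assoc (mk (wires 1) ⊠ mk (X 0 1 a)) (mk (X 1 2 0) ⊠ mk (wires 1)) _,
    show (mk (wires 1) ⊠ mk (X 0 1 a)) ⨟ (mk (X 1 2 0) ⊠ mk (wires 1)) = mk (X 1 2 0) ⨟ (mk (wires 2) ⊠ mk (X 0 1 a)) from by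
      rw [interchange, id_seq, seq_id, par_eq_seq_left (mk (X 1 2 0)) (mk (X 0 1 a)), par_empty],
    seq_assoc (mk (X 1 2 0)), ← seq_assoc (mk (wires 2) ⊠ mk (X 0 1 a)) (mk (wires 1) ⊠ mk (Z 2 1 0)) _, ← wires_par_wires 1 1,
    show ((mk (wires 1) ⊠ mk (wires 1)) ⊠ mk (X 0 1 a)) = mk (wires 1) ⊠ (mk (wires 1) ⊠ mk (X 0 1 a)) from (par_assoc _ _ _).trans (cast_id _ _ _), ← wires_par_seq,
    show (mk (wires 1) ⊠ mk (X 0 1 a)) ⨟ mk (Z 2 1 0) = (mk (X 0 1 a) ⊠ mk (wires 1)) ⨟ mk (Z 2 1 0) from by rw [← state_par_seq_swap (mk (X 0 1 a)) (mk (wires 1)), seq_assoc, swap_seq_Z],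
    show (mk (wires 1) ⊠ ((mk (X 0 1 a) ⊠ mk (wires 1)) ⨟ mk (Z 2 1 0))) ⨟ (mk (X 1 1 2) ⊠ mk (X 1 1 a)) = mk (X 1 1 2) ⊠ (((mk (X 0 1 a) ⊠ mk (wires 1)) ⨟ mk (Z 2 1 0)) ⨟ mk (X 1 1 a)) from by rw [interchange, id_seq],
    seq_assoc, ← swap_seq_par_one_one, ← seq_assoc, X_seq_swap, par_eq_seq_right (((mk (X 0 1 a) ⊠ mk (wires 1)) ⨟ mk (Z 2 1 0)) ⨟ mk (X 1 1 a)) (mk (X 1 1 2)), ← seq_assoc,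
    X_seq_par_X 1 1 1 1 le_rfl, zero_add (2 : ZMod 8)]

/-- The other CNOT conjugated by swaps is the mirrored CNOT: `σ ⨾ ((X^(1, 2) ⊗ 𝕀) ⨾ (𝕀 ⊗ Z^(2, 1))) ⨾ σ = (𝕀 ⊗ X^(1, 2)) ⨾ (Z^(2, 1) ⊗ 𝕀)`.
[cite: JeandelPerdrixVilmart2018, §2.2 (only topology matters)] -/
theorem swap_seq_notc_seq_swap : mk swap ⨟ ((mk (X 1 2 0) ⊠ mk (wires 1)) ⨟ (mk (wires 1) ⊠ mk (Z 2 1 0))) ⨟ mk swap = (mk (wires 1) ⊠ mk (X 1 2 0)) ⨟ (mk (Z 2 1 0) ⊠ mk (wires 1)) := by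
  have hx := fswap1_nat (mk (X 1 2 0))
  rw [fswap1_one, fswap1_two] at hx
  have hz := wires_par_seq_fswap1 (mk (Z 2 1 0))
  rw [fswap1_one, fswap1_two] at hz
  rw [← seq_assoc, hx, seq_assoc, seq_assoc, seq_assoc, ← seq_assoc (mk (wires 1) ⊠ mk swap), ← wires_par_seq, swap_seq_Z, hz, ← seq_assoc (mk swap ⊠ mk (wires 1)), ← seq_assoc (mk swap ⊠ mk (wires 1)),
    ← seq_par_wires, swap_seq_swap, wires_par_wires, id_seq, ← seq_assoc, ← wires_par_seq, X_seq_swap]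

/-- **The bialgebra square of the main computation in the orientation of rule (C)** (figs. `…-proof-fin_02–04`): a green copy of
the first input whose first copy merges (red) with the second input and whose second copy is capped against the third input
equals `√2 ⊗` a green copy of the second input, the red merge of the first input with its first copy, the red merge of its
second copy with the third input, and the green merge of the two:
`(Z^(1, 2) ⊗ 𝕀²) ⨾ (𝕀 ⊗ σ ⊗ 𝕀) ⨾ (X^(2, 1) ⊗ ∩) = √2 ⊗ ((𝕀 ⊗ Z^(1, 2) ⊗ 𝕀) ⨾ (X^(2, 1) ⊗ 𝕀²) ⨾ (𝕀 ⊗ X^(2, 1)) ⨾ Z^(2, 1))`.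
[cite: JeandelPerdrixVilmart2018, Fig. 1 (B2), proof of Appendix Lemma 34] -/
theorem square31 :
    ((mk (Z 1 2 0) ⊠ mk (wires 1)) ⊠ mk (wires 1)) ⨟ ((mk (wires 1) ⊠ mk swap) ⊠ mk (wires 1)) ⨟ (mk (X 2 1 0) ⊠ mk cap) =
      mk (dumbbell 0 0) ⊠ (((mk (wires 1) ⊠ mk (Z 1 2 0)) ⊠ mk (wires 1)) ⨟ ((mk (X 2 1 0) ⊠ mk (wires 1)) ⊠ mk (wires 1)) ⨟ (mk (wires 1) ⊠ mk (X 2 1 0)) ⨟ mk (Z 2 1 0)) := by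
  -- the bracket `Z-copy, then X-merge of the first copy with the second input` is CNOT followed by a swap
  have hnat := wires_par_seq_fswap1 (mk (X 2 1 0))
  rw [fswap1_one, fswap1_two] at hnat
  have hbr : (mk (Z 1 2 0) ⊠ mk (wires 1)) ⨟ (mk (wires 1) ⊠ mk swap) ⨟ (mk (X 2 1 0) ⊠ mk (wires 1)) = ((mk (Z 1 2 0) ⊠ mk (wires 1)) ⨟ (mk (wires 1) ⊠ mk (X 2 1 0))) ⨟ mk swap := by
    symm; rw [seq_assoc, hnat, ← seq_assoc, ← seq_assoc, ← seq_par_wires, Z_seq_swap]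
  have htail : (((mk swap ⨟ ((mk (X 1 2 0) ⊠ mk (wires 1)) ⨟ (mk (wires 1) ⊠ mk (Z 2 1 0)))) ⨟ mk swap) ⊠ mk (wires 1)) ⨟ (mk (wires 1) ⊠ mk cap) = (mk (wires 1) ⊠ mk (X 2 1 0)) ⨟ mk (Z 2 1 0) := by
    rw [swap_seq_notc_seq_swap, seq_par_wires, seq_assoc, show ((mk (Z 2 1 0) ⊠ mk (wires 1)) ⊠ mk (wires 1)) ⨟ (mk (wires 1) ⊠ mk cap) = (mk (wires 2) ⊠ mk cap) ⨟ mk (Z 2 1 0) from by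
        rw [show (mk (Z 2 1 0) ⊠ mk (wires 1)) ⊠ mk (wires 1) = mk (Z 2 1 0) ⊠ mk (wires 2) from by rw [← wires_par_wires 1 1]; exact (par_assoc _ _ _).trans (cast_id _ _ _),
          interchange, seq_id, id_seq, par_eq_seq_right (mk (Z 2 1 0)) (mk cap), par_empty],
      ← seq_assoc, show (mk (wires 1) ⊠ mk (X 1 2 0)) ⊠ mk (wires 1) = mk (wires 1) ⊠ (mk (X 1 2 0) ⊠ mk (wires 1)) from (par_assoc _ _ _).trans (cast_id _ _ _),
      ← wires_par_wires 1 1, show (mk (wires 1) ⊠ mk (wires 1)) ⊠ mk cap = mk (wires 1) ⊠ (mk (wires 1) ⊠ mk cap) from (par_assoc _ _ _).trans (cast_id _ _ _), ← wires_par_seq, xsplit_par_seq_par_cap]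
  rw [show mk (X 2 1 0) ⊠ mk cap = ((mk (X 2 1 0) ⊠ mk (wires 1)) ⊠ mk (wires 1)) ⨟ (mk (wires 1) ⊠ mk cap) from by
      rw [show (mk (X 2 1 0) ⊠ mk (wires 1)) ⊠ mk (wires 1) = mk (X 2 1 0) ⊠ mk (wires 2) from by rw [← wires_par_wires 1 1]; exact (par_assoc _ _ _).trans (cast_id _ _ _), interchange, seq_id, id_seq],
    ← seq_assoc, ← seq_par_wires, ← seq_par_wires, hbr, rule_B2_cnot, show ∀ (s : ZXClass 0 0) (A : ZXClass 2 2) (B : ZXClass 2 2), (s ⊠ A) ⨟ B = s ⊠ (A ⨟ B) from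
      fun s A B => by rw [scalar_par_seq_left, empty_par, cast_id],
    show ∀ (s : ZXClass 0 0) (A : ZXClass 2 2), (s ⊠ A) ⊠ mk (wires 1) = s ⊠ (A ⊠ mk (wires 1)) from fun s A => (par_assoc _ _ _).trans (cast_id _ _ _),
    show ∀ (s : ZXClass 0 0) (A : ZXClass 3 3) (B : ZXClass 3 1), (s ⊠ A) ⨟ B = s ⊠ (A ⨟ B) from fun s A B => by rw [scalar_par_seq_left, empty_par, cast_id],
    seq_assoc ((mk (X 1 2 0) ⊠ mk (wires 1)) ⨟ (mk (wires 1) ⊠ mk (Z 2 1 0))) (mk swap) ((mk (X 1 2 0) ⊠ mk (wires 1)) ⨟ (mk (wires 1) ⊠ mk (Z 2 1 0))), seq_assoc ((mk (X 1 2 0) ⊠ mk (wires 1)) ⨟ (mk (wires 1) ⊠ mk (Z 2 1 0))) (mk swap ⨟ ((mk (X 1 2 0) ⊠ mk (wires 1)) ⨟ (mk (wires 1) ⊠ mk (Z 2 1 0)))) (mk swap), seq_par_wires, seq_assoc, htail, ← cnot21_eq, seq_par_wires]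
  simp only [seq_assoc]

/-- A cap after a swap on its first leg is a cap after a swap on its second leg: `(σ ⊗ 𝕀) ⨾ (𝕀 ⊗ ∩) = (𝕀 ⊗ σ) ⨾ (∩ ⊗ 𝕀)`.
[cite: JeandelPerdrixVilmart2018, §2.2 (only topology matters)] -/
theorem swap_par_seq_par_cap : (mk swap ⊠ mk (wires 1)) ⨟ (mk (wires 1) ⊠ mk cap) = (mk (wires 1) ⊠ mk swap) ⨟ (mk cap ⊠ mk (wires 1)) := by
  have h := wires_par_seq_fswap1 (mk cap)
  rw [fswap1_zero, fswap1_two, seq_id] at h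
  rw [h, ← seq_assoc, ← seq_assoc, ← seq_par_wires, swap_seq_swap, wires_par_wires, id_seq]

/-- Scalar mover (bookkeeping): `A ⨾ (s ⊗ B) = s ⊗ (A ⨾ B)` for `A : 2 → 4`, `B : 4 → 2`. [folklore] -/
private theorem mvr_2_4_2 (A : ZXClass 2 4) (s : ZXClass 0 0) (B : ZXClass 4 2) : A ⨟ (s ⊠ B) = s ⊠ (A ⨟ B) := by
  rw [scalar_par_seq_right, empty_par, cast_id]

/-- Regrouping (bookkeeping): `(A ⊗ 𝕀) ⊗ 𝕀 = A ⊗ 𝕀²` for `A : 3 → 3`. [folklore] -/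
private theorem rg33 (A : ZXClass 3 3) : (A ⊠ mk (wires 1)) ⊠ mk (wires 1) = A ⊠ mk (wires 2) := by
  rw [← wires_par_wires 1 1]; exact (par_assoc _ _ _).trans (cast_id _ _ _)

/-- Regrouping (bookkeeping): `(A ⊗ 𝕀) ⊗ 𝕀 = A ⊗ 𝕀²` for `A : 2 → 3`. [folklore] -/
private theorem rg23 (A : ZXClass 2 3) : (A ⊠ mk (wires 1)) ⊠ mk (wires 1) = A ⊠ mk (wires 2) := by
  rw [← wires_par_wires 1 1]; exact (par_assoc _ _ _).trans (cast_id _ _ _)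

/-- Regrouping (bookkeeping): `(A ⊗ 𝕀²) ⊗ 𝕀 = (A ⊗ 𝕀) ⊗ 𝕀²` for `A : 1 → 2`. [folklore] -/
private theorem rg12 (A : ZXClass 1 2) : (A ⊠ mk (wires 2)) ⊠ mk (wires 1) = (A ⊠ mk (wires 1)) ⊠ mk (wires 2) := by
  rw [show A ⊠ mk (wires 2) = (A ⊠ mk (wires 1)) ⊠ mk (wires 1) from by rw [← wires_par_wires 1 1]; exact (par_assoc' _ _ _).trans (cast_id _ _ _)]
  exact rg23 _

/-- Regrouping (bookkeeping): `(𝕀 ⊗ (σ ⊗ 𝕀)) ⊗ 𝕀 = (𝕀 ⊗ σ) ⊗ 𝕀²`. [folklore] -/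
private theorem rg_wsw : (mk (wires 1) ⊠ (mk swap ⊠ mk (wires 1))) ⊠ mk (wires 1) = (mk (wires 1) ⊠ mk swap) ⊠ mk (wires 2) := by
  rw [show mk (wires 1) ⊠ (mk swap ⊠ mk (wires 1)) = (mk (wires 1) ⊠ mk swap) ⊠ mk (wires 1) from (par_assoc' _ _ _).trans (cast_id _ _ _)]
  exact rg33 _

/-- Regrouping (bookkeeping): `(𝕀 ⊗ (𝕀 ⊗ σ)) ⊗ 𝕀 = 𝕀² ⊗ (σ ⊗ 𝕀)`. [folklore] -/
private theorem rg_wws : (mk (wires 1) ⊠ (mk (wires 1) ⊠ mk swap)) ⊠ mk (wires 1) = mk (wires 2) ⊠ (mk swap ⊠ mk (wires 1)) := by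
  rw [show mk (wires 1) ⊠ (mk (wires 1) ⊠ mk swap) = mk (wires 2) ⊠ mk swap from by rw [← wires_par_wires 1 1]; exact (par_assoc' _ _ _).trans (cast_id _ _ _)]
  exact (par_assoc _ _ _).trans (cast_id _ _ _)

/-- **The bialgebra square with a state inserted** (towards fig. `…-proof-fin_04`): for any two-legged state `S` inserted
between the two copies of the first input, the copy whose first copy merges (red) with the first leg of `S` and whose second
copy is capped against the second input equals `√2 ⊗` the state inserted between the inputs, its second leg routed past the
second input, and the square `square31` on (first input, first leg, second input).
[cite: JeandelPerdrixVilmart2018, Fig. 1 (B2), §2.2, proof of Appendix Lemma 34] -/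
theorem splitState_square (S : ZXClass 0 2) :
    (mk (Z 1 2 0) ⊠ mk (wires 1)) ⨟ (((mk (wires 1) ⊠ S) ⨟ (mk (X 2 1 0) ⊠ mk (wires 1))) ⊠ mk cap) =
      mk (dumbbell 0 0) ⊠ (((mk (wires 1) ⊠ S) ⊠ mk (wires 1)) ⨟ (mk (wires 2) ⊠ mk swap) ⨟ ((((mk (wires 1) ⊠ mk (Z 1 2 0)) ⊠ mk (wires 1)) ⨟ ((mk (X 2 1 0) ⊠ mk (wires 1)) ⊠ mk (wires 1)) ⨟ (mk (wires 1) ⊠ mk (X 2 1 0)) ⨟ mk (Z 2 1 0)) ⊠ mk (wires 1))) := by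
  -- the state may be inserted before the copy, the second copy being routed past it
  have hnat := fswap1_nat S
  rw [fswap1_zero, fswap1_two, id_seq] at hnat
  have hins : (mk (Z 1 2 0) ⊠ mk (wires 1)) ⨟ ((mk (wires 1) ⊠ S) ⊠ mk (wires 2)) = ((mk (wires 1) ⊠ S) ⊠ mk (wires 1)) ⨟ ((mk (Z 1 2 0) ⊠ mk (wires 2)) ⊠ mk (wires 1)) ⨟ ((mk (wires 1) ⊠ ((mk swap ⊠ mk (wires 1)) ⨟ (mk (wires 1) ⊠ mk swap))) ⊠ mk (wires 1)) := by
    rw [← wires_par_wires 1 1, show (mk (wires 1) ⊠ S) ⊠ (mk (wires 1) ⊠ mk (wires 1)) = (mk (wires 1) ⊠ (S ⊠ mk (wires 1))) ⊠ mk (wires 1) from by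
        rw [show mk (wires 1) ⊠ (S ⊠ mk (wires 1)) = (mk (wires 1) ⊠ S) ⊠ mk (wires 1) from (par_assoc' _ _ _).trans (cast_id _ _ _)]; exact (par_assoc' _ _ _).trans (cast_id _ _ _),
      hnat, wires_par_seq, seq_par_wires, ← seq_assoc, show mk (wires 1) ⊠ (mk (wires 1) ⊠ S) = mk (wires 2) ⊠ S from by rw [← wires_par_wires 1 1]; exact (par_assoc' _ _ _).trans (cast_id _ _ _),
      ← seq_par_wires (mk (Z 1 2 0)) (mk (wires 2) ⊠ S) 1, show mk (Z 1 2 0) ⨟ (mk (wires 2) ⊠ S) = (mk (wires 1) ⊠ S) ⨟ (mk (Z 1 2 0) ⊠ mk (wires 2)) from by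
        rw [← par_eq_seq_right (mk (Z 1 2 0)) S, par_eq_seq_left (mk (Z 1 2 0)) S, par_empty],
      seq_par_wires, wires_par_wires]
  -- the routing swaps regroup into a swap of the inputs and the swap of `square31`
  have hA : ∀ R : ZXClass 5 2, ((mk (wires 1) ⊠ (mk swap ⊠ mk (wires 1))) ⊠ mk (wires 1)) ⨟ ((mk (wires 3) ⊠ mk swap) ⨟ R) = (mk (wires 3) ⊠ mk swap) ⨟ ((((mk (wires 1) ⊠ mk swap) ⊠ mk (wires 1)) ⊠ mk (wires 1)) ⨟ R) := fun R => by
    rw [← seq_assoc, ← seq_assoc, rg_wsw, rg33, interchange, seq_id, id_seq, interchange, id_seq, seq_id]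
  have hB : ∀ R : ZXClass 5 2, ((mk (Z 1 2 0) ⊠ mk (wires 2)) ⊠ mk (wires 1)) ⨟ ((mk (wires 3) ⊠ mk swap) ⨟ R) = (mk (wires 2) ⊠ mk swap) ⨟ ((((mk (Z 1 2 0) ⊠ mk (wires 1)) ⊠ mk (wires 1)) ⊠ mk (wires 1)) ⨟ R) := fun R => by
    rw [← seq_assoc, ← seq_assoc, rg12, rg23, interchange, seq_id, id_seq, interchange, id_seq, seq_id]
  have hC : ((mk (wires 1) ⊠ (mk (wires 1) ⊠ mk swap)) ⊠ mk (wires 1)) ⨟ ((mk (X 2 1 0) ⊠ mk (wires 1)) ⊠ mk cap) = (mk (wires 3) ⊠ mk swap) ⨟ ((mk (X 2 1 0) ⊠ mk cap) ⊠ mk (wires 1)) := by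
    rw [rg_wws, show (mk (X 2 1 0) ⊠ mk (wires 1)) ⊠ mk cap = mk (X 2 1 0) ⊠ (mk (wires 1) ⊠ mk cap) from (par_assoc _ _ _).trans (cast_id _ _ _), interchange, id_seq,
      swap_par_seq_par_cap, show mk (X 2 1 0) ⊠ ((mk (wires 1) ⊠ mk swap) ⨟ (mk cap ⊠ mk (wires 1))) = (mk (wires 2) ⊠ (mk (wires 1) ⊠ mk swap)) ⨟ (mk (X 2 1 0) ⊠ (mk cap ⊠ mk (wires 1))) from by
        rw [interchange, id_seq],
      show mk (wires 2) ⊠ (mk (wires 1) ⊠ mk swap) = mk (wires 3) ⊠ mk swap from by rw [← wires_par_wires 2 1]; exact (par_assoc' _ _ _).trans (cast_id _ _ _),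
      show mk (X 2 1 0) ⊠ (mk cap ⊠ mk (wires 1)) = (mk (X 2 1 0) ⊠ mk cap) ⊠ mk (wires 1) from (par_assoc' _ _ _).trans (cast_id _ _ _)]
  have hperm : ((mk (Z 1 2 0) ⊠ mk (wires 2)) ⊠ mk (wires 1)) ⨟ ((mk (wires 1) ⊠ ((mk swap ⊠ mk (wires 1)) ⨟ (mk (wires 1) ⊠ mk swap))) ⊠ mk (wires 1)) ⨟ ((mk (X 2 1 0) ⊠ mk (wires 1)) ⊠ mk cap) =
      (mk (wires 2) ⊠ mk swap) ⨟ ((((mk (Z 1 2 0) ⊠ mk (wires 1)) ⊠ mk (wires 1)) ⨟ ((mk (wires 1) ⊠ mk swap) ⊠ mk (wires 1)) ⨟ (mk (X 2 1 0) ⊠ mk cap)) ⊠ mk (wires 1)) := by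
    rw [wires_par_seq, seq_par_wires, seq_assoc, seq_assoc, hC, hA, hB, ← seq_assoc (((mk (Z 1 2 0) ⊠ mk (wires 1)) ⊠ mk (wires 1)) ⊠ mk (wires 1)), ← seq_par_wires,
      ← seq_par_wires]
  rw [show ((mk (wires 1) ⊠ S) ⨟ (mk (X 2 1 0) ⊠ mk (wires 1))) ⊠ mk cap = ((mk (wires 1) ⊠ S) ⊠ mk (wires 2)) ⨟ ((mk (X 2 1 0) ⊠ mk (wires 1)) ⊠ mk cap) from by rw [interchange, id_seq],
    ← seq_assoc, hins, seq_assoc, seq_assoc, ← seq_assoc ((mk (Z 1 2 0) ⊠ mk (wires 2)) ⊠ mk (wires 1)), hperm, square31,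
    show ∀ (s : ZXClass 0 0) (A : ZXClass 3 1), (s ⊠ A) ⊠ mk (wires 1) = s ⊠ (A ⊠ mk (wires 1)) from fun s A => (par_assoc _ _ _).trans (cast_id _ _ _),
    show ∀ (s : ZXClass 0 0) (B : ZXClass 4 2), (mk (wires 2) ⊠ mk swap) ⨟ (s ⊠ B) = s ⊠ ((mk (wires 2) ⊠ mk swap) ⨟ B) from fun s B => by rw [scalar_par_seq_right, empty_par, cast_id],
    mvr_2_4_2, ← seq_assoc]

/-- **The square block of the main computation** (figs. `…-proof-fin_02–04`): the green copy of the first input whose first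
copy enters the re-rooted ladder `ρ` and whose second copy is capped against the (bridge side of the) second input equals
`√2 ⊗` the root state `G60(α)` inserted between the inputs, its second leg routed past the second input, the phase-free
layers of rule (C) (`square31`'s square) and the rest of `ρ`.
[cite: JeandelPerdrixVilmart2018, Fig. 1 (B2), proof of Appendix Lemma 34] -/
theorem block_square (a : ZMod 8) :
    (mk (Z 1 2 0) ⊠ mk (wires 1)) ⨟ ((mk (X 1 2 2) ⨟ (((mk (X 0 1 a) ⊠ mk (wires 1)) ⨟ mk (Z 2 1 0) ⨟ mk (X 1 1 a)) ⊠ (mk (Z 1 1 1) ⨟ mk (xLeafL 0 1) ⨟ (mk (Z 1 2 0) ⨟ (mk (wires 1) ⊠ (mk (X 1 2 0) ⨟ (mk (Z 1 0 (-1)) ⊠ mk (Z 1 0 (-1)))))))) ⨟ (((mk (Z 0 1 0) ⨟ mk triangle) ⊠ mk (wires 2)) ⨟ mk (Z 3 1 0))) ⊠ mk cap) =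
      mk (dumbbell 0 0) ⊠ (((mk (wires 1) ⊠ (mk (X 0 1 a) ⨟ mk (Z 1 2 0) ⨟ (mk (X 1 1 2) ⊠ mk (X 1 1 a)))) ⊠ mk (wires 1)) ⨟ (mk (wires 2) ⊠ mk swap) ⨟ ((((mk (wires 1) ⊠ mk (Z 1 2 0)) ⊠ mk (wires 1)) ⨟ ((mk (X 2 1 0) ⊠ mk (wires 1)) ⊠ mk (wires 1)) ⨟ (mk (wires 1) ⊠ mk (X 2 1 0)) ⨟ mk (Z 2 1 0)) ⊠ mk (wires 1))
        ⨟ (mk swap ⨟ (mk (wires 1) ⊠ (mk (Z 1 1 1) ⨟ mk (xLeafL 0 1) ⨟ (mk (Z 1 2 0) ⨟ (mk (wires 1) ⊠ (mk (X 1 2 0) ⨟ (mk (Z 1 0 (-1)) ⊠ mk (Z 1 0 (-1)))))))) ⨟ (((mk (Z 0 1 0) ⨟ mk triangle) ⊠ mk (wires 2)) ⨟ mk (Z 3 1 0)))) := by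
  rw [par_eq_seq_left ((mk (X 0 1 a) ⊠ mk (wires 1)) ⨟ mk (Z 2 1 0) ⨟ mk (X 1 1 a)) (mk (Z 1 1 1) ⨟ mk (xLeafL 0 1) ⨟ (mk (Z 1 2 0) ⨟ (mk (wires 1) ⊠ (mk (X 1 2 0) ⨟ (mk (Z 1 0 (-1)) ⊠ mk (Z 1 0 (-1))))))), ← seq_assoc (mk (X 1 2 2)), xsplit_two_seq_rootMerge_par, seq_assoc ((mk (wires 1) ⊠ (mk (X 0 1 a) ⨟ mk (Z 1 2 0) ⨟ (mk (X 1 1 2) ⊠ mk (X 1 1 a)))) ⨟ (mk (X 2 1 0) ⊠ mk (wires 1))) (mk swap), seq_assoc ((mk (wires 1) ⊠ (mk (X 0 1 a) ⨟ mk (Z 1 2 0) ⨟ (mk (X 1 1 2) ⊠ mk (X 1 1 a)))) ⨟ (mk (X 2 1 0) ⊠ mk (wires 1))),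
    show ∀ P : ZXClass 2 1, (((mk (wires 1) ⊠ (mk (X 0 1 a) ⨟ mk (Z 1 2 0) ⨟ (mk (X 1 1 2) ⊠ mk (X 1 1 a)))) ⨟ (mk (X 2 1 0) ⊠ mk (wires 1))) ⨟ P) ⊠ mk cap = (((mk (wires 1) ⊠ (mk (X 0 1 a) ⨟ mk (Z 1 2 0) ⨟ (mk (X 1 1 2) ⊠ mk (X 1 1 a)))) ⨟ (mk (X 2 1 0) ⊠ mk (wires 1))) ⊠ mk cap) ⨟ P from fun P => by
      rw [show (((mk (wires 1) ⊠ (mk (X 0 1 a) ⨟ mk (Z 1 2 0) ⨟ (mk (X 1 1 2) ⊠ mk (X 1 1 a)))) ⨟ (mk (X 2 1 0) ⊠ mk (wires 1))) ⊠ mk cap) ⨟ P = (((mk (wires 1) ⊠ (mk (X 0 1 a) ⨟ mk (Z 1 2 0) ⨟ (mk (X 1 1 2) ⊠ mk (X 1 1 a)))) ⨟ (mk (X 2 1 0) ⊠ mk (wires 1))) ⊠ mk cap) ⨟ (P ⊠ mk (wires 0)) from by rw [par_empty], interchange, seq_id],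
    ← seq_assoc, splitState_square, scalar_par_two_two_seq_one]

/-! ### Appendix Lemma 34, main computation: assembly -/

/-- Scalar mover (bookkeeping): `(s ⊗ A) ⨾ B = s ⊗ (A ⨾ B)` for `A : 1 → 3`, `B : 3 → 1`. [folklore] -/
private theorem mvl_1_3_1 (s : ZXClass 0 0) (A : ZXClass 1 3) (B : ZXClass 3 1) : (s ⊠ A) ⨟ B = s ⊠ (A ⨟ B) := by
  rw [scalar_par_seq_left, empty_par, cast_id]

/-- Scalar mover (bookkeeping): `A ⨾ (s ⊗ B) = s ⊗ (A ⨾ B)` for `A : 2 → 5`, `B : 5 → 3`. [folklore] -/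
private theorem mvr_2_5_3 (A : ZXClass 2 5) (s : ZXClass 0 0) (B : ZXClass 5 3) : A ⨟ (s ⊠ B) = s ⊠ (A ⨟ B) := by
  rw [scalar_par_seq_right, empty_par, cast_id]

/-- Scalar mover (bookkeeping): `A ⨾ (s ⊗ B) = s ⊗ (A ⨾ B)` for `A : 2 → 4`, `B : 4 → 3`. [folklore] -/
private theorem mvr_2_4_3 (A : ZXClass 2 4) (s : ZXClass 0 0) (B : ZXClass 4 3) : A ⨟ (s ⊠ B) = s ⊠ (A ⨟ B) := by
  rw [scalar_par_seq_right, empty_par, cast_id]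

/-- **The `α`-leaf and the `α`-phase of Appendix Lemma 34 are the plugged ladder** (fig. `…-proof-fin_00/01`, `ladderState_eq`
backwards): `(X^{(1,0)}(α) ⊗ 𝕀) ⨾ X(α) = √2 ⊗ ((Λ ⊗ 𝕀) ⨾ X^{(2,1)})`, `Λ` the ladder with its second output bent into its input.
[cite: JeandelPerdrixVilmart2018, Appendix, proof of Lemma 34 (figs. `…-proof-fin_00/01`), Lemma 5 (inverse rule)] -/
theorem alphaBlock_eq (a : ZMod 8) :
    (mk (X 1 0 a) ⊠ mk (wires 1)) ⨟ mk (X 1 1 a) = mk (dumbbell 0 0) ⊠ (((((((mk (Z 0 1 0) ⨟ mk triangle) ⊠ mk (X 0 1 a)) ⨟ (mk (wires 1) ⊠ mk (Z 1 2 0)) ⨟ ((mk (wires 1) ⊠ mk (X 1 1 a)) ⊠ mk (wires 1)) ⨟ (mk (Z 2 2 0) ⊠ mk (wires 1)) ⨟ ((mk (wires 1) ⊠ mk triangle) ⊠ mk (wires 1)) ⨟ (mk (wires 1) ⊠ mk (X 2 1 0)) ⨟ (mk (X 1 2 0) ⊠ mk (wires 1)) ⨟ (mk (wires 1) ⊠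 mk (Z 2 1 0))) ⊠ mk (wires 1)) ⨟ (mk (wires 1) ⊠ mk cap)) ⊠ mk (wires 1)) ⨟ mk (X 2 1 0)) := by
  symm
  rw [ladderState_eq, show ∀ (s : ZXClass 0 0) (P : ZXClass 0 2), (s ⊠ P) ⊠ mk (wires 1) = s ⊠ (P ⊠ mk (wires 1)) from fun s P => (par_assoc _ _ _).trans (cast_id _ _ _), mvl_1_3_1,
    show (mk (X 0 1 a) ⊠ mk (X 0 1 a)) ⊠ mk (wires 1) = mk (X 0 1 a) ⊠ (mk (X 0 1 a) ⊠ mk (wires 1)) from (par_assoc _ _ _).trans (cast_id _ _ _), interchange, seq_id, xstate_par_seq_cap,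
    show ∀ (s : ZXClass 0 0) (Q : ZXClass 1 1), (s ⊠ Q) ⊠ mk (wires 1) = s ⊠ (Q ⊠ mk (wires 1)) from fun s Q => (par_assoc _ _ _).trans (cast_id _ _ _), scalar_par_two_two_seq_one,
    scalar_par_scalar_par (mk (dumbbell 0 0)) (mk invSqrtTwo), invSqrtTwo_par_sqrt_two_par_cancel, cast_id,
    show mk (X 0 1 a) ⊠ mk (X 1 0 a) = mk (X 1 0 a) ⨟ mk (X 0 1 a) from by rw [par_eq_seq_right (mk (X 0 1 a)) (mk (X 1 0 a)), empty_par, cast_id, par_empty],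
    seq_par_wires, seq_assoc, X_par_seq_X 0 1 1 1 le_rfl, add_zero a]

/-- `keyB` without the `√2`: the plugged ladder is `½ ⊗ ρ`. [cite: JeandelPerdrixVilmart2018, Appendix, proof of Lemma 34] -/
theorem pluggedLadder_eq_half_rho (a : ZMod 8) :
    mk (Z 1 2 0) ⨟ ((((((mk (Z 0 1 0) ⨟ mk triangle) ⊠ mk (X 0 1 a)) ⨟ (mk (wires 1) ⊠ mk (Z 1 2 0)) ⨟ ((mk (wires 1) ⊠ mk (X 1 1 a)) ⊠ mk (wires 1)) ⨟ (mk (Z 2 2 0) ⊠ mk (wires 1)) ⨟ ((mk (wires 1) ⊠ mk triangle) ⊠ mk (wires 1)) ⨟ (mk (wires 1) ⊠ mk (X 2 1 0)) ⨟ (mk (X 1 2 0) ⊠ mk (wires 1)) ⨟ (mk (wires 1) ⊠ mk (Z 2 1 0))) ⊠ mk (wires 1)) ⨟ (mk (wires 1) ⊠ mk cap)) ⊠ mk (wires 1)) ⨟ mk (X 2 1 0) = mk invSqrtTwo ⊠ (mk invSqrtTwo ⊠ (mk (X 1 2 2) ⨟ (((mk (X 0 1 a) ⊠ mk (wires 1))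 ⨟ mk (Z 2 1 0) ⨟ mk (X 1 1 a)) ⊠ (mk (Z 1 1 1) ⨟ mk (xLeafL 0 1) ⨟ (mk (Z 1 2 0) ⨟ (mk (wires 1) ⊠ (mk (X 1 2 0) ⨟ (mk (Z 1 0 (-1)) ⊠ mk (Z 1 0 (-1)))))))) ⨟ (((mk (Z 0 1 0) ⨟ mk triangle) ⊠ mk (wires 2)) ⨟ mk (Z 3 1 0)))) := by
  have h := congrArg (mk invSqrtTwo ⊠ ·) (sqrt_two_par_pluggedLadder a)
  simp only [invSqrtTwo_par_sqrt_two_par_cancel, cast_id] at h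
  exact h

/-- **From the left-hand side of Appendix Lemma 34 to the re-rooted ladder** (figs. `…-proof-fin_00–02`): the `α`-leaf and
the `α`-phase become the plugged ladder, which is cut (Hopf) and re-rooted; the bridge's phase moves to the other side of the cap.
[cite: JeandelPerdrixVilmart2018, Appendix, proof of Lemma 34] -/
theorem L34side_eq_rho (a b t u : ZMod 8) :
    (mk (X 1 1 t) ⊠ mk (wires 1)) ⨟ (mk (Z 1 3 0) ⊠ mk (Z 1 2 b)) ⨟ (((mk (X 1 0 a) ⊠ mk (wires 1)) ⊠ ((mk (X 1 1 u) ⊠ mk (wires 1)) ⨟ mk cap)) ⊠ mk (wires 1)) ⨟ (mk (X 1 1 a) ⊠ mk (X 1 2 4)) ⨟ (mk (Z 2 1 0) ⊠ mk (Z 1 0 b)) =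
      mk invSqrtTwo ⊠ ((mk (X 1 1 t) ⊠ mk (wires 1)) ⨟ (mk (Z 1 2 0) ⊠ (mk (Z 1 2 b) ⨟ (mk (X 1 1 u) ⊠ mk (wires 1)))) ⨟ (((mk (X 1 2 2) ⨟ (((mk (X 0 1 a) ⊠ mk (wires 1)) ⨟ mk (Z 2 1 0) ⨟ mk (X 1 1 a)) ⊠ (mk (Z 1 1 1) ⨟ mk (xLeafL 0 1) ⨟ (mk (Z 1 2 0) ⨟ (mk (wires 1) ⊠ (mk (X 1 2 0) ⨟ (mk (Z 1 0 (-1)) ⊠ mk (Z 1 0 (-1)))))))) ⨟ (((mk (Z 0 1 0) ⨟ mk triangle) ⊠ mk (wires 2)) ⨟ mk (Z 3 1 0))) ⊠ mk cap) ⊠ mk (X 1 2 4)) ⨟ (mk (Z 2 1 0) ⊠ mk (Z 1 0 b))) := by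
  rw [seq_assoc _ (((mk (X 1 0 a) ⊠ mk (wires 1)) ⊠ ((mk (X 1 1 u) ⊠ mk (wires 1)) ⨟ mk cap)) ⊠ mk (wires 1)) (mk (X 1 1 a) ⊠ mk (X 1 2 4)),
    show (((mk (X 1 0 a) ⊠ mk (wires 1)) ⊠ ((mk (X 1 1 u) ⊠ mk (wires 1)) ⨟ mk cap)) ⊠ mk (wires 1)) ⨟ (mk (X 1 1 a) ⊠ mk (X 1 2 4)) = ((((mk (X 1 0 a) ⊠ mk (wires 1)) ⨟ mk (X 1 1 a)) ⊠ ((mk (X 1 1 u) ⊠ mk (wires 1)) ⨟ mk cap)) ⊠ mk (X 1 2 4)) from by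
      rw [interchange, id_seq, show ((mk (X 1 0 a) ⊠ mk (wires 1)) ⊠ ((mk (X 1 1 u) ⊠ mk (wires 1)) ⨟ mk cap)) ⨟ mk (X 1 1 a) = ((mk (X 1 0 a) ⊠ mk (wires 1)) ⊠ ((mk (X 1 1 u) ⊠ mk (wires 1)) ⨟ mk cap)) ⨟ (mk (X 1 1 a) ⊠ mk (wires 0)) from by rw [par_empty],
        interchange, seq_id],
    alphaBlock_eq, show ∀ (s : ZXClass 0 0) (M : ZXClass 2 1), (s ⊠ M) ⊠ ((mk (X 1 1 u) ⊠ mk (wires 1)) ⨟ mk cap) = s ⊠ (M ⊠ ((mk (X 1 1 u) ⊠ mk (wires 1)) ⨟ mk cap)) from fun s M => (par_assoc _ _ _).trans (cast_id _ _ _),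
    show ∀ (s : ZXClass 0 0) (M : ZXClass 4 1), (s ⊠ M) ⊠ mk (X 1 2 4) = s ⊠ (M ⊠ mk (X 1 2 4)) from fun s M => (par_assoc _ _ _).trans (cast_id _ _ _),
    mvr_2_5_3, mvl_2_3_1,
    show mk (Z 1 3 0) = mk (Z 1 2 0) ⨟ (mk (Z 1 2 0) ⊠ mk (wires 1)) from by rw [Z_seq_Z_par 1 1 1 2 le_rfl, add_zero],
    show (mk (Z 1 2 0) ⨟ (mk (Z 1 2 0) ⊠ mk (wires 1))) ⊠ mk (Z 1 2 b) = (mk (Z 1 2 0) ⊠ mk (Z 1 2 b)) ⨟ ((mk (Z 1 2 0) ⊠ mk (wires 1)) ⊠ mk (wires 2)) from by rw [interchange, seq_id],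
    ← seq_assoc (mk (X 1 1 t) ⊠ mk (wires 1)), seq_assoc _ ((mk (Z 1 2 0) ⊠ mk (wires 1)) ⊠ mk (wires 2)),
    show (mk (Z 1 2 0) ⊠ mk (wires 1)) ⊠ mk (wires 2) = mk (Z 1 2 0) ⊠ mk (wires 3) from by rw [← wires_par_wires 1 2]; exact (par_assoc _ _ _).trans (cast_id _ _ _),
    show ((((((((mk (Z 0 1 0) ⨟ mk triangle) ⊠ mk (X 0 1 a)) ⨟ (mk (wires 1) ⊠ mk (Z 1 2 0)) ⨟ ((mk (wires 1) ⊠ mk (X 1 1 a)) ⊠ mk (wires 1)) ⨟ (mk (Z 2 2 0) ⊠ mk (wires 1)) ⨟ ((mk (wires 1) ⊠ mk triangle) ⊠ mk (wires 1)) ⨟ (mk (wires 1) ⊠ mk (X 2 1 0)) ⨟ (mk (X 1 2 0) ⊠ mk (wires 1)) ⨟ (mk (wires 1) ⊠ mk (Z 2 1 0))) ⊠ mk (wires 1)) ⨟ (mk (wires 1) ⊠ mk cap)) ⊠ mk (wires 1)) ⨟ mk (X 2 1 0)) ⊠ ((mk (X 1 1 u) ⊠ mk (wires 1)) ⨟ mk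 cap)) ⊠ mk (X 1 2 4) = (((((((mk (Z 0 1 0) ⨟ mk triangle) ⊠ mk (X 0 1 a)) ⨟ (mk (wires 1) ⊠ mk (Z 1 2 0)) ⨟ ((mk (wires 1) ⊠ mk (X 1 1 a)) ⊠ mk (wires 1)) ⨟ (mk (Z 2 2 0) ⊠ mk (wires 1)) ⨟ ((mk (wires 1) ⊠ mk triangle) ⊠ mk (wires 1)) ⨟ (mk (wires 1) ⊠ mk (X 2 1 0)) ⨟ (mk (X 1 2 0) ⊠ mk (wires 1)) ⨟ (mk (wires 1) ⊠ mk (Z 2 1 0))) ⊠ mk (wires 1)) ⨟ (mk (wires 1) ⊠ mk cap)) ⊠ mk (wires 1)) ⨟ mk (X 2 1 0)) ⊠ (((mk (X 1 1 u) ⊠ mk (wires 1)) ⨟ mk cap) ⊠ mk (X 1 2 4)) from (par_assoc _ _ _).trans (cast_id _ _ _),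
    interchange (mk (Z 1 2 0)) (((((((mk (Z 0 1 0) ⨟ mk triangle) ⊠ mk (X 0 1 a)) ⨟ (mk (wires 1) ⊠ mk (Z 1 2 0)) ⨟ ((mk (wires 1) ⊠ mk (X 1 1 a)) ⊠ mk (wires 1)) ⨟ (mk (Z 2 2 0) ⊠ mk (wires 1)) ⨟ ((mk (wires 1) ⊠ mk triangle) ⊠ mk (wires 1)) ⨟ (mk (wires 1) ⊠ mk (X 2 1 0)) ⨟ (mk (X 1 2 0) ⊠ mk (wires 1)) ⨟ (mk (wires 1) ⊠ mk (Z 2 1 0))) ⊠ mk (wires 1)) ⨟ (mk (wires 1) ⊠ mk cap)) ⊠ mk (wires 1)) ⨟ mk (X 2 1 0)) (mk (wires 3)) (((mk (X 1 1 u) ⊠ mk (wires 1)) ⨟ mk cap) ⊠ mk (X 1 2 4)), id_seq, ← seq_assoc (mk (Z 1 2 0)) ((((((mk (Z 0 1 0) ⨟ mk triangle) ⊠ mk (X 0 1 a)) ⨟ (mk (wires 1) ⊠ mk (Z 1 2 0)) ⨟ ((mk (wires 1) ⊠ mk (X 1 1 a)) ⊠ mk (wires 1)) ⨟ (mk (Z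 2 2 0) ⊠ mk (wires 1)) ⨟ ((mk (wires 1) ⊠ mk triangle) ⊠ mk (wires 1)) ⨟ (mk (wires 1) ⊠ mk (X 2 1 0)) ⨟ (mk (X 1 2 0) ⊠ mk (wires 1)) ⨟ (mk (wires 1) ⊠ mk (Z 2 1 0))) ⊠ mk (wires 1)) ⨟ (mk (wires 1) ⊠ mk cap)) ⊠ mk (wires 1)) (mk (X 2 1 0)), pluggedLadder_eq_half_rho,
    show ∀ (s : ZXClass 0 0) (D : ZXClass 3 2), (s ⊠ (s ⊠ (mk (X 1 2 2) ⨟ (((mk (X 0 1 a) ⊠ mk (wires 1)) ⨟ mk (Z 2 1 0) ⨟ mk (X 1 1 a)) ⊠ (mk (Z 1 1 1) ⨟ mk (xLeafL 0 1) ⨟ (mk (Z 1 2 0) ⨟ (mk (wires 1) ⊠ (mk (X 1 2 0) ⨟ (mk (Z 1 0 (-1)) ⊠ mk (Z 1 0 (-1)))))))) ⨟ (((mk (Z 0 1 0) ⨟ mk triangle) ⊠ mk (wires 2)) ⨟ mk (Z 3 1 0))))) ⊠ D = s ⊠ (s ⊠ ((mk (X 1 2 2) ⨟ (((mk (X 0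 1 a) ⊠ mk (wires 1)) ⨟ mk (Z 2 1 0) ⨟ mk (X 1 1 a)) ⊠ (mk (Z 1 1 1) ⨟ mk (xLeafL 0 1) ⨟ (mk (Z 1 2 0) ⨟ (mk (wires 1) ⊠ (mk (X 1 2 0) ⨟ (mk (Z 1 0 (-1)) ⊠ mk (Z 1 0 (-1)))))))) ⨟ (((mk (Z 0 1 0) ⨟ mk triangle) ⊠ mk (wires 2)) ⨟ mk (Z 3 1 0))) ⊠ D)) from fun s D =>
      (par_assoc _ _ _).trans ((cast_id _ _ _).trans (congrArg _ ((par_assoc _ _ _).trans (cast_id _ _ _)))),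
    mvr_2_4_3, mvr_2_4_3, mvl_2_3_1, mvl_2_3_1, scalar_par_scalar_par (mk (dumbbell 0 0)) (mk invSqrtTwo), invSqrtTwo_par_sqrt_two_par_cancel, cast_id,
    ← par_xphase_seq_cap, show ((mk (wires 1) ⊠ mk (X 1 1 u)) ⨟ mk cap) ⊠ mk (X 1 2 4) = ((mk (wires 1) ⊠ mk (X 1 1 u)) ⊠ mk (wires 1)) ⨟ (mk cap ⊠ mk (X 1 2 4)) from by rw [interchange, id_seq],
    show (mk (X 1 2 2) ⨟ (((mk (X 0 1 a) ⊠ mk (wires 1)) ⨟ mk (Z 2 1 0) ⨟ mk (X 1 1 a)) ⊠ (mk (Z 1 1 1) ⨟ mk (xLeafL 0 1) ⨟ (mk (Z 1 2 0) ⨟ (mk (wires 1) ⊠ (mk (X 1 2 0) ⨟ (mk (Z 1 0 (-1)) ⊠ mk (Z 1 0 (-1)))))))) ⨟ (((mk (Z 0 1 0) ⨟ mk triangle) ⊠ mk (wires 2)) ⨟ mk (Z 3 1 0))) ⊠ (((mk (wires 1) ⊠ mk (X 1 1 u)) ⊠ mk (wires 1)) ⨟ (mk cap ⊠ mk (X 1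 2 4))) = (mk (wires 1) ⊠ ((mk (wires 1) ⊠ mk (X 1 1 u)) ⊠ mk (wires 1))) ⨟ ((mk (X 1 2 2) ⨟ (((mk (X 0 1 a) ⊠ mk (wires 1)) ⨟ mk (Z 2 1 0) ⨟ mk (X 1 1 a)) ⊠ (mk (Z 1 1 1) ⨟ mk (xLeafL 0 1) ⨟ (mk (Z 1 2 0) ⨟ (mk (wires 1) ⊠ (mk (X 1 2 0) ⨟ (mk (Z 1 0 (-1)) ⊠ mk (Z 1 0 (-1)))))))) ⨟ (((mk (Z 0 1 0) ⨟ mk triangle) ⊠ mk (wires 2)) ⨟ mk (Z 3 1 0))) ⊠ (mk cap ⊠ mk (X 1 2 4))) from by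
      symm; rw [interchange, id_seq],
    show (mk (X 1 2 2) ⨟ (((mk (X 0 1 a) ⊠ mk (wires 1)) ⨟ mk (Z 2 1 0) ⨟ mk (X 1 1 a)) ⊠ (mk (Z 1 1 1) ⨟ mk (xLeafL 0 1) ⨟ (mk (Z 1 2 0) ⨟ (mk (wires 1) ⊠ (mk (X 1 2 0) ⨟ (mk (Z 1 0 (-1)) ⊠ mk (Z 1 0 (-1)))))))) ⨟ (((mk (Z 0 1 0) ⨟ mk triangle) ⊠ mk (wires 2)) ⨟ mk (Z 3 1 0))) ⊠ (mk cap ⊠ mk (X 1 2 4)) = ((mk (X 1 2 2) ⨟ (((mk (X 0 1 a) ⊠ mk (wires 1)) ⨟ mk (Z 2 1 0) ⨟ mk (X 1 1 a)) ⊠ (mk (Z 1 1 1) ⨟ mk (xLeafL 0 1) ⨟ (mk (Z 1 2 0) ⨟ (mk (wires 1) ⊠ (mk (X 1 2 0) ⨟ (mk (Z 1 0 (-1)) ⊠ mk (Z 1 0 (-1)))))))) ⨟ (((mk (Z 0 1 0) ⨟ mk triangle) ⊠ mk (wires 2)) ⨟ mk (Z 3 1 0))) ⊠ mk cap) ⊠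 mk (X 1 2 4) from (par_assoc' _ _ _).trans (cast_id _ _ _),
    ← seq_assoc _ (mk (wires 1) ⊠ ((mk (wires 1) ⊠ mk (X 1 1 u)) ⊠ mk (wires 1))), seq_assoc _ (mk (Z 1 2 0) ⊠ mk (Z 1 2 b)) (mk (wires 1) ⊠ ((mk (wires 1) ⊠ mk (X 1 1 u)) ⊠ mk (wires 1))),
    show mk (wires 1) ⊠ ((mk (wires 1) ⊠ mk (X 1 1 u)) ⊠ mk (wires 1)) = mk (wires 2) ⊠ (mk (X 1 1 u) ⊠ mk (wires 1)) from by
      rw [show (mk (wires 1) ⊠ mk (X 1 1 u)) ⊠ mk (wires 1) = mk (wires 1) ⊠ (mk (X 1 1 u) ⊠ mk (wires 1)) from (par_assoc _ _ _).trans (cast_id _ _ _), ← wires_par_wires 1 1]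
      exact (par_assoc' _ _ _).trans (cast_id _ _ _),
    show (mk (Z 1 2 0) ⊠ mk (Z 1 2 b)) ⨟ (mk (wires 2) ⊠ (mk (X 1 1 u) ⊠ mk (wires 1))) = mk (Z 1 2 0) ⊠ (mk (Z 1 2 b) ⨟ (mk (X 1 1 u) ⊠ mk (wires 1))) from by rw [interchange, seq_id]]

/-- Scalar mover (bookkeeping): `A ⨾ (s ⊗ B) = s ⊗ (A ⨾ B)` for `A : 2 → 3`, `B : 3 → 3`. [folklore] -/
private theorem mvr_2_3_3 (A : ZXClass 2 3) (s : ZXClass 0 0) (B : ZXClass 3 3) : A ⨟ (s ⊠ B) = s ⊠ (A ⨟ B) := by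
  rw [scalar_par_seq_right, empty_par, cast_id]

/-- Regrouping (bookkeeping): `(A ⊗ 𝕀) ⊗ 𝕀 = A ⊗ 𝕀²` for `A : 1 → 3`. [folklore] -/
private theorem rg13 (A : ZXClass 1 3) : (A ⊠ mk (wires 1)) ⊠ mk (wires 1) = A ⊠ mk (wires 2) := by
  rw [← wires_par_wires 1 1]; exact (par_assoc _ _ _).trans (cast_id _ _ _)

/-- **Towards fig. `…-proof-fin_04`: the left-hand side of Appendix Lemma 34 after the square**, regrouped as a common prefix
(the input phases, the root state `G60(α)` inserted and its second leg routed past the bridge input), the phase-free layers of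
rule (C), and a tail (the rest of `ρ`, the leaf of the second input, the final merges).
[cite: JeandelPerdrixVilmart2018, Appendix, proof of Lemma 34] -/
theorem L34side_eq_TL (a b t u : ZMod 8) :
    (mk (X 1 1 t) ⊠ mk (wires 1)) ⨟ (mk (Z 1 3 0) ⊠ mk (Z 1 2 b)) ⨟ (((mk (X 1 0 a) ⊠ mk (wires 1)) ⊠ ((mk (X 1 1 u) ⊠ mk (wires 1)) ⨟ mk cap)) ⊠ mk (wires 1)) ⨟ (mk (X 1 1 a) ⊠ mk (X 1 2 4)) ⨟ (mk (Z 2 1 0) ⊠ mk (Z 1 0 b)) =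
      mk invSqrtTwo ⊠ (mk (dumbbell 0 0) ⊠ (((mk (X 1 1 t) ⊠ (mk (Z 1 2 b) ⨟ (mk (X 1 1 u) ⊠ mk (wires 1)))) ⨟ ((mk (wires 1) ⊠ (mk (X 0 1 a) ⨟ mk (Z 1 2 0) ⨟ (mk (X 1 1 2) ⊠ mk (X 1 1 a)))) ⊠ mk (wires 2)) ⨟ ((mk (wires 2) ⊠ mk swap) ⊠ mk (wires 1))) ⨟ (((((mk (wires 1) ⊠ mk (Z 1 2 0)) ⊠ mk (wires 1)) ⨟ ((mk (X 2 1 0) ⊠ mk (wires 1)) ⊠ mk (wires 1)) ⨟ (mk (wires 1) ⊠ mk (X 2 1 0)) ⨟ mk (Z 2 1 0)) ⊠ mk (wires 1)) ⊠ mk (wires 1)) ⨟ ((mk swap ⊠ mk (wires 1)) ⨟ ((mk (wires 1) ⊠ (mk (Z 1 1 1) ⨟ mk (xLeafL 0 1) ⨟ (mk (Z 1 2 0) ⨟ (mk (wires 1) ⊠ (mk (X 1 2 0) ⨟ (mk (Z 1 0 (-1)) ⊠ mk (Z 1 0 (-1)))))))) ⊠ mk (wires 1)) ⨟ ((((mk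 (Z 0 1 0) ⨟ mk triangle) ⊠ mk (wires 2)) ⨟ mk (Z 3 1 0)) ⊠ mk (X 1 2 4)) ⨟ (mk (Z 2 1 0) ⊠ mk (Z 1 0 b))))) := by
  rw [L34side_eq_rho]
  congr 1
  rw [par_eq_seq_right (mk (Z 1 2 0)) (mk (Z 1 2 b) ⨟ (mk (X 1 1 u) ⊠ mk (wires 1))), ← seq_assoc (mk (X 1 1 t) ⊠ mk (wires 1)) (mk (wires 1) ⊠ (mk (Z 1 2 b) ⨟ (mk (X 1 1 u) ⊠ mk (wires 1)))) (mk (Z 1 2 0) ⊠ mk (wires 2)), seq_assoc _ (mk (Z 1 2 0) ⊠ mk (wires 2)) (((mk (X 1 2 2) ⨟ (((mk (X 0 1 a) ⊠ mk (wires 1)) ⨟ mk (Z 2 1 0) ⨟ mk (X 1 1 a)) ⊠ (mk (Z 1 1 1) ⨟ mk (xLeafL 0 1) ⨟ (mk (Z 1 2 0) ⨟ (mk (wires 1) ⊠ (mk (X 1 2 0) ⨟ (mk (Z 1 0 (-1)) ⊠ mk (Z 1 0 (-1)))))))) ⨟ (((mk (Z 0 1 0) ⨟ mk triangle) ⊠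 mk (wires 2)) ⨟ mk (Z 3 1 0))) ⊠ mk cap) ⊠ mk (X 1 2 4)),
    show (mk (Z 1 2 0) ⊠ mk (wires 2)) ⨟ (((mk (X 1 2 2) ⨟ (((mk (X 0 1 a) ⊠ mk (wires 1)) ⨟ mk (Z 2 1 0) ⨟ mk (X 1 1 a)) ⊠ (mk (Z 1 1 1) ⨟ mk (xLeafL 0 1) ⨟ (mk (Z 1 2 0) ⨟ (mk (wires 1) ⊠ (mk (X 1 2 0) ⨟ (mk (Z 1 0 (-1)) ⊠ mk (Z 1 0 (-1)))))))) ⨟ (((mk (Z 0 1 0) ⨟ mk triangle) ⊠ mk (wires 2)) ⨟ mk (Z 3 1 0))) ⊠ mk cap) ⊠ mk (X 1 2 4)) = ((mk (Z 1 2 0) ⊠ mk (wires 1)) ⨟ ((mk (X 1 2 2) ⨟ (((mk (X 0 1 a) ⊠ mk (wires 1)) ⨟ mk (Z 2 1 0) ⨟ mk (X 1 1 a)) ⊠ (mk (Z 1 1 1) ⨟ mk (xLeafL 0 1) ⨟ (mk (Z 1 2 0) ⨟ (mk (wires 1) ⊠ (mk (X 1 2 0) ⨟ (mk (Z 1 0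 (-1)) ⊠ mk (Z 1 0 (-1)))))))) ⨟ (((mk (Z 0 1 0) ⨟ mk triangle) ⊠ mk (wires 2)) ⨟ mk (Z 3 1 0))) ⊠ mk cap)) ⊠ mk (X 1 2 4) from by
      rw [show mk (Z 1 2 0) ⊠ mk (wires 2) = (mk (Z 1 2 0) ⊠ mk (wires 1)) ⊠ mk (wires 1) from by rw [← wires_par_wires 1 1]; exact (par_assoc' _ _ _).trans (cast_id _ _ _), interchange, id_seq],
    block_square, show ∀ (s : ZXClass 0 0) (A : ZXClass 2 1), (s ⊠ A) ⊠ mk (X 1 2 4) = s ⊠ (A ⊠ mk (X 1 2 4)) from fun s A => (par_assoc _ _ _).trans (cast_id _ _ _),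
    mvr_2_3_3, mvl_2_3_1]
  congr 1
  rw [show (mk (X 1 1 t) ⊠ mk (wires 1)) ⨟ (mk (wires 1) ⊠ (mk (Z 1 2 b) ⨟ (mk (X 1 1 u) ⊠ mk (wires 1)))) = mk (X 1 1 t) ⊠ (mk (Z 1 2 b) ⨟ (mk (X 1 1 u) ⊠ mk (wires 1))) from by rw [interchange, id_seq, seq_id],
    par_eq_seq_left (((mk (wires 1) ⊠ (mk (X 0 1 a) ⨟ mk (Z 1 2 0) ⨟ (mk (X 1 1 2) ⊠ mk (X 1 1 a)))) ⊠ mk (wires 1)) ⨟ (mk (wires 2) ⊠ mk swap) ⨟ ((((mk (wires 1) ⊠ mk (Z 1 2 0)) ⊠ mk (wires 1)) ⨟ ((mk (X 2 1 0) ⊠ mk (wires 1)) ⊠ mk (wires 1)) ⨟ (mk (wires 1) ⊠ mk (X 2 1 0)) ⨟ mk (Z 2 1 0)) ⊠ mk (wires 1)) ⨟ (mk swap ⨟ (mk (wires 1) ⊠ (mk (Z 1 1 1) ⨟ mk (xLeafL 0 1) ⨟ (mk (Z 1 2 0) ⨟ (mk (wires 1) ⊠ (mk (X 1 2 0) ⨟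 (mk (Z 1 0 (-1)) ⊠ mk (Z 1 0 (-1)))))))) ⨟ (((mk (Z 0 1 0) ⨟ mk triangle) ⊠ mk (wires 2)) ⨟ mk (Z 3 1 0)))) (mk (X 1 2 4)), seq_par_wires (((mk (wires 1) ⊠ (mk (X 0 1 a) ⨟ mk (Z 1 2 0) ⨟ (mk (X 1 1 2) ⊠ mk (X 1 1 a)))) ⊠ mk (wires 1)) ⨟ (mk (wires 2) ⊠ mk swap) ⨟ ((((mk (wires 1) ⊠ mk (Z 1 2 0)) ⊠ mk (wires 1)) ⨟ ((mk (X 2 1 0) ⊠ mk (wires 1)) ⊠ mk (wires 1)) ⨟ (mk (wires 1) ⊠ mk (X 2 1 0)) ⨟ mk (Z 2 1 0)) ⊠ mk (wires 1))) (mk swap ⨟ (mk (wires 1) ⊠ (mk (Z 1 1 1) ⨟ mk (xLeafL 0 1) ⨟ (mk (Z 1 2 0) ⨟ (mk (wires 1) ⊠ (mk (X 1 2 0) ⨟ (mk (Z 1 0 (-1)) ⊠ mk (Z 1 0 (-1)))))))) ⨟ (((mk (Z 0 1 0) ⨟ mk triangle) ⊠ mk (wires 2)) ⨟ mk (Z 3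 1 0))) 1, seq_par_wires (((mk (wires 1) ⊠ (mk (X 0 1 a) ⨟ mk (Z 1 2 0) ⨟ (mk (X 1 1 2) ⊠ mk (X 1 1 a)))) ⊠ mk (wires 1)) ⨟ (mk (wires 2) ⊠ mk swap)) ((((mk (wires 1) ⊠ mk (Z 1 2 0)) ⊠ mk (wires 1)) ⨟ ((mk (X 2 1 0) ⊠ mk (wires 1)) ⊠ mk (wires 1)) ⨟ (mk (wires 1) ⊠ mk (X 2 1 0)) ⨟ mk (Z 2 1 0)) ⊠ mk (wires 1)) 1, seq_par_wires ((mk (wires 1) ⊠ (mk (X 0 1 a) ⨟ mk (Z 1 2 0) ⨟ (mk (X 1 1 2) ⊠ mk (X 1 1 a)))) ⊠ mk (wires 1)) (mk (wires 2) ⊠ mk swap) 1,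
    seq_par_wires (mk swap ⨟ (mk (wires 1) ⊠ (mk (Z 1 1 1) ⨟ mk (xLeafL 0 1) ⨟ (mk (Z 1 2 0) ⨟ (mk (wires 1) ⊠ (mk (X 1 2 0) ⨟ (mk (Z 1 0 (-1)) ⊠ mk (Z 1 0 (-1))))))))) (((mk (Z 0 1 0) ⨟ mk triangle) ⊠ mk (wires 2)) ⨟ mk (Z 3 1 0)) 1, seq_par_wires (mk swap) (mk (wires 1) ⊠ (mk (Z 1 1 1) ⨟ mk (xLeafL 0 1) ⨟ (mk (Z 1 2 0) ⨟ (mk (wires 1) ⊠ (mk (X 1 2 0) ⨟ (mk (Z 1 0 (-1)) ⊠ mk (Z 1 0 (-1)))))))) 1, rg13]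
  simp only [seq_assoc]
  rw [show ∀ Rr : ZXClass 3 1, ((((mk (Z 0 1 0) ⨟ mk triangle) ⊠ mk (wires 2)) ⨟ mk (Z 3 1 0)) ⊠ mk (wires 1)) ⨟ ((mk (wires 1) ⊠ mk (X 1 2 4)) ⨟ Rr) = ((((mk (Z 0 1 0) ⨟ mk triangle) ⊠ mk (wires 2)) ⨟ mk (Z 3 1 0)) ⊠ mk (X 1 2 4)) ⨟ Rr from fun Rr => by rw [← seq_assoc, interchange, seq_id, id_seq]]

/-! ### Appendix Lemma 34, main computation: the final merges (figs. `…-proof-fin_03/04`) -/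

/-- A state merged (green) into a wire from the left is the state merged from the right. [cite: JeandelPerdrixVilmart2018, §2.2] -/
theorem state_par_seq_merge_symm (s : ZXClass 0 1) : (s ⊠ mk (wires 1)) ⨟ mk (Z 2 1 0) = (mk (wires 1) ⊠ s) ⨟ mk (Z 2 1 0) := by
  rw [← state_par_seq_swap s (mk (wires 1)), seq_assoc, swap_seq_Z]

/-- Merging a state into the first input of a merge is merging it into the output. [cite: JeandelPerdrixVilmart2018, Fig. 1 (S1)] -/
theorem mergeState_par_seq_merge (s : ZXClass 0 1) : (((mk (wires 1) ⊠ s) ⨟ mk (Z 2 1 0)) ⊠ mk (wires 1)) ⨟ mk (Z 2 1 0) = mk (Z 2 1 0) ⨟ ((mk (wires 1) ⊠ s) ⨟ mk (Z 2 1 0)) := by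
  rw [seq_par_wires, seq_assoc, Z_par_seq_Z 2 1 1 1 le_rfl, add_zero (0 : ZMod 8), show mk (Z (2 + 1) 1 0) = (mk (wires 1) ⊠ mk (Z 2 1 0)) ⨟ mk (Z 2 1 0) from by
      rw [par_Z_seq_Z 1 2 1 1 le_rfl, add_zero],
    ← seq_assoc, show (mk (wires 1) ⊠ s) ⊠ mk (wires 1) = mk (wires 1) ⊠ (s ⊠ mk (wires 1)) from (par_assoc _ _ _).trans (cast_id _ _ _), ← wires_par_seq, state_par_seq_merge_symm,
    wires_par_seq, seq_assoc, par_Z_seq_Z 1 2 1 1 le_rfl, add_zero (0 : ZMod 8), show mk (Z (1 + 2) 1 0) = (mk (Z 2 1 0) ⊠ mk (wires 1)) ⨟ mk (Z 2 1 0) from by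
      rw [Z_par_seq_Z 2 1 1 1 le_rfl, add_zero],
    ← seq_assoc, show mk (wires 1) ⊠ (mk (wires 1) ⊠ s) = mk (wires 2) ⊠ s from by rw [← wires_par_wires 1 1]; exact (par_assoc' _ _ _).trans (cast_id _ _ _),
    show (mk (wires 2) ⊠ s) ⨟ (mk (Z 2 1 0) ⊠ mk (wires 1)) = mk (Z 2 1 0) ⨟ (mk (wires 1) ⊠ s) from by rw [interchange, id_seq, seq_id, par_eq_seq_left (mk (Z 2 1 0)) s, par_empty], seq_assoc]

/-- Two states merged one after the other into a wire are the two states merged at once.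
[cite: JeandelPerdrixVilmart2018, Fig. 1 (S1)] -/
theorem mergeState_seq_mergeState (s₁ s₂ : ZXClass 0 1) : ((mk (wires 1) ⊠ s₁) ⨟ mk (Z 2 1 0)) ⨟ ((mk (wires 1) ⊠ s₂) ⨟ mk (Z 2 1 0)) = (mk (wires 1) ⊠ (s₁ ⊠ s₂)) ⨟ mk (Z 3 1 0) := by
  rw [← seq_assoc, seq_assoc (mk (wires 1) ⊠ s₁), show mk (Z 2 1 0) ⨟ (mk (wires 1) ⊠ s₂) = (mk (wires 2) ⊠ s₂) ⨟ (mk (Z 2 1 0) ⊠ mk (wires 1)) from by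
      rw [← par_eq_seq_right (mk (Z 2 1 0)) s₂, par_eq_seq_left (mk (Z 2 1 0)) s₂, par_empty],
    ← seq_assoc (mk (wires 1) ⊠ s₁), ← wires_par_wires 1 1, show (mk (wires 1) ⊠ mk (wires 1)) ⊠ s₂ = mk (wires 1) ⊠ (mk (wires 1) ⊠ s₂) from (par_assoc _ _ _).trans (cast_id _ _ _), ← wires_par_seq,
    show s₁ ⨟ (mk (wires 1) ⊠ s₂) = s₁ ⊠ s₂ from by rw [par_eq_seq_left s₁ s₂, par_empty], seq_assoc, Z_par_seq_Z 2 1 1 1 le_rfl, add_zero (0 : ZMod 8)]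

/-- The three-to-one spider absorbs a swap of its last two inputs. [cite: JeandelPerdrixVilmart2018, Fig. 1 (S1)] -/
theorem par_swap_seq_Z_three_one : (mk (wires 1) ⊠ mk swap) ⨟ mk (Z 3 1 0) = mk (Z 3 1 0) := by
  rw [show mk (Z 3 1 0) = (mk (wires 1) ⊠ mk (Z 2 1 0)) ⨟ mk (Z 2 1 0) from by rw [par_Z_seq_Z 1 2 1 1 le_rfl, add_zero], ← seq_assoc, ← wires_par_seq, swap_seq_Z]

/-- Merged states commute. [cite: JeandelPerdrixVilmart2018, Fig. 1 (S1)] -/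
theorem mergeState_comm (s₁ s₂ : ZXClass 0 1) : ((mk (wires 1) ⊠ s₁) ⨟ mk (Z 2 1 0)) ⨟ ((mk (wires 1) ⊠ s₂) ⨟ mk (Z 2 1 0)) = ((mk (wires 1) ⊠ s₂) ⨟ mk (Z 2 1 0)) ⨟ ((mk (wires 1) ⊠ s₁) ⨟ mk (Z 2 1 0)) := by
  rw [mergeState_seq_mergeState, mergeState_seq_mergeState, ← hb_states_seq_swap s₂ s₁, wires_par_seq, seq_assoc, par_swap_seq_Z_three_one]

/-- **The final merges of the two sides of the main computation agree** (figs. `…-proof-fin_03/04`): merging `s₂` into the first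
wire, then `s₁` and the second wire (three-legged), then the third wire, equals exchanging the last two wires, merging the
first two, then merging the result with the last wire and the two states (four-legged).
[cite: JeandelPerdrixVilmart2018, Fig. 1 (S1), §2.2 (only topology matters)] -/
theorem mergeStates_perm (s₁ s₂ : ZXClass 0 1) :
    (((((mk (wires 1) ⊠ s₂) ⨟ mk (Z 2 1 0)) ⊠ mk (wires 1)) ⨟ ((s₁ ⊠ mk (wires 2)) ⨟ mk (Z 3 1 0))) ⊠ mk (wires 1)) ⨟ mk (Z 2 1 0) =
      (mk (wires 1) ⊠ mk swap) ⨟ (mk (Z 2 1 0) ⊠ mk (wires 1)) ⨟ ((((mk (wires 1) ⊠ mk (wires 1)) ⊠ s₁) ⊠ s₂) ⨟ mk (Z 4 1 0)) := by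
  -- left: `Z^{(3,1)} ⨾ M(s₂) ⨾ M(s₁)`
  have hL1 : (s₁ ⊠ mk (wires 2)) ⨟ mk (Z 3 1 0) = mk (Z 2 1 0) ⨟ ((mk (wires 1) ⊠ s₁) ⨟ mk (Z 2 1 0)) := by
    rw [show mk (Z 3 1 0) = (mk (wires 1) ⊠ mk (Z 2 1 0)) ⨟ mk (Z 2 1 0) from by rw [par_Z_seq_Z 1 2 1 1 le_rfl, add_zero], ← seq_assoc, interchange, seq_id, id_seq,
      show s₁ ⊠ mk (Z 2 1 0) = mk (Z 2 1 0) ⨟ (s₁ ⊠ mk (wires 1)) from by rw [par_eq_seq_right s₁ (mk (Z 2 1 0)), empty_par, cast_id], seq_assoc, state_par_seq_merge_symm]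
  have hL : (((((mk (wires 1) ⊠ s₂) ⨟ mk (Z 2 1 0)) ⊠ mk (wires 1)) ⨟ ((s₁ ⊠ mk (wires 2)) ⨟ mk (Z 3 1 0))) ⊠ mk (wires 1)) ⨟ mk (Z 2 1 0) = mk (Z 3 1 0) ⨟ ((mk (wires 1) ⊠ s₂) ⨟ mk (Z 2 1 0)) ⨟ ((mk (wires 1) ⊠ s₁) ⨟ mk (Z 2 1 0)) := by
    rw [hL1, ← seq_assoc (((mk (wires 1) ⊠ s₂) ⨟ mk (Z 2 1 0)) ⊠ mk (wires 1)) (mk (Z 2 1 0)) ((mk (wires 1) ⊠ s₁) ⨟ mk (Z 2 1 0)), mergeState_par_seq_merge, seq_par_wires (mk (Z 2 1 0) ⨟ ((mk (wires 1) ⊠ s₂) ⨟ mk (Z 2 1 0))) ((mk (wires 1) ⊠ s₁) ⨟ mk (Z 2 1 0)) 1,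
      seq_par_wires (mk (Z 2 1 0)) ((mk (wires 1) ⊠ s₂) ⨟ mk (Z 2 1 0)) 1, seq_assoc _ (((mk (wires 1) ⊠ s₁) ⨟ mk (Z 2 1 0)) ⊠ mk (wires 1)) (mk (Z 2 1 0)), mergeState_par_seq_merge,
      seq_assoc (mk (Z 2 1 0) ⊠ mk (wires 1)) (((mk (wires 1) ⊠ s₂) ⨟ mk (Z 2 1 0)) ⊠ mk (wires 1)) _, ← seq_assoc (((mk (wires 1) ⊠ s₂) ⨟ mk (Z 2 1 0)) ⊠ mk (wires 1)) (mk (Z 2 1 0)) ((mk (wires 1) ⊠ s₁) ⨟ mk (Z 2 1 0)), mergeState_par_seq_merge,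
      ← seq_assoc (mk (Z 2 1 0) ⊠ mk (wires 1)) _ ((mk (wires 1) ⊠ s₁) ⨟ mk (Z 2 1 0)), ← seq_assoc (mk (Z 2 1 0) ⊠ mk (wires 1)) (mk (Z 2 1 0)) ((mk (wires 1) ⊠ s₂) ⨟ mk (Z 2 1 0)), Z_par_seq_Z 2 1 1 1 le_rfl, add_zero (0 : ZMod 8)]
  -- right: `Z^{(3,1)} ⨾ M(s₁) ⨾ M(s₂)`
  have hR1 : (((mk (wires 1) ⊠ mk (wires 1)) ⊠ s₁) ⊠ s₂) ⨟ mk (Z 4 1 0) = mk (Z 2 1 0) ⨟ ((mk (wires 1) ⊠ s₁) ⨟ mk (Z 2 1 0)) ⨟ ((mk (wires 1) ⊠ s₂) ⨟ mk (Z 2 1 0)) := by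
    rw [wires_par_wires, show mk (Z 4 1 0) = (mk (Z 3 1 0) ⊠ mk (wires 1)) ⨟ mk (Z 2 1 0) from by rw [Z_par_seq_Z 3 1 1 1 le_rfl, add_zero], ← seq_assoc, interchange, seq_id,
      show mk (Z 3 1 0) = (mk (Z 2 1 0) ⊠ mk (wires 1)) ⨟ mk (Z 2 1 0) from by rw [Z_par_seq_Z 2 1 1 1 le_rfl, add_zero], ← seq_assoc (mk (wires 2) ⊠ s₁), interchange, id_seq, seq_id,
      show mk (Z 2 1 0) ⊠ s₁ = mk (Z 2 1 0) ⨟ (mk (wires 1) ⊠ s₁) from by rw [par_eq_seq_left (mk (Z 2 1 0)) s₁, par_empty], seq_assoc (mk (Z 2 1 0)),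
      show (mk (Z 2 1 0) ⨟ ((mk (wires 1) ⊠ s₁) ⨟ mk (Z 2 1 0))) ⊠ s₂ = (mk (Z 2 1 0) ⨟ ((mk (wires 1) ⊠ s₁) ⨟ mk (Z 2 1 0))) ⨟ (mk (wires 1) ⊠ s₂) from by rw [par_eq_seq_left (mk (Z 2 1 0) ⨟ ((mk (wires 1) ⊠ s₁) ⨟ mk (Z 2 1 0))) s₂, par_empty],
      seq_assoc, seq_assoc, seq_assoc]
  rw [hL, seq_assoc (mk (wires 1) ⊠ mk swap), hR1, ← seq_assoc (mk (Z 2 1 0) ⊠ mk (wires 1)) _ ((mk (wires 1) ⊠ s₂) ⨟ mk (Z 2 1 0)), ← seq_assoc (mk (Z 2 1 0) ⊠ mk (wires 1)) (mk (Z 2 1 0)) ((mk (wires 1) ⊠ s₁) ⨟ mk (Z 2 1 0)),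
    Z_par_seq_Z 2 1 1 1 le_rfl, add_zero (0 : ZMod 8), ← seq_assoc (mk (wires 1) ⊠ mk swap) _ ((mk (wires 1) ⊠ s₂) ⨟ mk (Z 2 1 0)), ← seq_assoc (mk (wires 1) ⊠ mk swap) _ ((mk (wires 1) ⊠ s₁) ⨟ mk (Z 2 1 0)),
    par_swap_seq_Z_three_one, seq_assoc, mergeState_comm s₂ s₁, ← seq_assoc]

/-- **The tail of the left-hand side equals the tail of rule (C)'s side** (figs. `…-proof-fin_03/04`): the swap of the square's
output with the root's second leg, the rest of the transposed rung (`Z(π/4)`, the leaf, the gadget node), the merge with the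
pendant and that leg, the `π`-leaf of the second input and the final merge equal the swap of the last two wires followed by the
last layers of rule (C) (`Z(π/4)`, the two leaves, the merge) and the final four-legged merge with the pendant and the hanging
gadget. [cite: JeandelPerdrixVilmart2018, Fig. 1 (S1), §2.2, proof of Appendix Lemma 34] -/
theorem tailL_eq_tailP (b : ZMod 8) : ((mk swap ⊠ mk (wires 1)) ⨟ ((mk (wires 1) ⊠ (mk (Z 1 1 1) ⨟ mk (xLeafL 0 1) ⨟ (mk (Z 1 2 0) ⨟ (mk (wires 1) ⊠ (mk (X 1 2 0) ⨟ (mk (Z 1 0 (-1)) ⊠ mk (Z 1 0 (-1)))))))) ⊠ mk (wires 1)) ⨟ ((((mk (Z 0 1 0) ⨟ mk triangle) ⊠ mk (wires 2)) ⨟ mk (Z 3 1 0)) ⊠ mk (X 1 2 4)) ⨟ (mk (Z 2 1 0) ⊠ mk (Z 1 0 b))) = (mk (wires 1) ⊠ mk swap) ⨟ ((((mk (Z 1 1 1) ⊠ mk (wires 1)) ⨟ (mk (xLeafL 0 1) ⊠ mk (xLeafR 4 b)) ⨟ mk (Z 2 1 0)) ⊠ mk (wires 1)) ⨟ ((((mk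 (wires 1) ⊠ mk (wires 1)) ⊠ (mk (Z 0 1 0) ⨟ mk triangle)) ⊠ ((mk (Z 0 1 (-1)) ⊠ mk (Z 0 1 (-1))) ⨟ mk (X 2 1 0))) ⨟ mk (Z 4 1 0))) := by
  -- the swap is absorbed by the three-legged merge with the pendant
  have hsw : mk swap ⨟ (((mk (Z 0 1 0) ⨟ mk triangle) ⊠ mk (wires 2)) ⨟ mk (Z 3 1 0)) = (((mk (Z 0 1 0) ⨟ mk triangle) ⊠ mk (wires 2)) ⨟ mk (Z 3 1 0)) := by
    rw [← seq_assoc, show mk swap ⨟ ((mk (Z 0 1 0) ⨟ mk triangle) ⊠ mk (wires 2)) = ((mk (Z 0 1 0) ⨟ mk triangle) ⊠ mk (wires 2)) ⨟ (mk (wires 1) ⊠ mk swap) from by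
      rw [← par_eq_seq_left (mk (Z 0 1 0) ⨟ mk triangle) (mk swap), par_eq_seq_right (mk (Z 0 1 0) ⨟ mk triangle) (mk swap), empty_par, cast_id], seq_assoc, par_swap_seq_Z_three_one]
  have h1 : (mk swap ⊠ mk (wires 1)) ⨟ ((mk (wires 1) ⊠ (mk (Z 1 1 1) ⨟ mk (xLeafL 0 1) ⨟ (mk (Z 1 2 0) ⨟ (mk (wires 1) ⊠ (mk (X 1 2 0) ⨟ (mk (Z 1 0 (-1)) ⊠ mk (Z 1 0 (-1)))))))) ⊠ mk (wires 1)) ⨟ ((((mk (Z 0 1 0) ⨟ mk triangle) ⊠ mk (wires 2)) ⨟ mk (Z 3 1 0)) ⊠ mk (X 1 2 4)) = (((mk (Z 1 1 1) ⨟ mk (xLeafL 0 1) ⨟ (mk (Z 1 2 0) ⨟ (mk (wires 1) ⊠ (mk (X 1 2 0) ⨟ (mk (Z 1 0 (-1)) ⊠ mk (Z 1 0 (-1))))))) ⊠ mk (wires 1)) ⊠ mk (wires 1)) ⨟ ((((mk (Z 0 1 0) ⨟ mk triangle) ⊠ mk (wires 2)) ⨟ mk (Z 3 1 0)) ⊠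 mk (X 1 2 4)) := by
    rw [← seq_par_wires, swap_seq_par_one_one, seq_par_wires, seq_assoc, interchange, hsw, id_seq]
  -- the `π`-copy of the second input and its `β`-effect form the leaf of rule (C)
  have h2 : ((((mk (Z 0 1 0) ⨟ mk triangle) ⊠ mk (wires 2)) ⨟ mk (Z 3 1 0)) ⊠ mk (X 1 2 4)) ⨟ (mk (Z 2 1 0) ⊠ mk (Z 1 0 b)) = ((((mk (Z 0 1 0) ⨟ mk triangle) ⊠ mk (wires 2)) ⨟ mk (Z 3 1 0)) ⊠ mk (xLeafR 4 b)) ⨟ mk (Z 2 1 0) := by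
    rw [show mk (Z 2 1 0) ⊠ mk (Z 1 0 b) = (mk (wires 2) ⊠ mk (Z 1 0 b)) ⨟ mk (Z 2 1 0) from by rw [par_eq_seq_right (mk (Z 2 1 0)) (mk (Z 1 0 b)), par_empty], ← seq_assoc,
      ← wires_par_wires 1 1, show (mk (wires 1) ⊠ mk (wires 1)) ⊠ mk (Z 1 0 b) = mk (wires 1) ⊠ (mk (wires 1) ⊠ mk (Z 1 0 b)) from (par_assoc _ _ _).trans (cast_id _ _ _), interchange, seq_id,
      show mk (X 1 2 4) ⨟ (mk (wires 1) ⊠ mk (Z 1 0 b)) = mk (xLeafR 4 b) from rfl]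
  -- the gadget node is the hanging gadget merged; the maps on the first and last wires come out in front
  have h3 : (((mk (Z 1 1 1) ⨟ mk (xLeafL 0 1) ⨟ (mk (Z 1 2 0) ⨟ (mk (wires 1) ⊠ (mk (X 1 2 0) ⨟ (mk (Z 1 0 (-1)) ⊠ mk (Z 1 0 (-1))))))) ⊠ mk (wires 1)) ⊠ mk (wires 1)) ⨟ ((((mk (Z 0 1 0) ⨟ mk triangle) ⊠ mk (wires 2)) ⨟ mk (Z 3 1 0)) ⊠ mk (xLeafR 4 b)) ⨟ mk (Z 2 1 0) =
      (((mk (Z 1 1 1) ⨟ mk (xLeafL 0 1)) ⊠ mk (wires 1)) ⊠ mk (xLeafR 4 b)) ⨟ ((((((mk (wires 1) ⊠ ((mk (Z 0 1 (-1)) ⊠ mk (Z 0 1 (-1))) ⨟ mk (X 2 1 0))) ⨟ mk (Z 2 1 0)) ⊠ mk (wires 1)) ⨟ (((mk (Z 0 1 0) ⨟ mk triangle) ⊠ mk (wires 2)) ⨟ mk (Z 3 1 0))) ⊠ mk (wires 1)) ⨟ mk (Z 2 1 0)) := by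
    rw [interchange ((mk (Z 1 1 1) ⨟ mk (xLeafL 0 1) ⨟ (mk (Z 1 2 0) ⨟ (mk (wires 1) ⊠ (mk (X 1 2 0) ⨟ (mk (Z 1 0 (-1)) ⊠ mk (Z 1 0 (-1))))))) ⊠ mk (wires 1)) (((mk (Z 0 1 0) ⨟ mk triangle) ⊠ mk (wires 2)) ⨟ mk (Z 3 1 0)) (mk (wires 1)) (mk (xLeafR 4 b)), id_seq, ← par_gadget_transpose_seq_merge (-1), seq_par_wires (mk (Z 1 1 1) ⨟ mk (xLeafL 0 1)) ((mk (wires 1) ⊠ ((mk (Z 0 1 (-1)) ⊠ mk (Z 0 1 (-1))) ⨟ mk (X 2 1 0))) ⨟ mk (Z 2 1 0)) 1, seq_assoc ((mk (Z 1 1 1) ⨟ mk (xLeafL 0 1)) ⊠ mk (wires 1)),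
      show (((mk (Z 1 1 1) ⨟ mk (xLeafL 0 1)) ⊠ mk (wires 1)) ⨟ ((((mk (wires 1) ⊠ ((mk (Z 0 1 (-1)) ⊠ mk (Z 0 1 (-1))) ⨟ mk (X 2 1 0))) ⨟ mk (Z 2 1 0)) ⊠ mk (wires 1)) ⨟ (((mk (Z 0 1 0) ⨟ mk triangle) ⊠ mk (wires 2)) ⨟ mk (Z 3 1 0)))) ⊠ mk (xLeafR 4 b) = (((mk (Z 1 1 1) ⨟ mk (xLeafL 0 1)) ⊠ mk (wires 1)) ⊠ mk (xLeafR 4 b)) ⨟ (((((mk (wires 1) ⊠ ((mk (Z 0 1 (-1)) ⊠ mk (Z 0 1 (-1))) ⨟ mk (X 2 1 0))) ⨟ mk (Z 2 1 0)) ⊠ mk (wires 1)) ⨟ (((mk (Z 0 1 0) ⨟ mk triangle) ⊠ mk (wires 2)) ⨟ mk (Z 3 1 0))) ⊠ mk (wires 1)) from by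
        rw [← seq_id (mk (xLeafR 4 b)), ← interchange, seq_id], seq_assoc]
  -- the maps pass the swap; the merges are `mergeStates_perm`
  have h4 : (((mk (Z 1 1 1) ⨟ mk (xLeafL 0 1)) ⊠ mk (wires 1)) ⊠ mk (xLeafR 4 b)) ⨟ (mk (wires 1) ⊠ mk swap) = (mk (wires 1) ⊠ mk swap) ⨟ (((mk (Z 1 1 1) ⨟ mk (xLeafL 0 1)) ⊠ mk (xLeafR 4 b)) ⊠ mk (wires 1)) := by
    rw [show ((mk (Z 1 1 1) ⨟ mk (xLeafL 0 1)) ⊠ mk (wires 1)) ⊠ mk (xLeafR 4 b) = (mk (Z 1 1 1) ⨟ mk (xLeafL 0 1)) ⊠ (mk (wires 1) ⊠ mk (xLeafR 4 b)) from (par_assoc _ _ _).trans (cast_id _ _ _), interchange, seq_id, ← swap_seq_par_one_one,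
      show (mk (Z 1 1 1) ⨟ mk (xLeafL 0 1)) ⊠ (mk swap ⨟ (mk (xLeafR 4 b) ⊠ mk (wires 1))) = (mk (wires 1) ⊠ mk swap) ⨟ ((mk (Z 1 1 1) ⨟ mk (xLeafL 0 1)) ⊠ (mk (xLeafR 4 b) ⊠ mk (wires 1))) from by rw [interchange, id_seq],
      show (mk (Z 1 1 1) ⨟ mk (xLeafL 0 1)) ⊠ (mk (xLeafR 4 b) ⊠ mk (wires 1)) = ((mk (Z 1 1 1) ⨟ mk (xLeafL 0 1)) ⊠ mk (xLeafR 4 b)) ⊠ mk (wires 1) from (par_assoc' _ _ _).trans (cast_id _ _ _)]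
  rw [h1, seq_assoc, h2, ← seq_assoc, h3, mergeStates_perm, seq_assoc (mk (wires 1) ⊠ mk swap) (mk (Z 2 1 0) ⊠ mk (wires 1)) ((((mk (wires 1) ⊠ mk (wires 1)) ⊠ (mk (Z 0 1 0) ⨟ mk triangle)) ⊠ ((mk (Z 0 1 (-1)) ⊠ mk (Z 0 1 (-1))) ⨟ mk (X 2 1 0))) ⨟ mk (Z 4 1 0)),
    ← seq_assoc (((mk (Z 1 1 1) ⨟ mk (xLeafL 0 1)) ⊠ mk (wires 1)) ⊠ mk (xLeafR 4 b)) (mk (wires 1) ⊠ mk swap) _, h4, seq_assoc (mk (wires 1) ⊠ mk swap) (((mk (Z 1 1 1) ⨟ mk (xLeafL 0 1)) ⊠ mk (xLeafR 4 b)) ⊠ mk (wires 1)) _,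
    ← seq_assoc (((mk (Z 1 1 1) ⨟ mk (xLeafL 0 1)) ⊠ mk (xLeafR 4 b)) ⊠ mk (wires 1)) (mk (Z 2 1 0) ⊠ mk (wires 1)) ((((mk (wires 1) ⊠ mk (wires 1)) ⊠ (mk (Z 0 1 0) ⨟ mk triangle)) ⊠ ((mk (Z 0 1 (-1)) ⊠ mk (Z 0 1 (-1))) ⨟ mk (X 2 1 0))) ⨟ mk (Z 4 1 0)), ← seq_par_wires,
    show (mk (Z 1 1 1) ⨟ mk (xLeafL 0 1)) ⊠ mk (xLeafR 4 b) = (mk (Z 1 1 1) ⊠ mk (wires 1)) ⨟ (mk (xLeafL 0 1) ⊠ mk (xLeafR 4 b)) from by rw [interchange, id_seq]]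

/-! ### Appendix Lemma 34, main computation: the rule-(C) side regrouped (fig. `…-proof-fin_04`) -/

/-- Regrouping (bookkeeping): `(A ⊗ 𝕀) ⊗ 𝕀 = A ⊗ 𝕀²` for `A : 3 → 2`. [folklore] -/
private theorem rg32 (A : ZXClass 3 2) : (A ⊠ mk (wires 1)) ⊠ mk (wires 1) = A ⊠ mk (wires 2) := by
  rw [← wires_par_wires 1 1]; exact (par_assoc _ _ _).trans (cast_id _ _ _)

/-- Regrouping (bookkeeping): `(A ⊗ 𝕀) ⊗ 𝕀 = A ⊗ 𝕀²` for `A : 2 → 2`. [folklore] -/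
private theorem rg22 (A : ZXClass 2 2) : (A ⊠ mk (wires 1)) ⊠ mk (wires 1) = A ⊠ mk (wires 2) := by
  rw [← wires_par_wires 1 1]; exact (par_assoc _ _ _).trans (cast_id _ _ _)

/-- Regrouping (bookkeeping): `(A ⊗ 𝕀) ⊗ 𝕀 = A ⊗ 𝕀²` for `A : 1 → 1`. [folklore] -/
private theorem rg11 (A : ZXClass 1 1) : (A ⊠ mk (wires 1)) ⊠ mk (wires 1) = A ⊠ mk (wires 2) := by
  rw [← wires_par_wires 1 1]; exact (par_assoc _ _ _).trans (cast_id _ _ _)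

/-- **The diagram of rule (C) with first angle `π/4`, factored**: the phases of its two red merges pulled onto the first and
third inputs (the third input copied with the second angle first), then its phase-free first layers (`square31`'s square),
then `Z(π/4)`, the two leaves and the merge. [cite: JeandelPerdrixVilmart2018, Fig. 1 rule (C)] -/
theorem cGen_factor (b t u : ZMod 8) :
    (((mk (wires 1) ⊠ mk (Z 1 2 0)) ⊠ mk (wires 1)) ⨟ ((mk (X 2 1 t) ⊠ mk (wires 1)) ⊠ mk (Z 1 2 b)) ⨟ ((mk (wires 1) ⊠ mk (X 2 1 u)) ⊠ mk (wires 1)) ⨟ (mk (Z 2 1 1) ⊠ mk (wires 1)) ⨟ (mk (xLeafL 0 1) ⊠ mk (xLeafR 4 b)) ⨟ mk (Z 2 1 0)) = ((mk (X 1 1 t) ⊠ mk (wires 1)) ⊠ (mk (Z 1 2 b) ⨟ (mk (X 1 1 u) ⊠ mk (wires 1)))) ⨟ ((((mk (wires 1) ⊠ mk (Z 1 2 0)) ⊠ mk (wires 1)) ⨟ ((mk (X 2 1 0) ⊠ mk (wires 1)) ⊠ mk (wires 1)) ⨟ (mk (wires 1) ⊠ mk (X 2 1 0)) ⨟ mk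 (Z 2 1 0)) ⊠ mk (wires 1)) ⨟ ((mk (Z 1 1 1) ⊠ mk (wires 1)) ⨟ (mk (xLeafL 0 1) ⊠ mk (xLeafR 4 b)) ⨟ mk (Z 2 1 0)) := by
  have e2 : (((mk (X 1 1 t) ⊠ mk (wires 1)) ⨟ mk (X 2 1 0)) ⊠ mk (wires 1)) ⊠ mk (Z 1 2 b) = (((mk (X 1 1 t) ⊠ mk (wires 1)) ⊠ mk (wires 1)) ⊠ mk (wires 1)) ⨟ ((mk (X 2 1 0) ⊠ mk (wires 1)) ⊠ mk (Z 1 2 b)) := by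
    rw [seq_par_wires, ← id_seq (mk (Z 1 2 b)), ← interchange, id_seq]
  have e3 : (mk (wires 1) ⊠ ((mk (wires 1) ⊠ mk (X 1 1 u)) ⨟ mk (X 2 1 0))) ⊠ mk (wires 1) = ((mk (wires 2) ⊠ mk (X 1 1 u)) ⊠ mk (wires 1)) ⨟ ((mk (wires 1) ⊠ mk (X 2 1 0)) ⊠ mk (wires 1)) := by
    rw [wires_par_seq, seq_par_wires, show mk (wires 1) ⊠ (mk (wires 1) ⊠ mk (X 1 1 u)) = mk (wires 2) ⊠ mk (X 1 1 u) from by rw [← wires_par_wires 1 1]; exact (par_assoc' _ _ _).trans (cast_id _ _ _)]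
  have c1 : ∀ R' : ZXClass 4 1, ((mk (wires 1) ⊠ mk (Z 1 2 0)) ⊠ mk (wires 1)) ⨟ ((((mk (X 1 1 t) ⊠ mk (wires 1)) ⊠ mk (wires 1)) ⊠ mk (wires 1)) ⨟ R') = ((mk (X 1 1 t) ⊠ mk (wires 1)) ⊠ mk (wires 1)) ⨟ (((mk (wires 1) ⊠ mk (Z 1 2 0)) ⊠ mk (wires 1)) ⨟ R') := fun R' => by
    rw [← seq_assoc, ← seq_assoc, show ((mk (X 1 1 t) ⊠ mk (wires 1)) ⊠ mk (wires 1)) ⊠ mk (wires 1) = (mk (X 1 1 t) ⊠ mk (wires 2)) ⊠ mk (wires 1) from congrArg (· ⊠ mk (wires 1)) (rg11 _), interchange, id_seq,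
      interchange, id_seq, seq_id, par_eq_seq_left (mk (X 1 1 t)) (mk (Z 1 2 0)), seq_par_wires]
  have c2 : ∀ R' : ZXClass 4 1, ((mk (X 2 1 0) ⊠ mk (wires 1)) ⊠ mk (Z 1 2 b)) ⨟ (((mk (wires 2) ⊠ mk (X 1 1 u)) ⊠ mk (wires 1)) ⨟ R') = (mk (wires 3) ⊠ (mk (Z 1 2 b) ⨟ (mk (X 1 1 u) ⊠ mk (wires 1)))) ⨟ (((mk (X 2 1 0) ⊠ mk (wires 1)) ⊠ mk (wires 1)) ⊠ mk (wires 1)) ⨟ R' := fun R' => by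
    rw [← seq_assoc, show (mk (wires 2) ⊠ mk (X 1 1 u)) ⊠ mk (wires 1) = mk (wires 2) ⊠ (mk (X 1 1 u) ⊠ mk (wires 1)) from (par_assoc _ _ _).trans (cast_id _ _ _), interchange, seq_id,
      par_eq_seq_right (mk (X 2 1 0) ⊠ mk (wires 1)) (mk (Z 1 2 b) ⨟ (mk (X 1 1 u) ⊠ mk (wires 1))), rg32]
  have c3 : ∀ R' : ZXClass 5 1, ((mk (wires 1) ⊠ mk (Z 1 2 0)) ⊠ mk (wires 1)) ⨟ ((mk (wires 3) ⊠ (mk (Z 1 2 b) ⨟ (mk (X 1 1 u) ⊠ mk (wires 1)))) ⨟ R') = (mk (wires 2) ⊠ (mk (Z 1 2 b) ⨟ (mk (X 1 1 u) ⊠ mk (wires 1)))) ⨟ ((((mk (wires 1) ⊠ mk (Z 1 2 0)) ⊠ mk (wires 1)) ⊠ mk (wires 1)) ⨟ R') := fun R' => by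
    rw [← seq_assoc, ← seq_assoc, ← wires_par_wires 1 2, interchange, wires_par_wires, seq_id, id_seq, par_eq_seq_right (mk (wires 1) ⊠ mk (Z 1 2 0)) (mk (Z 1 2 b) ⨟ (mk (X 1 1 u) ⊠ mk (wires 1))), rg23]
  have c4 : ∀ R' : ZXClass 4 1, ((mk (X 1 1 t) ⊠ mk (wires 1)) ⊠ mk (wires 1)) ⨟ ((mk (wires 2) ⊠ (mk (Z 1 2 b) ⨟ (mk (X 1 1 u) ⊠ mk (wires 1)))) ⨟ R') = ((mk (X 1 1 t) ⊠ mk (wires 1)) ⊠ (mk (Z 1 2 b) ⨟ (mk (X 1 1 u) ⊠ mk (wires 1)))) ⨟ R' := fun R' => by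
    rw [← seq_assoc, ← par_eq_seq_left]
  have c5 : ∀ K : ZXClass 2 1, (((mk (wires 1) ⊠ mk (Z 1 2 0)) ⊠ mk (wires 1)) ⊠ mk (wires 1)) ⨟ ((((mk (X 2 1 0) ⊠ mk (wires 1)) ⊠ mk (wires 1)) ⊠ mk (wires 1)) ⨟ (((mk (wires 1) ⊠ mk (X 2 1 0)) ⊠ mk (wires 1)) ⨟ ((mk (Z 2 1 0) ⊠ mk (wires 1)) ⨟ K))) = ((((mk (wires 1) ⊠ mk (Z 1 2 0)) ⊠ mk (wires 1)) ⨟ (((mk (X 2 1 0) ⊠ mk (wires 1)) ⊠ mk (wires 1)) ⨟ ((mk (wires 1) ⊠ mk (X 2 1 0)) ⨟ mk (Z 2 1 0)))) ⊠ mk (wires 1)) ⨟ K := fun K => by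
    rw [← seq_assoc ((mk (wires 1) ⊠ mk (X 2 1 0)) ⊠ mk (wires 1)) (mk (Z 2 1 0) ⊠ mk (wires 1)) K, ← seq_par_wires, ← seq_assoc (((mk (X 2 1 0) ⊠ mk (wires 1)) ⊠ mk (wires 1)) ⊠ mk (wires 1)) _ K, ← seq_par_wires, ← seq_assoc (((mk (wires 1) ⊠ mk (Z 1 2 0)) ⊠ mk (wires 1)) ⊠ mk (wires 1)) _ K, ← seq_par_wires]
  rw [show mk (X 2 1 t) = (mk (X 1 1 t) ⊠ mk (wires 1)) ⨟ mk (X 2 1 0) from by rw [X_par_seq_X 1 1 1 1 le_rfl, add_zero],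
    show mk (X 2 1 u) = (mk (wires 1) ⊠ mk (X 1 1 u)) ⨟ mk (X 2 1 0) from by rw [par_X_seq_X 1 1 1 1 le_rfl, zero_add],
    show mk (Z 2 1 1) = mk (Z 2 1 0) ⨟ mk (Z 1 1 1) from by rw [Z_seq_Z 2 1 1 le_rfl, zero_add], e2, e3, seq_par_wires (mk (Z 2 1 0)) (mk (Z 1 1 1)) 1]
  simp only [seq_assoc]
  rw [c1, c2, seq_assoc, c3, c4, c5]

/-- Regrouping (bookkeeping): `(A ⊗ 𝕀) ⊗ 𝕀 = A ⊗ 𝕀²` for `A : 3 → 1`. [folklore] -/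
private theorem rg31 (A : ZXClass 3 1) : (A ⊠ mk (wires 1)) ⊠ mk (wires 1) = A ⊠ mk (wires 2) := by
  rw [← wires_par_wires 1 1]; exact (par_assoc _ _ _).trans (cast_id _ _ _)

/-- **The rule-(C) side of the main computation regrouped** (fig. `…-proof-fin_04`): the root state inserted between the inputs,
its second leg routed past the second input, the factored diagram of rule (C) and the final merge equal the common prefix,
the phase-free layers, the swap of the last two wires and the tail of `tailL_eq_tailP`.
[cite: JeandelPerdrixVilmart2018, Fig. 1 rule (C), §2.2, proof of Appendix Lemma 34] -/
theorem plugCore_eq (a b t u : ZMod 8) :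
    (((mk (wires 1) ⊠ (mk (X 0 1 a) ⨟ mk (Z 1 2 0) ⨟ (mk (X 1 1 2) ⊠ mk (X 1 1 a)))) ⊠ mk (wires 1)) ⨟ ((mk (wires 1) ⊠ mk (wires 1)) ⊠ mk swap) ⨟ ((((mk (wires 1) ⊠ mk (Z 1 2 0)) ⊠ mk (wires 1)) ⨟ ((mk (X 2 1 t) ⊠ mk (wires 1)) ⊠ mk (Z 1 2 b)) ⨟ ((mk (wires 1) ⊠ mk (X 2 1 u)) ⊠ mk (wires 1)) ⨟ (mk (Z 2 1 1) ⊠ mk (wires 1)) ⨟ (mk (xLeafL 0 1) ⊠ mk (xLeafR 4 b)) ⨟ mk (Z 2 1 0)) ⊠ mk (wires 1)) ⨟ ((((mk (wires 1) ⊠ mk (wires 1)) ⊠ (mk (Z 0 1 0) ⨟ mk triangle)) ⊠ ((mk (Z 0 1 (-1)) ⊠ mk (Z 0 1 (-1))) ⨟ mk (X 2 1 0))) ⨟ mk (Z 4 1 0))) = ((mk (X 1 1 t) ⊠ (mk (Z 1 2 b) ⨟ (mk (X 1 1 u) ⊠ mk (wires 1)))) ⨟ ((mk (wires 1) ⊠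 (mk (X 0 1 a) ⨟ mk (Z 1 2 0) ⨟ (mk (X 1 1 2) ⊠ mk (X 1 1 a)))) ⊠ mk (wires 2)) ⨟ ((mk (wires 2) ⊠ mk swap) ⊠ mk (wires 1))) ⨟ (((((mk (wires 1) ⊠ mk (Z 1 2 0)) ⊠ mk (wires 1)) ⨟ ((mk (X 2 1 0) ⊠ mk (wires 1)) ⊠ mk (wires 1)) ⨟ (mk (wires 1) ⊠ mk (X 2 1 0)) ⨟ mk (Z 2 1 0)) ⊠ mk (wires 1)) ⊠ mk (wires 1)) ⨟ ((mk (wires 1) ⊠ mk swap) ⨟ ((((mk (Z 1 1 1) ⊠ mk (wires 1)) ⨟ (mk (xLeafL 0 1) ⊠ mk (xLeafR 4 b)) ⨟ mk (Z 2 1 0)) ⊠ mk (wires 1)) ⨟ ((((mk (wires 1) ⊠ mk (wires 1)) ⊠ (mk (Z 0 1 0) ⨟ mk triangle)) ⊠ ((mk (Z 0 1 (-1)) ⊠ mk (Z 0 1 (-1))) ⨟ mk (X 2 1 0))) ⨟ mk (Z 4 1 0)))) := by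
  have hnat := fswap1_nat ((mk (Z 1 2 b) ⨟ (mk (X 1 1 u) ⊠ mk (wires 1))))
  rw [fswap1_one, fswap1_two] at hnat
  have k1 : ∀ R' : ZXClass 5 1, ((mk (wires 1) ⊠ mk (wires 1)) ⊠ mk swap) ⨟ ((((mk (X 1 1 t) ⊠ mk (wires 1)) ⊠ (mk (Z 1 2 b) ⨟ (mk (X 1 1 u) ⊠ mk (wires 1)))) ⊠ mk (wires 1)) ⨟ R') = ((mk (X 1 1 t) ⊠ mk (wires 1)) ⊠ (mk (wires 1) ⊠ (mk (Z 1 2 b) ⨟ (mk (X 1 1 u) ⊠ mk (wires 1))))) ⨟ ((mk (wires 2) ⊠ ((mk swap ⊠ mk (wires 1)) ⨟ (mk (wires 1) ⊠ mk swap))) ⨟ R') := fun R' => by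
    rw [← seq_assoc, ← seq_assoc, wires_par_wires, show ((mk (X 1 1 t) ⊠ mk (wires 1)) ⊠ (mk (Z 1 2 b) ⨟ (mk (X 1 1 u) ⊠ mk (wires 1)))) ⊠ mk (wires 1) = (mk (X 1 1 t) ⊠ mk (wires 1)) ⊠ ((mk (Z 1 2 b) ⨟ (mk (X 1 1 u) ⊠ mk (wires 1))) ⊠ mk (wires 1)) from (par_assoc _ _ _).trans (cast_id _ _ _),
      interchange, id_seq, hnat, show (mk (X 1 1 t) ⊠ mk (wires 1)) ⊠ ((mk (wires 1) ⊠ (mk (Z 1 2 b) ⨟ (mk (X 1 1 u) ⊠ mk (wires 1)))) ⨟ ((mk swap ⊠ mk (wires 1)) ⨟ (mk (wires 1) ⊠ mk swap))) = ((mk (X 1 1 t) ⊠ mk (wires 1)) ⊠ (mk (wires 1) ⊠ (mk (Z 1 2 b) ⨟ (mk (X 1 1 u) ⊠ mk (wires 1))))) ⨟ (mk (wires 2) ⊠ ((mk swap ⊠ mk (wires 1)) ⨟ (mk (wires 1) ⊠ mk swap))) from by rw [interchange, seq_id]]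
  have k2 : ∀ R' : ZXClass 5 1, ((mk (wires 1) ⊠ (mk (X 0 1 a) ⨟ (mk (Z 1 2 0) ⨟ (mk (X 1 1 2) ⊠ mk (X 1 1 a))))) ⊠ mk (wires 1)) ⨟ (((mk (X 1 1 t) ⊠ mk (wires 1)) ⊠ (mk (wires 1) ⊠ (mk (Z 1 2 b) ⨟ (mk (X 1 1 u) ⊠ mk (wires 1))))) ⨟ R') = (mk (X 1 1 t) ⊠ (mk (Z 1 2 b) ⨟ (mk (X 1 1 u) ⊠ mk (wires 1)))) ⨟ (((mk (wires 1) ⊠ (mk (X 0 1 a) ⨟ (mk (Z 1 2 0) ⨟ (mk (X 1 1 2) ⊠ mk (X 1 1 a))))) ⊠ mk (wires 2)) ⨟ R') := fun R' => by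
    rw [← seq_assoc, show (mk (X 1 1 t) ⊠ mk (wires 1)) ⊠ (mk (wires 1) ⊠ (mk (Z 1 2 b) ⨟ (mk (X 1 1 u) ⊠ mk (wires 1)))) = (mk (X 1 1 t) ⊠ mk (wires 2)) ⊠ (mk (Z 1 2 b) ⨟ (mk (X 1 1 u) ⊠ mk (wires 1))) from
        ((par_assoc' _ _ _).trans (cast_id _ _ _)).trans (congrArg (· ⊠ (mk (Z 1 2 b) ⨟ (mk (X 1 1 u) ⊠ mk (wires 1)))) (rg11 _)),
      interchange, id_seq, interchange, id_seq, seq_id, par_eq_seq_left (mk (X 1 1 t)) (mk (X 0 1 a) ⨟ (mk (Z 1 2 0) ⨟ (mk (X 1 1 2) ⊠ mk (X 1 1 a)))), par_empty,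
      show (mk (X 1 1 t) ⨟ (mk (wires 1) ⊠ (mk (X 0 1 a) ⨟ (mk (Z 1 2 0) ⨟ (mk (X 1 1 2) ⊠ mk (X 1 1 a)))))) ⊠ (mk (Z 1 2 b) ⨟ (mk (X 1 1 u) ⊠ mk (wires 1))) = (mk (X 1 1 t) ⊠ (mk (Z 1 2 b) ⨟ (mk (X 1 1 u) ⊠ mk (wires 1)))) ⨟ ((mk (wires 1) ⊠ (mk (X 0 1 a) ⨟ (mk (Z 1 2 0) ⨟ (mk (X 1 1 2) ⊠ mk (X 1 1 a))))) ⊠ mk (wires 2)) from by rw [interchange, seq_id], seq_assoc]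
  have k3 : ∀ R' : ZXClass 3 1, (mk (wires 2) ⊠ ((mk swap ⊠ mk (wires 1)) ⨟ (mk (wires 1) ⊠ mk swap))) ⨟ ((((((mk (wires 1) ⊠ mk (Z 1 2 0)) ⊠ mk (wires 1)) ⨟ (((mk (X 2 1 0) ⊠ mk (wires 1)) ⊠ mk (wires 1)) ⨟ ((mk (wires 1) ⊠ mk (X 2 1 0)) ⨟ mk (Z 2 1 0)))) ⊠ mk (wires 1)) ⊠ mk (wires 1)) ⨟ R') = ((mk (wires 2) ⊠ mk swap) ⊠ mk (wires 1)) ⨟ ((((((mk (wires 1) ⊠ mk (Z 1 2 0)) ⊠ mk (wires 1)) ⨟ (((mk (X 2 1 0) ⊠ mk (wires 1)) ⊠ mk (wires 1)) ⨟ ((mk (wires 1) ⊠ mk (X 2 1 0)) ⨟ mk (Z 2 1 0)))) ⊠ mk (wires 1)) ⊠ mk (wires 1)) ⨟ ((mk (wires 1) ⊠ mk swap) ⨟ R')) := fun R' => by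
    rw [wires_par_seq, show mk (wires 2) ⊠ (mk swap ⊠ mk (wires 1)) = (mk (wires 2) ⊠ mk swap) ⊠ mk (wires 1) from (par_assoc' _ _ _).trans (cast_id _ _ _),
      show mk (wires 2) ⊠ (mk (wires 1) ⊠ mk swap) = mk (wires 3) ⊠ mk swap from by rw [← wires_par_wires 2 1]; exact (par_assoc' _ _ _).trans (cast_id _ _ _),
      seq_assoc, ← seq_assoc (mk (wires 3) ⊠ mk swap), rg31, interchange, id_seq, seq_id,
      show (((mk (wires 1) ⊠ mk (Z 1 2 0)) ⊠ mk (wires 1)) ⨟ (((mk (X 2 1 0) ⊠ mk (wires 1)) ⊠ mk (wires 1)) ⨟ ((mk (wires 1) ⊠ mk (X 2 1 0)) ⨟ mk (Z 2 1 0)))) ⊠ mk swap = ((((mk (wires 1) ⊠ mk (Z 1 2 0)) ⊠ mk (wires 1)) ⨟ (((mk (X 2 1 0) ⊠ mk (wires 1)) ⊠ mk (wires 1)) ⨟ ((mk (wires 1) ⊠ mk (X 2 1 0)) ⨟ mk (Z 2 1 0)))) ⊠ mk (wires 2)) ⨟ (mk (wires 1) ⊠ mk swap) from by rw [interchange, seq_id,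 id_seq], seq_assoc]
  rw [cGen_factor, seq_par_wires _ ((mk (Z 1 1 1) ⊠ mk (wires 1)) ⨟ (mk (xLeafL 0 1) ⊠ mk (xLeafR 4 b)) ⨟ mk (Z 2 1 0)) 1, seq_par_wires ((mk (X 1 1 t) ⊠ mk (wires 1)) ⊠ (mk (Z 1 2 b) ⨟ (mk (X 1 1 u) ⊠ mk (wires 1)))) _ 1]
  simp only [seq_assoc]
  rw [k1, k2, k3]

/-- **Appendix Lemma 34, forward form (figs. `…-proof-fin_00–04`)**: for independent top and bridge phases `t, u`, the left-hand
side of Lemma 34 equals `1/√2 ⊗ √2 ⊗` the root state `G60(α)` inserted between the inputs, its second leg routed past the second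
input, the diagram of rule (C) with angles `(π/4, β)` and red phases `(t, u)` on (first input, first leg, second input), and the
final merge with that leg, the pendant `Z ⨾ T` and the hanging gadget.
[cite: JeandelPerdrixVilmart2018, Appendix, proof of Lemma 34 (figs. `…-proof-fin_00–04`)] -/
theorem L34_forward (a b t u : ZMod 8) : (mk (X 1 1 t) ⊠ mk (wires 1)) ⨟ (mk (Z 1 3 0) ⊠ mk (Z 1 2 b)) ⨟ (((mk (X 1 0 a) ⊠ mk (wires 1)) ⊠ ((mk (X 1 1 u) ⊠ mk (wires 1)) ⨟ mk cap)) ⊠ mk (wires 1)) ⨟ (mk (X 1 1 a) ⊠ mk (X 1 2 4)) ⨟ (mk (Z 2 1 0) ⊠ mk (Z 1 0 b)) = mk invSqrtTwo ⊠ (mk (dumbbell 0 0) ⊠ ((((mk (wires 1) ⊠ (mk (X 0 1 a) ⨟ mk (Z 1 2 0) ⨟ (mk (X 1 1 2) ⊠ mk (X 1 1 a)))) ⊠ mk (wires 1)) ⨟ ((mk (wires 1) ⊠ mk (wires 1)) ⊠ mk swap) ⨟ ((((mk (wires 1) ⊠ mk (Z 1 2 0)) ⊠ mk (wires 1)) ⨟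 ((mk (X 2 1 t) ⊠ mk (wires 1)) ⊠ mk (Z 1 2 b)) ⨟ ((mk (wires 1) ⊠ mk (X 2 1 u)) ⊠ mk (wires 1)) ⨟ (mk (Z 2 1 1) ⊠ mk (wires 1)) ⨟ (mk (xLeafL 0 1) ⊠ mk (xLeafR 4 b)) ⨟ mk (Z 2 1 0)) ⊠ mk (wires 1)) ⨟ ((((mk (wires 1) ⊠ mk (wires 1)) ⊠ (mk (Z 0 1 0) ⨟ mk triangle)) ⊠ ((mk (Z 0 1 (-1)) ⊠ mk (Z 0 1 (-1))) ⨟ mk (X 2 1 0))) ⨟ mk (Z 4 1 0))))) := by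
  rw [L34side_eq_TL, tailL_eq_tailP, plugCore_eq]

end ZXClass

end Literature.Computability.QuantumComplexity
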